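import Summits.QuantumFields.YangMills.Theorems.BalabanUVNodesN06Thm312313AtPinsStateSUCLE
import Literature.MathematicalPhysics.QuantumFieldTheory.Balaban1983to89.Node00.OpsYDelta2FormP
import Summits.QuantumFields.YangMills.Theorems.BalabanUVNodesN06Rgd2LegAtPinsPhysPU
import Literature.MathematicalPhysics.QuantumFieldTheory.Balaban1983to89.B9SectBStepUClosedSUOfSections
import Literature.MathematicalPhysics.QuantumFieldTheory.Balaban1983to89.Node00.OpsYExpsOfRecordV2
import Literature.MathematicalPhysics.QuantumFieldTheory.Balaban1983to89.Node00.OpsYOps312OfRecord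
import Literature.MathematicalPhysics.QuantumFieldTheory.Balaban1983to89.Node00.OpsYBondMapOfRecord
import Summits.QuantumFields.YangMills.Theorems.BalabanUVNodesN06G0QstarLettersLegAtPinsPU
import Literature.MathematicalPhysics.QuantumFieldTheory.Balaban1983to89.B9LeafXCodedKnitU
import Summits.QuantumFields.YangMills.Theorems.BalabanUVNodesN06Rgdd13AtPinsPUW
import Literature.MathematicalPhysics.QuantumFieldTheory.Balaban1983to89.B9Eq3132FromStateR
import Literature.MathematicalPhysics.QuantumFieldTheory.Balaban1983to89.B9RWSumsDefinitePinsPairMDir4Rows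
import Summits.QuantumFields.YangMills.Theorems.BalabanUVNodesN06G0LayerFromThm310AtPinsGUSP
import Summits.QuantumFields.YangMills.Theorems.BalabanUVNodesN06G0QstarL2LettersLegAtPinsPU
import Summits.QuantumFields.YangMills.Theorems.BalabanUVNodesN06RgdILegAtPinsPhysR
import Summits.QuantumFields.YangMills.Theorems.BalabanUVNodesN06RgdDsLegAtPinsPhysR
import Summits.QuantumFields.YangMills.Theorems.BalabanUVNodesN06DivLegAtPinsPhysR
import Summits.QuantumFields.YangMills.Theorems.BalabanUVNodesN06HHLegAtPinsPhysRU
import Summits.QuantumFields.YangMills.Theorems.BalabanUVNodesN06WGpLegAtPinsPhysPU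
import Summits.QuantumFields.YangMills.Theorems.BalabanUVNodesN06RgdH43LegAtPinsPhysPU
import Literature.MathematicalPhysics.QuantumFieldTheory.Balaban1983to89.B9PlaquetteBinderOfReg335Y
import Summits.QuantumFields.YangMills.Theorems.BalabanUVNodesN06CutL2LettersAtPinsPhysR
import Summits.QuantumFields.YangMills.Theorems.BalabanUVNodesN06DirKinematicsAtPinsR
import Summits.QuantumFields.YangMills.Theorems.BalabanUVNodesN06DirKinematics3AtPinsSN
import Summits.QuantumFields.YangMills.Theorems.BalabanUVNodesN06Proj349AtPinsPhysRC
import Literature.MathematicalPhysics.QuantumFieldTheory.Balaban1983to89.B9Ineq349SiteThresholdRateNamed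
import Literature.MathematicalPhysics.QuantumFieldTheory.Balaban1983to89.B9Thm31GpMajFromPinsPairMR
import Summits.QuantumFields.YangMills.Theorems.BalabanUVNodesN06CurrentMajAtPinsIdPhys
import Literature.MathematicalPhysics.QuantumFieldTheory.Balaban1983to89.B9Ineq349SiteFacesAtLettersR
import Literature.MathematicalPhysics.QuantumFieldTheory.Balaban1983to89.B9Thm314Thm315LayerR
import Summits.QuantumFields.YangMills.Theorems.BalabanUVNodesN06ProbeZeroAtPinsPhysR
import Summits.QuantumFields.YangMills.Theorems.BalabanUVNodesN06MixedLegAtPinsPhysR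
import Summits.QuantumFields.YangMills.Theorems.BalabanUVNodesN06MixedFactorAtPinsPhysR
import Summits.QuantumFields.YangMills.Theorems.BalabanUVNodesN06SplitMajorantsAtPinsPhysR
import Summits.QuantumFields.YangMills.Theorems.BalabanUVNodesN06StepL2AtPinsPhysR
import Summits.QuantumFields.YangMills.Theorems.BalabanUVNodesN06HgVacuousRC
import Literature.MathematicalPhysics.QuantumFieldTheory.Balaban1983to89.B9Thm39FacesAtLettersRC
import Literature.MathematicalPhysics.QuantumFieldTheory.Balaban1983to89.B9Thm315SectEStarRepAtLettersR
import Summits.QuantumFields.YangMills.Theorems.BalabanUVNodesN06WalkLettersAtRecordR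
import Summits.QuantumFields.YangMills.Theorems.BalabanUVNodesN06Row17FromRow19LettersDir
import Summits.QuantumFields.YangMills.Theorems.BalabanUVNodesN06Proj349AtPinsPhys
import Summits.QuantumFields.YangMills.Theorems.BalabanUVNodesN06SectBOfFrameV7
import Summits.QuantumFields.YangMills.Theorems.BalabanUVNodesN06SectDUnitsAtPinsPhys
import Literature.MathematicalPhysics.QuantumFieldTheory.Balaban1983to89.B9CoReadingCoordsHolderAdmReadings
import Literature.MathematicalPhysics.QuantumFieldTheory.Balaban1983to89.B9CoReadingCoordsHolderSAdmReadings
import Literature.MathematicalPhysics.QuantumFieldTheory.Balaban1983to89.B9CoReadingCoordsHolderSNearReadings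
import Literature.MathematicalPhysics.QuantumFieldTheory.Balaban1983to89.B9H43GpFromPinsSN
import Literature.MathematicalPhysics.QuantumFieldTheory.Balaban1983to89.B9H44GFromPinsSN
import Literature.MathematicalPhysics.QuantumFieldTheory.Balaban1983to89.B9H44mFromPinsKA
import Summits.QuantumFields.YangMills.Theorems.BalabanUVNodesN06DirKinematics3AtPins
import Summits.QuantumFields.YangMills.Theorems.BalabanUVNodesN06Ids3152AtPinsPhys

/-!
# BalabanUVNodes ∕ N06 ([B9], `Dag.B9_main`) — THE STAGE-11 CERTIFICATE, EDITION 111 «VL» = EDITION 109 «VJ» WITH THE RESIDUAL LETTERS OF RECORD PINNED (t2a, node00-def-Y ✓p763134 `Node00/OpsYDelta2FormP`): the displayed residual record `𝔯 : ResY …` (Δ⁽²⁾ of [Balaban1985BackgroundPropagators, (3.134) p.422]) is now node00-def-Y's `resYOfC2P N θ M⋆ 𝔠` — [5]'s second-order form `C⁽²⁾` as the displayed PARAMETER `𝔠 : C2Y …`, fed print's `G′_phys = η²·G′` — by ONE definitional equation `h𝔯 : 𝔯 = resYOfC2P … 𝔠` (the pattern of `h𝔈 ∕ h𝔬12 ∕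 hbI`, editions 79∕81∕83) plus ONE reality letter `h𝔠real` (the form commutes with `star` at SU(N)-valued configurations); the displayed symmetry schema `hΔ2` (`IsSymmTr ((𝔯 x).Δ2 U)` at SU(N)) is DERIVED as the proof's first line by `subst h𝔯; exact Node00.resYOfC2P_Δ2_isSymmTr_SU θ.toStage3Params Mstar 𝔠 h𝔠real` (def-Y FOLD RECIPE I.32338 (ii); `(bg9YR …).Cfg` unfolds to `CfgY`); the displayed `hD2sup` now reads `(resYOfC2P … 𝔠 x).Δ2 U ≡ delta2OfY (trDualMatY N) … (GpPhysY …) (𝔠 x).form U` (`resYOfC2P_Δ2`, rfl) = the object of dag-n06-l g33's ROAD P-D2 (next fold).  Everything else = edition 109 («VJ»: `hrgdd13` derived by `…N06Rgdd13AtPinsPUW` + dag-n06-c's `rgdd_of_pinsT`).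
CONE CENSUS (№289 (1)(b) ∕ №290 (1)(e)): raw-class Step letters remaining in the cone: 0 · unguarded Reg335-keyed binders remaining in the cone: 0 of print's thresholded species (`hGR hRP1 hRP2 hP1 hP2` declared, discharged in the print-literal twin) · №277 rider: NO `hunitA` binder.
BINDER DIFF vs edition 109 (352 → 354 displayed): REMOVED `hΔ2` (derived); ADDED `𝔠 : C2Y N θ.toStage3Params Mstar` (datum), `h𝔯` (definitional pin), `h𝔠real` (reality letter); nothing retyped; no numeric change (witness S `…N06NumericsWitnessS.numerics_inhabited_ed109` applies verbatim).  Remaining displayed [B9] letter schemas (15 names): `h348; h36 h36H hopI; h36A hGsqA h36HA h36A2 hopIA; hD2sup hZ; h14₁ h14₂ hexp14; hE` (+ the structural reality letter `h𝔠real` on the new datum).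
INHABITED BY (dag-lead standing filing rule): as editions 83–109 (`hι` by dag-n06-c `B9SectionCarryingMembersV1`; instance binders by def-Y; `h𝔈 h𝔬12 hbI h𝔯 hbHX hbHXA hbH13 hbXH hbHXT hbHXTA` by `rfl`); OPEN: the bond-sector walk letters' static conditions + A-side pins (W-a), the Thm-3.14 objects (n06-m lane).
CONCLUSION IDENTICAL to edition 109 (the `𝔯` letter kept, pinned).  PROOF = edition 109's plus ONE `have hΔ2` (first line).
HONEST FRAMING.  Kernel bookkeeping over LANDED modules; every remaining [B9] estimate is a DISPLAYED hypothesis of printed species or a landed pin fact; COUNT-NEUTRAL; NOT a discharge of N06; K1⁹ NOT closed; one finite 𝕋⁴ programme at fixed `ε` — NOT continuum ∕ OS ∕ mass gap ∕ Clay. 0 `def`, 0 `sorry`.  Cell `pub-ymgap` (D-0062), Track A node N06 [B9], seat `pub-ymgap-dag-n06-d` (g22), 2026-08-30.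
-/
noncomputable section
namespace Summit.QuantumFields.YangMills.BalabanUVNodes.N06AtOpsYNuOfRecordV6EPairVL
open Literature.MathematicalPhysics.QuantumFieldTheory.Balaban1983to89 open T4Continuum (T4Family) open Node00 open B9PinMembersKLevelV1 (MemberY geo9Y bg9Y) open B9PinGeometryKLevelV1 (dOmegaY OmKY inΛY unitDistY c35Y) open B7Prop2SpecialUnitary (specialUnitaryUnits specialUnitaryUnits_le_unitaryUnits) open B9Ineq347GAAtLetters (hGA_opsYOfLetters) open B9Ineq344LocalPairHolds (hGp_opsYOfLetters_holds) open B9Cor35ComparisonsGAAtLetters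
 (hGA_e_opsYOfLetters hGA_h1_opsYOfLetters hGA_e4_opsYOfLetters hGA_h2_opsYOfLetters hGA_l2_opsYOfLetters) open B9CoReadingCoordsHolderAdm (holderProbesKA bond_h1ReadsNbr_of_pinsA) open B9CoReadingCoordsHolderAdmReadings (bond_coReadsHHolderNbr_of_pinsA bond_inputReadsFam_of_pinsA) open B9CoReadingCoordsHolderSNear (holderProbesSN site_h1ReadsNbr_of_pinsSN) open B9CoReadingCoordsHolderSNearReadings (site_inputReadsFam_of_pinsSN) open N06DirKinematicsAtPinsR (h36HA_of_dir_pinsR h36_of_dirSq_pinsR h36A_of_dirSq_pinsR) open N06DirKinematics3AtPinsSN (h36H_of_dir_pins₃SN) open B9H43GpFromPinsSN (h43Gp_of_thm37PrintedSN) open B9HpDGWFromPinsSN (hpDGW_of_thm37PrintedSN_unif) open B9H44GFromPinsSN (h44G_hp45W_of_thm37PrintedSN) open B9H44mFromPinsKA (h44m_h45X_h45Y_of_local3107 thm33G0DirT_of_local3107 inputConst44_pins_nonneg inputConst45_pins_nonneg const37_pins_nonneg) open B9SmoothHolderClassPI (bHZPIfam bHZKPIfam) open B9RWSums347DefiniteFaces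 (exp261) open B9RWSums344Input (inputConst44 inputConst45) open B9RWSums343Holder (holderConst) open B9Thm37Whole (const37) open B9RWSums346MixedFactorAtRecordClosed (MRec aRec BRec δRec) open N06CurrentMajAtPinsIdPhys (hBJ_of_pins_P) open B9WalkLettersOps (opsWalkY dirOpsWalkY dirLettersWalkY kappaWalkY thetaWalkY KcWalkY rdWalkY) open B9WalkLettersOpsFacts (staticOK_opsWalkY bounded_kappaWalkY) open N06WalkLettersAtRecordR (localityDir_opsWalkY_of_agree identities₂_opsWalkY_of_reg335R) open N06XdYdLegAtPinsPhysPU (hXd_of_pinsP_geo9Y pYDH_of_pinsP_geo9Y) open N06DgLegAtPinsPhysPU (hκ13_of_pinsP dgDH_dgDHd_of_pinsP_geo9Y) open B9SmoothHolderClassP (bHZPG bHZKP bHZKPG) open N06WELegAtPinsPhysPUB (hκX_of_pinsP hWE_of_pinsP_geo9Y_budget) open N06WGpLegAtPinsPhysPU (hwGp_of_pinsP_geo9Y) open N06RgdH43LegAtPinsPhysPU (hrgdH_of_pinsP43_geo9Y) open B9SmoothHolderClassPProducers (CTel) open B9Ineq349SiteThresholdRateNamed (thrM349 cg349 cg349_pos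 fineEntryS_le_named) open B9Thm39ReadingAtLetters (basis39 κ39) open B9MultiscaleSmoothPartitionYNear (rNear) open B9Thm313WholeDvHolderAtPinsGraded (thetaL CJG) open B9PlaquetteBinderOfReg335Y (plaqV_binder_of_regYR_budget_SU budget_nonneg) open B9SectDSup (weightNorm) open B9MultiscaleSmoothPartitionYLip (CLip) open B9GradViaDivLettersTransported (taxiS taxiB) open B9OpsRTransport (ops312RY) open B9Ineq349SiteFacesAtLettersR (s349_site_of_t37_display348_of_R) open B9Thm314Thm315LayerR (thm314_pair_layerOfLettersR) open B9Eq335ClassBridgePV1 (regY335_of_regYP335 regY336_of_regYP336) open B9BackgroundsKLevelV1P (bg9YP) open N06MixedLegAtPinsPhysR (l2MixedLegs37_of_pinsR) open N06MixedFactorAtPinsPhysR (h36H_with_factor_of_pinsR) open N06SplitMajorantsAtPinsPhysR (split_majorants_of_letter_schemasR) open N06StepL2AtPinsPhysR (stepL2_of_letter_schemas_residualR) open N06Thm312313AtPinsStateSUCLE (t312_t313_of_pins_stateSUCLE) open B9Thm313WholeLeafCompletePairMBCZcUSXCL (letters313L2Pc_of_fields) open N06Rgd2LegAtPinsPhysPU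 (hrgd2_of_pinsP_geo9Y) open B9SectBStepUClosedSUOfSections (sectBStepU_C37GY_su_extraYPb_closed) open Node00.OpsYExpsOfRecordV2 (expsYOfRecordV2) open Node00.OpsYOps312OfRecord (ops312YOfRecord) open Node00.OpsYBondMapOfRecord (bIYOfRecord) open N06G0QstarLettersLegAtPinsPU (g0qstar_letters_of_pins) open N06G0QstarTransferLegAtPinsPU (g0qstar_transfer_letters_of_pins) open B9Thm39FacesAtLettersRC (t39_hksum_oneCube_opsYOfLetters_FRC) open B9Thm311Thm315FacesAtLettersR (t311_of_pins_opsYOfLettersR) open B9Thm315SectEStarRepAtLettersR (DecayMidOnStY t315_opsYNuStOfRecordV4PE_sectEStYOfRecordV7_of_3185_onR) open B9BackgroundsKLevelV1R (RegFamY MemOfFam mem_of_reg335R bg9YR regYP335 regYP336 regYP335_one kernelFamilyR hKernelR rwExpansionR fineKernelR) open B9LeafXClassAntitone (ClassIncl residualGpAtOne_R residualGAGlobAtOne_R rwSumsYieldIneqs_R rwKernelSumYields_R thm37Printed_antitone cor38Printed_antitone thm39Printed_antitone thm310Printed_antitone thm311Printed_antitone thm312Printed_antitone thm313Printed_antitone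 thm314Printed_antitone thm315FullPrinted_antitone stmt349Printed_antitone stmt3132Printed_antitone thm314LocalPrinted_antitone) open B9PinGeometryKLevelV1B (c35B ten_L3_le_c35B ten_L4_le_c35B c35Y_le_ten) open DagBinding (B9LeafX) open N06Ids3152AtPinsPhys (ids3124_ids3152_of_hZ_pins) open Node00.OpsYNablaBridge (cf_mul_etaS_of_hcfk)
open B9Cor35ComparisonsGpCAtLetters (hGp_e_opsYOfLetters hGp_h1_opsYOfLetters hC_opsYOfLetters) open B9Cor35ComparisonsEH (hE4_of_hGA_e4 hH2_of_hGA_h2) open B9GeoLemma21KLevelV1 (geo9Y_len_pos) open B9Thm39WholeBlk (Conv348Blk) open B9Thm39OneCubeReadingAtLettersY (oneCubeOps39YF) open B9RowSum261DefiniteFaces (rowConst261) open B9Thm312Whole (GeoOK FormSmall cNorm PosDefEnd) open B11SectG (BlockNorm HasMaj) open B9GeoNormsKLevelV1 (geo9K_dist_nonneg geo9K_supNorm_nonneg) open B9GeoLemma21KLevelV1 (geo9Y_dist_triangle geo9Y_dist_comm) open B9GeoNormsKLevelModelSignsV1 (modelSignsOn_geo9K) open B9Thm34Ext (toB6) open B9CoRealizesRelAtLetters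 (RelB maj342_relB_left maj342_relB_right dist_eq_of_relB len_eq_of_relB relB_refl) open B9SectCDiffDict (maj342) open B6Ineq2142KLevelV1 (β) open B9CarrierBlockMultiplicity (card_sameCarrier_le_kIdx) open B9Thm311ReadingCoords (PosDefTr) open B9PinGeometryKLevelV1 (kLab) open B9Thm314GpFlatTorusGeometry (tdistK OmegaC) open B9Thm314WholePinGeometry (locDataY) open B9Thm314WholePair (locData₂) open B9Thm314WholePairWalks (pairWalkSets) open B9Thm314WholeSummation (WalkSetsSpec WalkWeightsSummable) open B9SectCWalkTermsAllNorms (Thm310AllNormsPrinted) open B9Thm314WholeExpansionReads (ExpansionReads) open B9Thm314WholeCancellationLayer (pairOp) open B9Thm37Whole (Ops Sizes StaticOK Local342)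
open B9Cor38Whole (WalkReading) open B9Thm310Whole (Ops310 WalkReading310 Sizes310 StaticOK310 Locality310 Local342G) open B9Thm310WholeDir (DirLetters310 Identities310₂) open B9RWSumsDefinitePins (PinPrims) open B9RWSumsDefinitePinsPair (PairPrims) open B9RWSumsDefinitePinsPairM (MixedPrims E310YPairM) open B9RWSumsDefinitePinsPairMDir (E37YPairMDir) open B9RWSumsDefinitePinsPairMDir4Rows (rows131819_definite_geo9Y_pairM_dir₄) open B9Thm37WholeDir (DirLetters37 Identities₂) open B9Cor38WholeDir (LocalityDir) open B9Thm37KLetterDir (HolderV37Dir FactorsInputPair37Dir) open B9RWSums344InputFam (InputReadsFam sliceProbe) open B9RWSums344InputPair (InputLegsPair37 InputLegsPair310 FactorsInputPair310) open B9RWSums346MixedPair (L2MixedLegs310 FactorsL2Mixed310) open B9CoReadingCoordsTranspose (TrIdx trBasis isTransposePair_GcoK_trBasis isTransposePair_DcoK_GcoK_trBasis isTransposePair_GcoS_trBasis isTransposePair_DcoS_GcoS_trBasis) open B9Thm311SymmAtRecordV4 (symm0_parSymY symmG_parSymY) open B9Thm311AdjointPairs (GpY_isSymmTr) open B9RWSums346SecondDiff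 (familyOp DirOps310 L2SecondLegs310) open B9RWSums346SecondDiffGp (DirOps37 L2SecondLegs37) open B9Thm37Glue (IsTransposePair) open B9RWSumsReadsNbr (H1ReadsNbr) open B9RWSums346Two (L2TwoLegs310 FactorsL2_310) open B9RWSums343Holder (HolderProbes HolderLegs310 FactorsHolder310) open B9RWSums343HolderGp (HolderLegs37) open B9Thm39ReadingCoords (cR39) open B9CoReadingCoords (XBK evBK blkBK GcoK DcoK DscoK LcoK coordOpK cdBₗ cdsBₗ) open B9CoReadingCoordsS (XSK evSK blkSK sIK sIK_faithful off_bound_evSK GcoS DcoS DscoS LcoS) open B9CoReadingCoordsL2S (sIK_dist_le_one site_l2ReadsNbr012_of_pins site_l2ReadsNbr345_of_pins) open B9CoReadingCoordsL2Pair (bond_l2ReadsNbr345_of_pins) open B9Ineq349SiteComposite (cdSL cdsSL) open B9Thm312WholeL2 (StepL2) open B9Thm312WholeHHolderNbr (CoReadsHHolderNbr) open B9Thm311ReadingCoords (IsSymmTr) open N06CoReadingsOfPins (bond_coReadings3_of_pins bond_coReadingsLap_of_pins site_coReadings4_of_pins bond_l2ReadsNbr3_of_pins) open B9GeoNbrCountKLevelV1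 (nbrM₀Y nbrCountY hnbr_two_of_le) open B9CoReadingCoordsH (XHK) open B6Ineq2142KLevelV1 (lvl) open B9Thm314WholePinGeometry (locDataY_laws) open B9PinGeometryKLevelV1 (dOmegaY_nonneg) open scoped Matrix.Norms.L2Operator
open N06Proj349AtPinsPhysRC (proj349Maj_of_t37_display348_rateR_ge cP349_nonneg) open B9Eq346GradGpDivAtPinsL2Closed (M46 a46 B46 δ46 M46_pos a46_pos B46_pos blockBd_DvGcoSDvs_memberY_at) open B9PerturbationL2Delta2 (D2coK constL2Pi constL2Pi_nonneg) open B9PerturbationL2Letters (constL2 constL2_nonneg) open N06SectDUnitsAtPinsPhys (isUnit_deltaPiAY_of_formSmall_phys isUnit_deltaOneY_of_formSmall_phys posDefEnd_S0coK_of_posDefTr_phys posDefTr_deltaOneY_of_formSmall_pins_phys identitiesDef_of_pins_phys isUnit_deltaAY_phys_of_posDefTr) open B9Thm313WholeLettersCut (Letters313HZc Letters313L2Pc) open B9Thm313WholeRgdFrom3152 (Ids3152) open B9SectDSup (weightNorm) open B9Thm313WholeLeftZ (Letters313DZ) open B9Thm313WholeDirZ (Letters313DMZ) open B9Thm313WholeHolderZ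 (Letters313HZ) open B9Thm313WholeDirL2Z (Letters313L2MZ) open B9LettersHZAtOne (plateau_pos) open B9Thm313WholeDirInputBC (Letters313IML) open B9Thm312WholeClasses (cNormR) open B9CoReadingCoordsHolder (PK) open B9CoReadingCoordsInput (bHK) open B9CoReadingCoordsInputS (bHS) open N06G0LayerFromThm310GUSP (g0_layer_of_thm310_coreDir₃USP) open N06G0QstarL2LettersLegAtPinsPU (g0qstar_l2_letters_of_pins) open N06DvLettersLegAtPinsPU (dv_letters_of_pins pXDv_of_pins_KX) open N06RgdILegAtPinsPhysR (rgdI_of_pinsR) open N06RgdDsLegAtPinsPhysR (rgdDs_rgdDd_of_pinsR) open N06DivLegAtPinsPhysR (hdivDs_of_pinsR) open N06HHLegAtPinsPhysRU (hLHH_of_pinsRU) open N06CutL2LettersAtPinsPhysR (vDRDG_vGDRD_of_pinsR) open B9Thm313WholeLettersCutKept (Letters313L2Pk Letters313L2Pc.of_kept) open N06MixedLegAtPinsPhys (hcntM_of_walkCnt) open N06Row17FromRow19LettersDir (row17_of_row19_letters₂) open B9WalkLettersCoordsS (SblkY hWalkY gsqcoS walkCntM₀Y walkCntY nearBlkCntY)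 open B6Cover236MultiLevelBlocks (cubes) open B9Eq346MixedLegAtPinsL2Closed (MMix aMix BMix δMix) open B9Thm39ReadingCoords (coordBound39 basisBound39) open B9Thm31GpMajFromPinsPairMR (thm31GpMaj_of_t37_pairMR) open B9PerturbationMajorantLetters (const3131) open B9RowSum261DefiniteFaces (rowConst261) open B9Thm312WholeIdentitiesSplit (Ids3124 identities_of_def_3124) open Node00.OpsYSectDCoords (DvcoKH DvscoKH GcoK_GAY_mul_S0coK cR39_trBasis_pos) open B9Thm311ReadingCoords (isUnit_of_posDefTr) open N06StateLayerAtPinsPUW (hStateTuplesW_of_pinsP_geo9Y) open N06Rgdd13AtPinsPUW (hrgdd13_of_pinsP_geo9Y) open N06DgDvdLegAtPinsT (dgDvd_pdgDvd_of_pinsT_all) open B9GradLetterTransportedSupSource (hasMaj_bHZPIfam_of_supBlocks) open B9GradLetterTransportedInputClassesPI (bHZPIfam_κ exists_l1_control_bHZPIfam) open B9MultiscaleSmoothPartitionYNear (rNear) open B9GeoLemma21KLevelV1 (rowSum261_geo9Y) open B9RWSumsDefinitePins (PinPrims.rate_pos) open B9Eq3132FromStateR (s3132Nu_opsYSectE_of_stepS_R_of_refinesY)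 open B9StateAprioriL1 (exists_l1_control_bHK exists_l1_control_bHS) open B9MultiscaleSmoothPartitionYLip (CLip_nonneg) open B9Thm312WholeClasses (rwt rwt_nonneg)
open B9LeafXCodedKnitU (b9LeafX_carriersYU) open B9SectBCodedClassR (regC335 regC336 bg9YC extraYPb classIncl_regC335Pb_regYPb335 classIncl_regC336Pb_regYPb336 classIncl_regYPb335_regC335Pb) open Node00 (Y9OfRecordUPb carriersYU CfgY BlkY IBondY deltaAY) open B9Eq360DeltaPrimeAY (AfldY) open B9PinMembersKLevelV1 (mstar_le_M) open B9LettersZSchemasMono (kernel_mono letters313DMZ_mono)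
variable {N : ℕ}
section Pointed
variable [NeZero N] {F : T4Family}
set_option maxHeartbeats 2400000 in set_option synthInstance.maxSize 2048 in set_option maxRecDepth 8192 in
/-- **THE STAGE-11 CERTIFICATE AT THE STAR RECORD, EDITION 111 «VL» — EDITION 109 WITH THE RESIDUAL LETTERS `𝔯` PINNED TO node00-def-Y's `resYOfC2P 𝔠` (`h𝔯`, reality letter `h𝔠real`; the symmetry schema `hΔ2` derived by `resYOfC2P_Δ2_isSymmTr_SU`)** (module docstring): 354 displayed binders;
conclusion `B9LeafX (Node00.Y9OfRecordUPb N θ.toStage3Params M⋆ ops f bR ιB C38)`, unchanged.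
[cite: Balaban1985BackgroundPropagators, Thm 3.4 p.400, Sect. B pp.400–407, (3.35)–(3.38) p.396, (3.40)–(3.41) p.397, Thm 3.3 (3.42)–(3.47) pp.397–399, Cor. 3.6 p.408, (3.13) p.392, Thm 3.10 (3.105)–(3.106) pp.414–416, Cor. 3.8 (3.87)–(3.94) pp.408–410, Thm 3.7 p.408, Thm 3.11 p.416, (3.120)–(3.133) pp.419–422, Thm 3.12 p.423, (3.137)–(3.138) p.423, (3.151)–(3.153) p.426, Thm 3.13 p.426, Thm 3.15 (3.156)–(3.158) p.428, (3.185)–(3.187) p.432, (3.49) p.399, Thms 3.1–3.15 pp.397–432; Balaban1984PropagatorsII, (2.3)–(2.4) p.224, (2.36)–(2.46) pp.229–231, (2.51)–(2.56) pp.232–233, Lemma 2.1 (2.59)–(2.61) pp.233–234, Props. 2.2–2.6, Prop. 2.7 p.249; Balaban1984PropagatorsI, (1.18) p.20] -/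
theorem b9LeafXUR_opsYNuOfRecordV6E_pairVL
    (θ : Stage11Params F N) (hθ : θ.Admissible) (Mstar : ℕ) (𝔯 : ResY N θ.toStage3Params Mstar)
    -- (t2a, edition 111) `𝔯` IS node00-def-Y's `resYOfC2P 𝔠` ([5]'s `C⁽²⁾` as the parameter `𝔠`): ONE definitional equation + ONE reality letter replace the displayed symmetry `hΔ2`
    (𝔠 : C2Y N θ.toStage3Params Mstar) (h𝔯 : 𝔯 = resYOfC2P N θ.toStage3Params Mstar 𝔠) (h𝔠real : ∀ (x : MemberY θ.d₆ θ.ℓ₆ θ.hd' θ.hL' θ.b₀ θ.b₁ Mstar) (U : CfgY (Matrix (Fin N) (Fin N) ℂ) x.toKIdx), (∀ μ z, U μ z ∈ specialUnitaryUnits (Fin N)) → ∀ A A' : FBondY x.toKIdx → Matrix (Fin N) (Fin N) ℂ, (𝔠 x).form U (star A) (star A') = star ((𝔠 x).form U A A')) (𝔢₀ : SectEY N θ.toStage3Params Mstar) (𝔴 : RWEY N θ.toStage3Params Mstar) (𝔈 : ExpsY N θ.toStage3Params Mstar) (𝔈₀ : ExpsY N θ.toStage3Params Mstar) {R₁ R₂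 : RegFamY θ.d₆ θ.ℓ₆ θ.hd' θ.hL' θ.b₀ θ.b₁ Mstar (Matrix (Fin N) (Fin N) ℂ)} (c : ℝ) (hcB : c35B θ.ℓ₆ ≤ c) (hc : 0 < c) (hGR : MemOfFam (specialUnitaryUnits (Fin N)) R₁) (hRP1 : ∀ (x : MemberY θ.d₆ θ.ℓ₆ θ.hd' θ.hL' θ.b₀ θ.b₁ Mstar) (α₀ : ℝ) (U : (bg9YR (Matrix (Fin N) (Fin N) ℂ) (specialUnitaryUnits (Fin N)) R₁ R₂ x).Cfg), (bg9YR (Matrix (Fin N) (Fin N) ℂ) (specialUnitaryUnits (Fin N)) R₁ R₂ x).Reg335 c α₀ U → 0 ≤ α₀ ∧ (bg9YP (Matrix (Fin N) (Fin N) ℂ) (specialUnitaryUnits (Fin N)) x).Reg335 c35Y α₀ U) (hRP2 : ∀ (x : MemberY θ.d₆ θ.ℓ₆ θ.hd' θ.hL' θ.b₀ θ.b₁ Mstar) (α₀ : ℝ) (U : (bg9YR (Matrix (Fin N) (Fin N) ℂ) (specialUnitaryUnits (Fin N)) R₁ R₂ x).Cfg), (bg9YR (Matrix (Fin N) (Fin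 N) ℂ) (specialUnitaryUnits (Fin N)) R₁ R₂ x).Reg336 c α₀ U → 0 ≤ α₀ ∧ (bg9YP (Matrix (Fin N) (Fin N) ℂ) (specialUnitaryUnits (Fin N)) x).Reg336 c35Y α₀ U) (hP1 : ClassIncl (regYP335 (Matrix (Fin N) (Fin N) ℂ) (specialUnitaryUnits (Fin N))) c35Y R₁ c) (hP2 : ClassIncl (regYP336 (Matrix (Fin N) (Fin N) ℂ) (specialUnitaryUnits (Fin N))) c35Y R₂ c) [∀ x : MemberY θ.d₆ θ.ℓ₆ θ.hd' θ.hL' θ.b₀ θ.b₁ Mstar, Fintype (geo9Y x).Site] [∀ x : MemberY θ.d₆ θ.ℓ₆ θ.hd' θ.hL' θ.b₀ θ.b₁ Mstar, DecidableEq (geo9Y x).Site] [∀ x : MemberY θ.d₆ θ.ℓ₆ θ.hd' θ.hL' θ.b₀ θ.b₁ Mstar, DecidableRel (RelB x.toKIdx)] (bI : ∀ x : MemberY θ.d₆ θ.ℓ₆ θ.hd' θ.hL' θ.b₀ θ.b₁ Mstar, FBondY x.toKIdx → IBondY x.toKIdx)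
    -- (BI, edition 83) `bI` IS node00-def-Y's `bIYOfRecord`: ONE definitional equation replaces the displayed laws `hβI hlev hβ1 hbI0`
    (hbI : bI = bIYOfRecord θ.toStage3Params Mstar) (α' r39 δ39 B39 a39 M39 : ℝ) (hα'0 : 0 < α') (hα'1 : α' < 1) (hr39 : 0 < r39) (hrδ39 : r39 ≤ δ39) (hB39 : 0 < B39) (ha39 : 0 < a39) (hM39 : 0 < M39) (h348 : ∀ x : MemberY θ.d₆ θ.ℓ₆ θ.hd' θ.hL' θ.b₀ θ.b₁ Mstar, M39 ≤ (geo9Y x).M → ∀ α₀ : ℝ, 0 < α₀ → c * (geo9Y x).M * α₀ ≤ a39 → ∀ U : (bg9YR (Matrix (Fin N) (Fin N) ℂ) (specialUnitaryUnits (Fin N)) R₁ R₂ x).Cfg, (bg9YR (Matrix (Fin N) (Fin N) ℂ) (specialUnitaryUnits (Fin N)) R₁ R₂ x).Reg335 c α₀ U → Conv348Blk (oneCubeOps39YF θ.toStage3Params Mstar (lettersYOfRecordV4P N θ.toStage3Params Mstar 𝔯) bI x) B39 δ39 U) {ιA AA : MemberY θ.d₆ θ.ℓ₆ θ.hd' θ.hL'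 θ.b₀ θ.b₁ Mstar → Type} [∀ x, Fintype (ιA x)] [∀ x, Fintype (AA x)] (p q : PinPrims) (hp : p.OK) (hq : q.OK) (hα3 : 3 * p.α ≤ (1 - p.αF) * (1 - 2 * p.α)) (p3 q3 : PairPrims) (hp3 : p3.OK) (hq3 : q3.OK) (pM qM : MixedPrims) (hpM : pM.OK) (hqM : qM.OK) (H : MemberY θ.d₆ θ.ℓ₆ θ.hd' θ.hL' θ.b₀ θ.b₁ Mstar → Prop) (hM₀ : nbrM₀Y θ.d₆ θ.ℓ₆ θ.hd' θ.hL' θ.b₀ θ.b₁ 2 ≤ Mstar) (hM₀' : nbrM₀Y θ.d₆ θ.ℓ₆ θ.hd' θ.hL' θ.b₀ θ.b₁ ((θ.ℓ₆ : ℝ) + 4) ≤ Mstar) (hM₀B : nbrM₀Y θ.d₆ θ.ℓ₆ θ.hd' θ.hL' θ.b₀ θ.b₁ (2 * ((θ.d₆ : ℝ) + 1)) ≤ Mstar) (𝔭 : ∀ x : MemberY θ.d₆ θ.ℓ₆ θ.hd' θ.hL' θ.b₀ θ.b₁ Mstar, HolderProbes (geo9Y x) (bg9YR (Matrix (Fin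 N) (Fin N) ℂ) (specialUnitaryUnits (Fin N)) R₁ R₂ x) (XSK (TrIdx N) x.toKIdx) (XSK (TrIdx N) x.toKIdx) (PK (SiteY x.toKIdx) (Fin (θ.d₆ + 1)) (TrIdx N)) (PK (SiteY x.toKIdx) (Fin (θ.d₆ + 1)) (TrIdx N))) (h𝔭 : ∀ x : MemberY θ.d₆ θ.ℓ₆ θ.hd' θ.hL' θ.b₀ θ.b₁ Mstar, 𝔭 x = holderProbesSN x.toKIdx (trBasis N) (bg9YR (Matrix (Fin N) (Fin N) ℂ) (specialUnitaryUnits (Fin N)) R₁ R₂ x) (fun U => U) (lettersYOfRecordV4P N θ.toStage3Params Mstar 𝔯 x).parS (bI x)) (bHX : ∀ x : MemberY θ.d₆ θ.ℓ₆ θ.hd' θ.hL' θ.b₀ θ.b₁ Mstar, ℝ → BlockNorm (toB6 (geo9Y x) 1 (H x)) ((XSK (TrIdx N) x.toKIdx) → ℝ)) (hbHX : ∀ x : MemberY θ.d₆ θ.ℓ₆ θ.hd' θ.hL' θ.b₀ θ.b₁ Mstar, bHX x = fun ε => letI : Fintype (B9GeoNormsKLevelV1.geo9K x.toKIdx).Site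 := (inferInstance : Fintype (geo9Y x).Site); bHS x.toKIdx (sIK x.toKIdx (bI x)) ε) (SH S3 SI : ∀ x : MemberY θ.d₆ θ.ℓ₆ θ.hd' θ.hL' θ.b₀ θ.b₁ Mstar, ↥(cubes x.toKIdx.D.toDomains) → Finset (geo9Y x).Site) (h36 : ∀ x, p.M₁ ≤ (geo9Y x).M → ∀ α₀ : ℝ, 0 < α₀ → c * (geo9Y x).M * α₀ ≤ p.a₁ → ∀ U : (bg9YR (Matrix (Fin N) (Fin N) ℂ) (specialUnitaryUnits (Fin N)) R₁ R₂ x).Cfg, (bg9YR (Matrix (Fin N) (Fin N) ℂ) (specialUnitaryUnits (Fin N)) R₁ R₂ x).Reg335 c α₀ U → Local342 (opsWalkY x (trBasis N) (bg9YR (Matrix (Fin N) (Fin N) ℂ) (specialUnitaryUnits (Fin N)) R₁ R₂ x) (fun U => U) (parSymY x.toKIdx) (bI x)) 1 (H x) p.B₀ p.δ₀ U) (h36H : ∀ x, p.M₁ ≤ (geo9Y x).M → ∀ α₀ : ℝ, 0 < α₀ → c * (geo9Y x).M * α₀ ≤ p.a₁ → ∀ U : (bg9YR (Matrix (Fin N)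 (Fin N) ℂ) (specialUnitaryUnits (Fin N)) R₁ R₂ x).Cfg, (bg9YR (Matrix (Fin N) (Fin N) ℂ) (specialUnitaryUnits (Fin N)) R₁ R₂ x).Reg335 c α₀ U →
      HolderLegs37 (opsWalkY x (trBasis N) (bg9YR (Matrix (Fin N) (Fin N) ℂ) (specialUnitaryUnits (Fin N)) R₁ R₂ x) (fun U => U) (parSymY x.toKIdx) (bI x)) (𝔭 x) 1 (H x) (SH x) p.Bl p.δ₀ U ∧ HolderV37Dir (opsWalkY x (trBasis N) (bg9YR (Matrix (Fin N) (Fin N) ℂ) (specialUnitaryUnits (Fin N)) R₁ R₂ x) (fun U => U) (parSymY x.toKIdx) (bI x)) (dirOpsWalkY x (trBasis N) (bg9YR (Matrix (Fin N) (Fin N) ℂ) (specialUnitaryUnits (Fin N)) R₁ R₂ x) (fun U => U) (parSymY x.toKIdx) (bI x)) (dirLettersWalkY x (trBasis N) (bg9YR (Matrix (Fin N) (Fin N) ℂ) (specialUnitaryUnits (Fin N)) R₁ R₂ x) (fun U => U) (parSymY x.toKIdx) (bI x)) (𝔭 x) 1 (H x) p.Bt p.δ₀ U ∧ (L2SecondLegs37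 (opsWalkY x (trBasis N) (bg9YR (Matrix (Fin N) (Fin N) ℂ) (specialUnitaryUnits (Fin N)) R₁ R₂ x) (fun U => U) (parSymY x.toKIdx) (bI x)) (dirOpsWalkY x (trBasis N) (bg9YR (Matrix (Fin N) (Fin N) ℂ) (specialUnitaryUnits (Fin N)) R₁ R₂ x) (fun U => U) (parSymY x.toKIdx) (bI x)) 1 (H x) (S3 x) p3.B3 p.δ₀ U ∧ (∀ q' μ, IsTransposePair ((dirLettersWalkY x (trBasis N) (bg9YR (Matrix (Fin N) (Fin N) ℂ) (specialUnitaryUnits (Fin N)) R₁ R₂ x) (fun U => U) (parSymY x.toKIdx) (bI x)).Pt U q' μ) ((dirLettersWalkY x (trBasis N) (bg9YR (Matrix (Fin N) (Fin N) ℂ) (specialUnitaryUnits (Fin N)) R₁ R₂ x) (fun U => U) (parSymY x.toKIdx) (bI x)).P U q' μ)) ∧ (∀ q', IsTransposePair ((opsWalkY x (trBasis N) (bg9YR (Matrix (Fin N) (Fin N) ℂ) (specialUnitaryUnits (Fin N)) R₁ R₂ x) (fun U => U) (parSymY x.toKIdx) (bI x)).Ct U q') ((opsWalkY x (trBasis N)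 (bg9YR (Matrix (Fin N) (Fin N) ℂ) (specialUnitaryUnits (Fin N)) R₁ R₂ x) (fun U => U) (parSymY x.toKIdx) (bI x)).Cop U q'))) ∧ (InputLegsPair37 (opsWalkY x (trBasis N) (bg9YR (Matrix (Fin N) (Fin N) ℂ) (specialUnitaryUnits (Fin N)) R₁ R₂ x) (fun U => U) (parSymY x.toKIdx) (bI x)) (dirOpsWalkY x (trBasis N) (bg9YR (Matrix (Fin N) (Fin N) ℂ) (specialUnitaryUnits (Fin N)) R₁ R₂ x) (fun U => U) (parSymY x.toKIdx) (bI x)) (𝔭 x) 1 (H x) (bHX x) (SI x) p.BI p.BI2 p.δ₀ U ∧ FactorsInputPair37Dir (opsWalkY x (trBasis N) (bg9YR (Matrix (Fin N) (Fin N) ℂ) (specialUnitaryUnits (Fin N)) R₁ R₂ x) (fun U => U) (parSymY x.toKIdx) (bI x)) (dirOpsWalkY x (trBasis N) (bg9YR (Matrix (Fin N) (Fin N) ℂ) (specialUnitaryUnits (Fin N)) R₁ R₂ x) (fun U => U) (parSymY x.toKIdx) (bI x)) (dirLettersWalkY x (trBasis N) (bg9YR (Matrix (Fin N) (Fin N)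 ℂ) (specialUnitaryUnits (Fin N)) R₁ R₂ x) (fun U => U) (parSymY x.toKIdx) (bI x)) 1 (H x) (bHX x) p.θI p.δ₀ U)) (bHXT : ∀ x : MemberY θ.d₆ θ.ℓ₆ θ.hd' θ.hL' θ.b₀ θ.b₁ Mstar, (bg9YR (Matrix (Fin N) (Fin N) ℂ) (specialUnitaryUnits (Fin N)) R₁ R₂ x).Cfg → ℝ → BlockNorm (toB6 (geo9Y x) 1 (H x)) ((XSK (TrIdx N) x.toKIdx) → ℝ)) (hbHXT : ∀ (x : MemberY θ.d₆ θ.ℓ₆ θ.hd' θ.hL' θ.b₀ θ.b₁ Mstar) (U : (bg9YR (Matrix (Fin N) (Fin N) ℂ) (specialUnitaryUnits (Fin N)) R₁ R₂ x).Cfg), bHXT x U = fun ε => letI : Fintype (B9GeoNormsKLevelV1.geo9K x.toKIdx).Site := (inferInstance : Fintype (geo9Y x).Site); bHZPIfam (κ := TrIdx N) x.toKIdx (trBasis N) (taxiS x.toKIdx (bg9YR (Matrix (Fin N) (Fin N) ℂ) (specialUnitaryUnits (Fin N)) R₁ R₂ x) (fun U => U) U) (R := (1 : ℝ)) (H :=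 H x) ε)
    -- [B9 Cor. 3.6 p.408 species at the TRANSPORTED site class (3.40)∕(3.44): print's input legs of the G′ walk, ‖·‖^ξ′_ε with ξ′ = Lʲ′η, read at `bHZPIfam (taxiS U)` (edition 95; dag-n06-c LOCATED-20: flat and transported classes are incomparable)]
    (hopI : ∀ x, p.M₁ ≤ (geo9Y x).M → ∀ α₀ : ℝ, 0 < α₀ → c * (geo9Y x).M * α₀ ≤ p.a₁ → ∀ U : (bg9YR (Matrix (Fin N) (Fin N) ℂ) (specialUnitaryUnits (Fin N)) R₁ R₂ x).Cfg, (bg9YR (Matrix (Fin N) (Fin N) ℂ) (specialUnitaryUnits (Fin N)) R₁ R₂ x).Reg335 c α₀ U → InputLegsPair37 (opsWalkY x (trBasis N) (bg9YR (Matrix (Fin N) (Fin N) ℂ) (specialUnitaryUnits (Fin N)) R₁ R₂ x) (fun U => U) (parSymY x.toKIdx) (bI x)) (dirOpsWalkY x (trBasis N) (bg9YR (Matrix (Fin N) (Fin N) ℂ) (specialUnitaryUnits (Fin N)) R₁ R₂ x) (fun U => U) (parSymY x.toKIdx) (bI x)) (𝔭 x) 1 (H x) (bHXT x U) (SI x)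 p.BI p.BI2 p.δ₀ U ∧ FactorsInputPair37Dir (opsWalkY x (trBasis N) (bg9YR (Matrix (Fin N) (Fin N) ℂ) (specialUnitaryUnits (Fin N)) R₁ R₂ x) (fun U => U) (parSymY x.toKIdx) (bI x)) (dirOpsWalkY x (trBasis N) (bg9YR (Matrix (Fin N) (Fin N) ℂ) (specialUnitaryUnits (Fin N)) R₁ R₂ x) (fun U => U) (parSymY x.toKIdx) (bI x)) (dirLettersWalkY x (trBasis N) (bg9YR (Matrix (Fin N) (Fin N) ℂ) (specialUnitaryUnits (Fin N)) R₁ R₂ x) (fun U => U) (parSymY x.toKIdx) (bI x)) 1 (H x) (bHXT x U) p.θI p.δ₀ U)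
    (hM1mix : MMix θ.d₆ θ.ℓ₆ θ.hd' θ.hL' θ.b₀ θ.b₁ Mstar N c hc ≤ p.M₁) (ha1mix : p.a₁ ≤ aMix θ.d₆ θ.ℓ₆ θ.hd' θ.hL' θ.b₀ θ.b₁ Mstar N c hc) (hBMmix : BMix θ.d₆ θ.ℓ₆ θ.hd' θ.hL' θ.b₀ θ.b₁ Mstar N c hc ≤ pM.BM) (hδmix : p.δ₀ ≤ δMix θ.d₆ θ.ℓ₆ θ.hd' θ.hL' θ.b₀ θ.b₁ Mstar N c hc) (hM1fac : MRec θ.d₆ θ.ℓ₆ θ.hd' θ.hL' θ.b₀ θ.b₁ Mstar N c hc ≤ p.M₁) (ha1fac : p.a₁ ≤ aRec θ.d₆ θ.ℓ₆ θ.hd' θ.hL' θ.b₀ θ.b₁ Mstar N c hc) (hδfac : p.δ₀ ≤ δRec θ.d₆ θ.ℓ₆ θ.hd' θ.hL' θ.b₀ θ.b₁ Mstar N c hc) (hθfac : p.θ₀ * Real.exp ((3 / 4 + p.δ₀) * p.ρ) * BRec θ.d₆ θ.ℓ₆ θ.hd' θ.hL' θ.b₀ θ.b₁ Mstar N c hc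 ≤ pM.θM) (hcntH : ∀ x (a : (geo9Y x).Site), (∑ c, if a ∈ SH x c then (1 : ℝ) else 0) ≤ p.NH) (hcnt3 : ∀ x (a : (geo9Y x).Site), (∑ c, if a ∈ S3 x c then (1 : ℝ) else 0) ≤ p3.N3) (hcntI : ∀ x (a : (geo9Y x).Site), (∑ c, if a ∈ SI x c then (1 : ℝ) else 0) ≤ p.NI) (hMw : ∀ x : MemberY θ.d₆ θ.ℓ₆ θ.hd' θ.hL' θ.b₀ θ.b₁ Mstar, walkCntM₀Y θ.d₆ θ.ℓ₆ θ.hd' θ.hL' θ.b₀ θ.b₁ Mstar ≤ (geo9Y x).M) (hNMw : walkCntY θ.d₆ θ.ℓ₆ θ.hd' θ.hL' θ.b₀ θ.b₁ Mstar ≤ pM.NM) (hM3 : nbrM₀Y θ.d₆ θ.ℓ₆ θ.hd' θ.hL' θ.b₀ θ.b₁ 3 ≤ Mstar) (hρ3 : 3 ≤ p.ρ) (hNc : walkCntY θ.d₆ θ.ℓ₆ θ.hd' θ.hL' θ.b₀ θ.b₁ Mstar ≤ p.Nc) (hN' : walkCntY θ.d₆ θ.ℓ₆ θ.hd' θ.hL'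 θ.b₀ θ.b₁ Mstar ≤ p.N') (hCℓ : (((θ.ℓ₆ + 1 : ℕ) : ℝ)) ^ 2 ≤ p.Cℓ) (hKc : KcWalkY θ.d₆ θ.ℓ₆ θ.hd' θ.hL' θ.b₀ θ.b₁ (trBasis N) ≤ p.Kc) (hθ₀ : thetaWalkY θ.d₆ θ.ℓ₆ θ.hd' θ.hL' θ.b₀ θ.b₁ (trBasis N) p.Cℓ ≤ p.θ₀) (𝔬A : ∀ x : MemberY θ.d₆ θ.ℓ₆ θ.hd' θ.hL' θ.b₀ θ.b₁ Mstar, Ops310 (geo9Y x) (bg9YR (Matrix (Fin N) (Fin N) ℂ) (specialUnitaryUnits (Fin N)) R₁ R₂ x) (XBK (TrIdx N) x.toKIdx) (XBK (TrIdx N) x.toKIdx) (ιA x) (AA x)) (rdA : ∀ x : MemberY θ.d₆ θ.ℓ₆ θ.hd' θ.hL' θ.b₀ θ.b₁ Mstar, WalkReading310 (geo9Y x) (bg9YR (Matrix (Fin N) (Fin N) ℂ) (specialUnitaryUnits (Fin N)) R₁ R₂ x) (XBK (TrIdx N) x.toKIdx) (ιA x) (AA x)) (𝔭A : ∀ x :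 MemberY θ.d₆ θ.ℓ₆ θ.hd' θ.hL' θ.b₀ θ.b₁ Mstar, HolderProbes (geo9Y x) (bg9YR (Matrix (Fin N) (Fin N) ℂ) (specialUnitaryUnits (Fin N)) R₁ R₂ x) (XBK (TrIdx N) x.toKIdx) (XBK (TrIdx N) x.toKIdx) (PK (FBondY x.toKIdx) (Fin (θ.d₆ + 1)) (TrIdx N)) (PK (FBondY x.toKIdx) (Fin (θ.d₆ + 1)) (TrIdx N))) (h𝔭A : ∀ x : MemberY θ.d₆ θ.ℓ₆ θ.hd' θ.hL' θ.b₀ θ.b₁ Mstar, 𝔭A x = holderProbesKA x.toKIdx (trBasis N) (bg9YR (Matrix (Fin N) (Fin N) ℂ) (specialUnitaryUnits (Fin N)) R₁ R₂ x) (fun U => U) (lettersYOfRecordV4P N θ.toStage3Params Mstar 𝔯 x).parB (bI x)) (𝔡A : ∀ x : MemberY θ.d₆ θ.ℓ₆ θ.hd' θ.hL' θ.b₀ θ.b₁ Mstar, DirOps310 (𝔬A x) (Fin (θ.d₆ + 1))) (𝔩A : ∀ x : MemberY θ.d₆ θ.ℓ₆ θ.hd' θ.hL' θ.b₀ θ.b₁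 Mstar, DirLetters310 (𝔬A x) (Fin (θ.d₆ + 1))) (bHXA : ∀ x : MemberY θ.d₆ θ.ℓ₆ θ.hd' θ.hL' θ.b₀ θ.b₁ Mstar, ℝ → BlockNorm (toB6 (geo9Y x) 1 (H x)) ((XBK (TrIdx N) x.toKIdx) → ℝ)) (κA : MemberY θ.d₆ θ.ℓ₆ θ.hd' θ.hL' θ.b₀ θ.b₁ Mstar → Sizes310) (SHA S3A SIA SMA S2A : ∀ x : MemberY θ.d₆ θ.ℓ₆ θ.hd' θ.hL' θ.b₀ θ.b₁ Mstar, ιA x → Finset (geo9Y x).Site) (hbHXA : ∀ x : MemberY θ.d₆ θ.ℓ₆ θ.hd' θ.hL' θ.b₀ θ.b₁ Mstar, bHXA x = fun ε => letI : Fintype (B9GeoNormsKLevelV1.geo9K x.toKIdx).Site := (inferInstance : Fintype (geo9Y x).Site); bHK x.toKIdx (bI x) ε) (hstA : ∀ x, StaticOK310 (𝔬A x) q.ρ q.Nc q.N' q.NF q.Cℓ (κA x)) (hκA : ∀ x, (κA x).Bounded q.Kc) (hrdA : ∀ x, (rdA x).OKRel (𝔬A x).blk (RelB x.toKIdx)) (hlocA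 : ∀ x, Locality310 (𝔬A x) (rdA x)) (h36A : ∀ x, q.M₁ ≤ (geo9Y x).M → ∀ α₀ : ℝ, 0 < α₀ → c * (geo9Y x).M * α₀ ≤ q.a₁ → ∀ U : (bg9YR (Matrix (Fin N) (Fin N) ℂ) (specialUnitaryUnits (Fin N)) R₁ R₂ x).Cfg, (bg9YR (Matrix (Fin N) (Fin N) ℂ) (specialUnitaryUnits (Fin N)) R₁ R₂ x).Reg335 c α₀ U → Local342G (𝔬A x) 1 (H x) q.B₀ q.δ₀ U ∧ B9Thm310Whole.Factors389 (𝔬A x) 1 (H x) q.θ₀ q.δ₀ U ∧ Identities310₂ (𝔬A x) (𝔡A x) (𝔩A x) 1 (H x) U)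
    (hGsqA : ∀ x, q.M₁ ≤ (geo9Y x).M → ∀ α₀ : ℝ, 0 < α₀ → c * (geo9Y x).M * α₀ ≤ q.a₁ → ∀ U : (bg9YR (Matrix (Fin N) (Fin N) ℂ) (specialUnitaryUnits (Fin N)) R₁ R₂ x).Cfg, (bg9YR (Matrix (Fin N) (Fin N) ℂ) (specialUnitaryUnits (Fin N)) R₁ R₂ x).Reg335 c α₀ U → ∀ i, IsTransposePair ((𝔬A x).Gsq U i) ((𝔬A x).Gsq U i) ∧ ∀ v, 0 ≤ v ⬝ᵥ (𝔬A x).Gsq U i v) (h36HA : ∀ x, q.M₁ ≤ (geo9Y x).M → ∀ α₀ : ℝ, 0 < α₀ → c * (geo9Y x).M * α₀ ≤ q.a₁ → ∀ U : (bg9YR (Matrix (Fin N) (Fin N) ℂ) (specialUnitaryUnits (Fin N)) R₁ R₂ x).Cfg, (bg9YR (Matrix (Fin N) (Fin N) ℂ) (specialUnitaryUnits (Fin N)) R₁ R₂ x).Reg335 c α₀ U → HolderLegs310 (𝔬A x) (𝔭A x) 1 (H x) (SHA x) q.Bl q.δ₀ U ∧ FactorsHolder310 (𝔬A x) (𝔭A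 x) 1 (H x) q.Bt q.δ₀ U ∧ (L2SecondLegs310 (𝔬A x) (𝔡A x) 1 (H x) (S3A x) q3.B3 q.δ₀ U ∧ ∀ a, IsTransposePair ((𝔬A x).Rt U a) ((𝔬A x).Rf U a)) ∧ (InputLegsPair310 (𝔬A x) (𝔡A x) (𝔭A x) 1 (H x) (bHXA x) (SIA x) q.BI q.BI2 q.δ₀ U ∧ FactorsInputPair310 (𝔬A x) (𝔡A x) 1 (H x) (bHXA x) q.θI q.δ₀ U) ∧ (L2MixedLegs310 (𝔬A x) (𝔡A x) 1 (H x) (SMA x) qM.BM q.δ₀ U ∧ FactorsL2Mixed310 (𝔬A x) (𝔡A x) 1 (H x) qM.θM q.δ₀ U)) (bHXTA : ∀ x : MemberY θ.d₆ θ.ℓ₆ θ.hd' θ.hL' θ.b₀ θ.b₁ Mstar, (bg9YR (Matrix (Fin N) (Fin N) ℂ) (specialUnitaryUnits (Fin N)) R₁ R₂ x).Cfg → ℝ → BlockNorm (toB6 (geo9Y x) 1 (H x)) ((XBK (TrIdx N) x.toKIdx) → ℝ)) (hbHXTA : ∀ (x : MemberY θ.d₆ θ.ℓ₆ θ.hd'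 θ.hL' θ.b₀ θ.b₁ Mstar) (U : (bg9YR (Matrix (Fin N) (Fin N) ℂ) (specialUnitaryUnits (Fin N)) R₁ R₂ x).Cfg), bHXTA x U = fun ε => letI : Fintype (B9GeoNormsKLevelV1.geo9K x.toKIdx).Site := (inferInstance : Fintype (geo9Y x).Site); bHZKPIfam (κ := TrIdx N) x.toKIdx (trBasis N) (taxiB x.toKIdx (bg9YR (Matrix (Fin N) (Fin N) ℂ) (specialUnitaryUnits (Fin N)) R₁ R₂ x) (fun U => U) U) (R := (1 : ℝ)) (H := H x) ε)
    -- [B9 Cor. 3.6 p.408 species at the TRANSPORTED bond class: print's (3.44)∕(3.45) input legs of Theorem 3.10's G(U), read at `bHZKPIfam (taxiB U)` (edition 95)]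
    (hopIA : ∀ x, q.M₁ ≤ (geo9Y x).M → ∀ α₀ : ℝ, 0 < α₀ → c * (geo9Y x).M * α₀ ≤ q.a₁ → ∀ U : (bg9YR (Matrix (Fin N) (Fin N) ℂ) (specialUnitaryUnits (Fin N)) R₁ R₂ x).Cfg, (bg9YR (Matrix (Fin N) (Fin N) ℂ) (specialUnitaryUnits (Fin N)) R₁ R₂ x).Reg335 c α₀ U → InputLegsPair310 (𝔬A x) (𝔡A x) (𝔭A x) 1 (H x) (bHXTA x U) (SIA x) q.BI q.BI2 q.δ₀ U ∧ FactorsInputPair310 (𝔬A x) (𝔡A x) 1 (H x) (bHXTA x U) q.θI q.δ₀ U) (h36A2 : ∀ x, q.M₁ ≤ (geo9Y x).M → ∀ α₀ : ℝ, 0 < α₀ → c * (geo9Y x).M * α₀ ≤ q.a₁ → ∀ U : (bg9YR (Matrix (Fin N) (Fin N) ℂ) (specialUnitaryUnits (Fin N)) R₁ R₂ x).Cfg, (bg9YR (Matrix (Fin N) (Fin N) ℂ) (specialUnitaryUnits (Fin N)) R₁ R₂ x).Reg335 c α₀ U → L2TwoLegs310 (𝔬A x) 1 (H x) (S2A x)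 q.B2 q.δ₀ U ∧ FactorsL2_310 (𝔬A x) 1 (H x) q.θ2 q.δ₀ U) (hcntHA : ∀ x (a : (geo9Y x).Site), (∑ c, if a ∈ SHA x c then (1 : ℝ) else 0) ≤ q.NH) (hcnt3A : ∀ x (a : (geo9Y x).Site), (∑ c, if a ∈ S3A x c then (1 : ℝ) else 0) ≤ q3.N3) (hcntIA : ∀ x (a : (geo9Y x).Site), (∑ c, if a ∈ SIA x c then (1 : ℝ) else 0) ≤ q.NI) (hcntMA : ∀ x (a : (geo9Y x).Site), (∑ c, if a ∈ SMA x c then (1 : ℝ) else 0) ≤ qM.NM) (hcnt2A : ∀ x (a : (geo9Y x).Site), (∑ c, if a ∈ S2A x c then (1 : ℝ) else 0) ≤ q.N2) (hblkA : ∀ x : MemberY θ.d₆ θ.ℓ₆ θ.hd' θ.hL' θ.b₀ θ.b₁ Mstar, (𝔬A x).blk = blkBK x.toKIdx (bI x)) (hblkYA : ∀ x : MemberY θ.d₆ θ.ℓ₆ θ.hd' θ.hL' θ.b₀ θ.b₁ Mstar, (𝔬A x).blkY = blkBK x.toKIdx (bI x)) (hGcoA : ∀ (x : MemberY θ.d₆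 θ.ℓ₆ θ.hd' θ.hL' θ.b₀ θ.b₁ Mstar) (U : (bg9YR (Matrix (Fin N) (Fin N) ℂ) (specialUnitaryUnits (Fin N)) R₁ R₂ x).Cfg), (𝔬A x).G U = GcoK x.toKIdx (trBasis N) (bg9YR (Matrix (Fin N) (Fin N) ℂ) (specialUnitaryUnits (Fin N)) R₁ R₂ x) (fun U => U) (lettersYOfRecordV4P N θ.toStage3Params Mstar 𝔯 x).GA U) (hDcoA : ∀ (x : MemberY θ.d₆ θ.ℓ₆ θ.hd' θ.hL' θ.b₀ θ.b₁ Mstar) (U : (bg9YR (Matrix (Fin N) (Fin N) ℂ) (specialUnitaryUnits (Fin N)) R₁ R₂ x).Cfg), (𝔬A x).D U = DcoK x.toKIdx (trBasis N) (bg9YR (Matrix (Fin N) (Fin N) ℂ) (specialUnitaryUnits (Fin N)) R₁ R₂ x) (fun U => U) U) (hDscoA : ∀ (x : MemberY θ.d₆ θ.ℓ₆ θ.hd' θ.hL' θ.b₀ θ.b₁ Mstar) (U : (bg9YR (Matrix (Fin N) (Fin N) ℂ) (specialUnitaryUnits (Fin N)) R₁ R₂ x).Cfg), (𝔬A x).Dstar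 U = DscoK x.toKIdx (trBasis N) (bg9YR (Matrix (Fin N) (Fin N) ℂ) (specialUnitaryUnits (Fin N)) R₁ R₂ x) (fun U => U) U) (hLcoA : ∀ (x : MemberY θ.d₆ θ.ℓ₆ θ.hd' θ.hL' θ.b₀ θ.b₁ Mstar) (U : (bg9YR (Matrix (Fin N) (Fin N) ℂ) (specialUnitaryUnits (Fin N)) R₁ R₂ x).Cfg), (𝔬A x).Lap U = LcoK x.toKIdx (trBasis N) (bg9YR (Matrix (Fin N) (Fin N) ℂ) (specialUnitaryUnits (Fin N)) R₁ R₂ x) (fun U => U) U) (h𝔡Ad : ∀ (x : MemberY θ.d₆ θ.ℓ₆ θ.hd' θ.hL' θ.b₀ θ.b₁ Mstar) (U : (bg9YR (Matrix (Fin N) (Fin N) ℂ) (specialUnitaryUnits (Fin N)) R₁ R₂ x).Cfg), (𝔡A x).Dd U = fun μ => coordOpK (trBasis N) (fun _ : Fin (θ.d₆ + 1) => cdBₗ x.toKIdx U μ)) (h𝔡As : ∀ (x : MemberY θ.d₆ θ.ℓ₆ θ.hd' θ.hL' θ.b₀ θ.b₁ Mstar) (U : (bg9YR (Matrix (Fin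 N) (Fin N) ℂ) (specialUnitaryUnits (Fin N)) R₁ R₂ x).Cfg), (𝔡A x).Dsd U = fun μ => coordOpK (trBasis N) (fun _ : Fin (θ.d₆ + 1) => cdsBₗ x.toKIdx U μ)) (hGsqAS : ∀ (x : MemberY θ.d₆ θ.ℓ₆ θ.hd' θ.hL' θ.b₀ θ.b₁ Mstar) (U : (bg9YR (Matrix (Fin N) (Fin N) ℂ) (specialUnitaryUnits (Fin N)) R₁ R₂ x).Cfg) (j : ιA x), ∃ (r : ℝ) (G : (FBondY x.toKIdx → Matrix (Fin N) (Fin N) ℂ) →ₗ[ℝ] (FBondY x.toKIdx → Matrix (Fin N) (Fin N) ℂ)), (𝔬A x).Gsq U j = r • coordOpK (trBasis N) (fun _ : Fin (θ.d₆ + 1) => G)) (𝔬12 : ∀ x : MemberY θ.d₆ θ.ℓ₆ θ.hd' θ.hL' θ.b₀ θ.b₁ Mstar, B9Thm312Whole.Ops (geo9Y x) (bg9YR (Matrix (Fin N) (Fin N) ℂ) (specialUnitaryUnits (Fin N)) R₁ R₂ x) (XBK (TrIdx N) x.toKIdx) (XBK (TrIdx N) x.toKIdx) (XHK (TrIdx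 N) x.toKIdx) (XSK (TrIdx N) x.toKIdx))
    -- (Q56, edition 81) `𝔬12` IS node00-def-Y's `ops312YOfRecord`: ONE definitional equation replaces the twenty-two displayed pins `hblk12 … hRco12`
    (h𝔬12 : 𝔬12 = ops312YOfRecord N θ.toStage3Params Mstar 𝔯 R₁ R₂ bI)
    -- (t4, edition 79) `𝔈` IS node00-def-Y's `expsYOfRecordV2` over `𝔈₀`: ONE definitional equation replaces the displayed pins `hEK39 hPD hE37 hE310 hpinE hpinH hpinK`
    (h𝔈 : 𝔈 = expsYOfRecordV2 N θ.toStage3Params Mstar 𝔯 𝔈₀ R₁ R₂ bI α' r39 B39 p q p3 q3 pM qM H 𝔬A rdA 𝔬12) (bH13 : ∀ x : MemberY θ.d₆ θ.ℓ₆ θ.hd' θ.hL' θ.b₀ θ.b₁ Mstar, (bg9YR (Matrix (Fin N) (Fin N) ℂ) (specialUnitaryUnits (Fin N)) R₁ R₂ x).Cfg → BlockNorm (toB6 (geo9Y x) 1 (H x)) (XSK (TrIdx N) x.toKIdx → ℝ)) (δ12₀ δK12 σ12 ρ12 a12 M12 B12₃ δ12₃ ρ13 α12 : ℝ) (ρf12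 : ℝ) (hρf12 : 0 < ρf12) (hρf1 : ρf12 + σ12 ≤ (1 - α12) * ρ12) (hρf2 : ρf12 + 2 * σ12 + α12 * ρ12 ≤ ρ12) (hB12₃ : 0 ≤ B12₃) (hσ12 : 0 < σ12) (hρ12 : 0 < ρ12) (hρS12 : ρ12 ≤ δ12₀) (hρδ12 : ρ12 + 2 * σ12 ≤ δK12) (hρ₃12 : ρ12 + σ12 ≤ δ12₃) (ha12 : 0 < a12) (hM12 : 0 < M12) (hα12 : 0 < α12) (hα12' : α12 ≤ 1 / 2) (hδ₃₀ : δ12₃ < δ12₀) (hδ12₀ : δ12₀ ≤ (1 - 3 * q.αF) * ((1 - 2 * q.α) * q.δ₀)) (t12 δT12 ρS σS : ℝ) (ht12 : 0 ≤ t12) (hσS : 0 < σS) (hρST : ρS ≤ δT12) (hρS₀ : ρS + σS ≤ δ12₀) (hδKS : δK12 + q.αF * ((1 - 2 * q.α) * q.δ₀) ≤ ρS) (hσSK : σS ≤ δK12) (bXH : ∀ x : MemberY θ.d₆ θ.ℓ₆ θ.hd' θ.hL' θ.b₀ θ.b₁ Mstar, (bg9YR (Matrix (Fin N) (Fin N)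 ℂ) (specialUnitaryUnits (Fin N)) R₁ R₂ x).Cfg → BlockNorm (toB6 (geo9Y x) 1 (H x)) (XBK (TrIdx N) x.toKIdx → ℝ)) (w13 wX : ℝ → ℝ) (hw13₀ : ∀ s, 0 ≤ w13 s) (hw13₁ : ∀ s, w13 s ≤ 1) (hwX₀ : ∀ s, 0 ≤ wX s) (hwX₁ : ∀ s, wX s ≤ 1) (hbH13 : ∀ (x : MemberY θ.d₆ θ.ℓ₆ θ.hd' θ.hL' θ.b₀ θ.b₁ Mstar) (U : (bg9YR (Matrix (Fin N) (Fin N) ℂ) (specialUnitaryUnits (Fin N)) R₁ R₂ x).Cfg), bH13 x U = letI : Fintype (B9GeoNormsKLevelV1.geo9K x.toKIdx).Site := (inferInstance : Fintype (geo9Y x).Site); bHZPG (κ := TrIdx N) x.toKIdx (trBasis N) (taxiS x.toKIdx (bg9YR (Matrix (Fin N) (Fin N) ℂ) (specialUnitaryUnits (Fin N)) R₁ R₂ x) (fun U => U) U) (R := (1 : ℝ)) (H := H x) w13 hw13₀ hw13₁) (hbXH : ∀ (x : MemberY θ.d₆ θ.ℓ₆ θ.hd' θ.hL' θ.b₀ θ.b₁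 Mstar) (U : (bg9YR (Matrix (Fin N) (Fin N) ℂ) (specialUnitaryUnits (Fin N)) R₁ R₂ x).Cfg), bXH x U = letI : Fintype (B9GeoNormsKLevelV1.geo9K x.toKIdx).Site := (inferInstance : Fintype (geo9Y x).Site); bHZKPG (κ := TrIdx N) x.toKIdx (trBasis N) (taxiB x.toKIdx (bg9YR (Matrix (Fin N) (Fin N) ℂ) (specialUnitaryUnits (Fin N)) R₁ R₂ x) (fun U => U) U) (R := (1 : ℝ)) (H := H x) wX hwX₀ hwX₁) (hρ13 : 0 < ρ13) (hρ13ρ : ρ13 + 5 * σ12 ≤ ρ12) (hσρ13 : 3 * σ12 < (1 - α12) * ρ13) (B13₄ : ℝ) (Bx13 : ℝ → ℝ) (hB13₄ : 0 ≤ B13₄) (hBx13 : ∀ β, 0 ≤ β → β < 1 → 0 ≤ Bx13 β) (tJ δB rT : ℝ) (ha1J : 10 * ((θ.ℓ₆ + 1 : ℕ) : ℝ) ^ 7 * a12 ≤ 1) (htJ : 2 * ((θ.d₆ : ℝ) + 1) * (((θ.ℓ₆ + 1 : ℕ) : ℝ)) ^ 3 * (N : ℝ) * (10 ^ 4 * ((θ.d₆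 : ℝ) + 1) * (10 * ((θ.ℓ₆ + 1 : ℕ) : ℝ) ^ 7)) * Real.exp (3 * δB) ≤ tJ) (hrTP : rT ≤ min ((1 - 2 * p.α) * p.δ₀) δ39 / 8) (hrTB : rT ≤ δB) (hδT12 : 0 ≤ δT12) (hδTr : δT12 + 3 * σS + 3 * (q.αF * ((1 - 2 * q.α) * q.δ₀)) ≤ rT) (ϑF : ℝ) (hϑF : 2 * (10 * (((θ.ℓ₆ + 1 : ℕ) : ℝ)) * a12) * (1 + 10 * (((θ.ℓ₆ + 1 : ℕ) : ℝ)) * a12) * Real.exp (4 * (10 * (((θ.ℓ₆ + 1 : ℕ) : ℝ)) * a12)) * (((θ.ℓ₆ + 1 : ℕ) : ℝ)) ≤ ϑF) (sch : ℝ → ℝ) (hsch0 : ∀ β', 0 ≤ β' → β' < 1 → 0 < sch β') (hsch1 : ∀ β', 0 ≤ β' → β' < 1 → sch β' < 1) (hschβ : ∀ β', 0 ≤ β' → β' < 1 → β' < sch β') (hwsch : ∀ β', 0 ≤ β' → β' < 1 → 0 < w13 (sch β')) (δ45 : ℝ) (hδ45 : δ12₃ < δ45) (BZ : ℝ → ℝ)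 (hBZ : ∀ β', 0 ≤ β' → β' < 1 → 0 ≤ BZ β') (hBZge : ∀ β', 0 ≤ β' → β' < 1 → (((θ.ℓ₆ + 1 : ℕ) : ℝ)) * inputConst45 (exp261 (@geo9Y θ.d₆ θ.ℓ₆ θ.hd' θ.hL' θ.b₀ θ.b₁ Mstar) q.δ₀ q.α) q.δ₀ q.α q.NI q.NF (((θ.ℓ₆ + 1 : ℕ) : ℝ)) (holderConst (exp261 (@geo9Y θ.d₆ θ.ℓ₆ θ.hd' θ.hL' θ.b₀ θ.b₁ Mstar) q.δ₀ q.α) q.δ₀ q.α q.NH q.NF (const37 (exp261 (@geo9Y θ.d₆ θ.ℓ₆ θ.hd' θ.hL' θ.b₀ θ.b₁ Mstar) q.δ₀ q.α) q.δ₀ q.α q.ρ q.B₀ q.Nc q.N' q.Cℓ q.Kc) (q.Bl β') (q.Bt β')) (q.BI2 (sch β' - β') β') (q.θI (sch β')) ≤ BZ β') (hδ45le : δ45 ≤ ((1 - q.αF) * ((1 - 2 * q.α) * q.δ₀) - q.α * q.δ₀))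
    (θ₂ δ₂ : ℝ) (hθ₂ : 0 ≤ θ₂) (hrT4 : rT ≤ δ46 θ.d₆ θ.ℓ₆ θ.hd' θ.hL' θ.b₀ θ.b₁ Mstar N c hc) (hrT2 : rT ≤ δ₂) (hδ₃T : δ12₃ ≤ (1 - 2 * q.αF) * rT - σS) (hδ12₃F : δ12₃ ≤ (1 - 2 * p.αF) * ((1 - 2 * p.α) * p.δ₀)) (hD2sup : ∀ x : MemberY θ.d₆ θ.ℓ₆ θ.hd' θ.hL' θ.b₀ θ.b₁ Mstar, M12 ≤ (geo9Y x).M → ∀ α₀ : ℝ, 0 < α₀ → (geo9Y x).M * α₀ ≤ a12 → ∀ U : (bg9YR (Matrix (Fin N) (Fin N) ℂ) (specialUnitaryUnits (Fin N)) R₁ R₂ x).Cfg, (bg9YR (Matrix (Fin N) (Fin N) ℂ) (specialUnitaryUnits (Fin N)) R₁ R₂ x).Reg335 c α₀ U → (bg9YR (Matrix (Fin N) (Fin N) ℂ) (specialUnitaryUnits (Fin N)) R₁ R₂ x).Reg336 c α₀ U → B6RandomWalk.HasMajorant (g := toB6 (geo9Y x) 1 (H x)) (𝔬12 x).blk (D2coK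 x.toKIdx (trBasis N) (bg9YR (Matrix (Fin N) (Fin N) ℂ) (specialUnitaryUnits (Fin N)) R₁ R₂ x) (fun U => U) ((𝔯 x).Δ2) U) (fun (a b : (geo9Y x).Site) => θ₂ * ((geo9Y x).M * α₀) * ((geo9Y x).len a ^ 2)⁻¹ * Real.exp (-(δ₂ * (geo9Y x).dist a b)))) (δ45Y : ℝ) (hδ45Y : δ12₃ < δ45Y) (BiY : ℝ → ℝ) (hBiY : ∀ β', 0 ≤ β' → β' < 1 → 0 ≤ BiY β')  (αW σW δFW : ℝ) (hαW0 : 0 < αW) (hαW1 : αW < 1) (hσW : 0 < σW) (hδFW : 0 < δFW) (hδFP : δFW ≤ min ((1 - 2 * p.α) * p.δ₀) δ39 / 8) (hbudW : 0 ≤ δFW - αW * δFW - 2 * σW) (hδ3W : δ12₃ ≤ δFW - αW * δFW - 2 * σW) (hwschX : ∀ β', 0 ≤ β' → β' < 1 → 0 < wX (sch β')) (δ45W : ℝ) (hδ45W : δFW - αW * δFW - 2 * σW ≤ δ45W) (B45W : ℝ → ℝ) (hB45W : ∀ β', 0 ≤ β' → β' < 1 → 0 ≤ B45W β') (δhW :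 ℝ) (hδhW : δFW - αW * δFW - σW ≤ δhW) (BhW : ℝ → ℝ) (hBhW : ∀ β', 0 ≤ β' → β' < 1 → 0 ≤ BhW β') (hB45Wge : ∀ β', 0 ≤ β' → β' < 1 → let Cσ : ℝ := ((((θ.ℓ₆ + 1 : ℕ) : ℝ)) * ((((θ.ℓ₆ + 1 : ℕ) : ℝ)) ^ 3 * (2 + 2 * coordBound39 (trBasis N) * basisBound39 (trBasis N) * (((θ.ℓ₆ + 1 : ℕ) : ℝ)) ^ 2)) * Real.exp ((1 - p.αF) * ((1 - 2 * p.α) * p.δ₀) * (2 * (rNear θ.d₆ θ.ℓ₆ + 1) + (((θ.d₆ : ℝ) + 1) * (((θ.ℓ₆ : ℝ) + 1) + 1) + 2)))); let X44 : ℝ := ((((θ.ℓ₆ + 1 : ℕ) : ℝ)) * ((1 + CLip θ.d₆ θ.ℓ₆) * inputConst44 (exp261 (@geo9Y θ.d₆ θ.ℓ₆ θ.hd' θ.hL' θ.b₀ θ.b₁ Mstar) p.δ₀ p.α) p.δ₀ p.α p.NI p.N' (p.C (exp261 (@geo9Y θ.d₆ θ.ℓ₆ θ.hd' θ.hL' θ.b₀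 θ.b₁ Mstar) p.δ₀ p.α)) (((θ.ℓ₆ + 1 : ℕ) : ℝ)) (p.BI (sch β')) (p.θI (sch β')) * Cσ * B6.c1 (exp261 (@geo9Y θ.d₆ θ.ℓ₆ θ.hd' θ.hL' θ.b₀ θ.b₁ Mstar) p.δ₀ p.α) p.δ₀ p.α)); (((θ.d₆ + 1 : ℕ) : ℝ)) * ((((((θ.ℓ₆ + 1 : ℕ) : ℝ)) * ((1 + CLip θ.d₆ θ.ℓ₆) * inputConst45 (exp261 (@geo9Y θ.d₆ θ.ℓ₆ θ.hd' θ.hL' θ.b₀ θ.b₁ Mstar) p.δ₀ p.α) p.δ₀ p.α p.NI p.N' (((θ.ℓ₆ + 1 : ℕ) : ℝ)) (holderConst (exp261 (@geo9Y θ.d₆ θ.ℓ₆ θ.hd' θ.hL' θ.b₀ θ.b₁ Mstar) p.δ₀ p.α) p.δ₀ p.α p.NH p.N' (p.C (exp261 (@geo9Y θ.d₆ θ.ℓ₆ θ.hd' θ.hL' θ.b₀ θ.b₁ Mstar) p.δ₀ p.α)) (p.Bl β') (p.Bt β')) (p.BI2 (sch β' - β') β') (p.θI (sch β')) * Cσ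 * B6.c1 (exp261 (@geo9Y θ.d₆ θ.ℓ₆ θ.hd' θ.hL' θ.b₀ θ.b₁ Mstar) p.δ₀ p.α) p.δ₀ p.α)) + 2 * coordBound39 (trBasis N) * basisBound39 (trBasis N) * ((θ.ℓ₆ : ℝ) + 1) * Real.exp (((1 - p.αF) * ((1 - 2 * p.α) * p.δ₀) - 3 * (p.α * p.δ₀)) * (((θ.d₆ : ℝ) + 1) * (((θ.ℓ₆ : ℝ) + 1) + 1) + 2)) * ((((θ.d₆ + 1 : ℕ) : ℝ)) ^ 2 * (2 * (10 * (((θ.ℓ₆ + 1 : ℕ) : ℝ)) * (p.a₁ / c)) * (1 + 10 * (((θ.ℓ₆ + 1 : ℕ) : ℝ)) * (p.a₁ / c)) * Real.exp (4 * (10 * (((θ.ℓ₆ + 1 : ℕ) : ℝ)) * (p.a₁ / c)))) * (((θ.ℓ₆ + 1 : ℕ) : ℝ)) ^ 6) * X44 + coordBound39 (trBasis N) * basisBound39 (trBasis N) * X44 + X44) + X44 + coordBound39 (trBasis N) * basisBound39 (trBasis N) * X44) ≤ B45W β') (hδ45Wle : δ45W ≤ ((1 - p.αF) * ((1 - 2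 * p.α) * p.δ₀) - 3 * (p.α * p.δ₀)))
    -- transfer numerics: dag-n06-c's a₀-uniform closed (3.44)-profile and the Conv342 rate versus the displayed letters `BhW δhW` of rows 20–21 (edition 93: `hpDGW` DERIVED)
    (hBhWge : ∀ β', 0 ≤ β' → β' < 1 → ((B9RWSums343Holder.holderConst (B9RWSums347DefiniteFaces.exp261 (@geo9Y θ.d₆ θ.ℓ₆ θ.hd' θ.hL' θ.b₀ θ.b₁ Mstar) p.δ₀ p.α) p.δ₀ p.α p.NH p.N' (p.C (B9RWSums347DefiniteFaces.exp261 (@geo9Y θ.d₆ θ.ℓ₆ θ.hd' θ.hL' θ.b₀ θ.b₁ Mstar) p.δ₀ p.α)) (p.Bl β') (p.Bt β') + 2 * B9Thm39ReadingCoords.coordBound39 (trBasis N) * B9Thm39ReadingCoords.basisBound39 (trBasis N) * ((θ.ℓ₆ : ℝ) + 1) * Real.exp (((1 - 2 * p.α) * p.δ₀) * (((θ.d₆ : ℝ) + 1) * (((θ.ℓ₆ : ℝ) + 1) + 1) + 2)) * ((((θ.d₆ + 1 : ℕ) : ℝ)) ^ 2 * (2 * (10 * ((θ.ℓ₆ +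 1 : ℕ) : ℝ) * (p.a₁ / c)) * (1 + 10 * ((θ.ℓ₆ + 1 : ℕ) : ℝ) * (p.a₁ / c)) * Real.exp (4 * (10 * ((θ.ℓ₆ + 1 : ℕ) : ℝ) * (p.a₁ / c)))) * ((θ.ℓ₆ + 1 : ℕ) : ℝ) ^ 6) * (p.C (B9RWSums347DefiniteFaces.exp261 (@geo9Y θ.d₆ θ.ℓ₆ θ.hd' θ.hL' θ.b₀ θ.b₁ Mstar) p.δ₀ p.α)) + B9Thm39ReadingCoords.coordBound39 (trBasis N) * B9Thm39ReadingCoords.basisBound39 (trBasis N) * (p.C (B9RWSums347DefiniteFaces.exp261 (@geo9Y θ.d₆ θ.ℓ₆ θ.hd' θ.hL' θ.b₀ θ.b₁ Mstar) p.δ₀ p.α)) + (p.C (B9RWSums347DefiniteFaces.exp261 (@geo9Y θ.d₆ θ.ℓ₆ θ.hd' θ.hL' θ.b₀ θ.b₁ Mstar) p.δ₀ p.α))) + (p.C (B9RWSums347DefiniteFaces.exp261 (@geo9Y θ.d₆ θ.ℓ₆ θ.hd' θ.hL' θ.b₀ θ.b₁ Mstar) p.δ₀ p.α)) + B9Thm39ReadingCoords.coordBound39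 (trBasis N) * B9Thm39ReadingCoords.basisBound39 (trBasis N) * (p.C (B9RWSums347DefiniteFaces.exp261 (@geo9Y θ.d₆ θ.ℓ₆ θ.hd' θ.hL' θ.b₀ θ.b₁ Mstar) p.δ₀ p.α))) ≤ BhW β') (hδhWle : δhW ≤ ((1 - 2 * p.α) * p.δ₀)) (CP : ℝ) (hCPge : ((θ.d₆ + 1 : ℕ) : ℝ) * (coordBound39 (trBasis N) * basisBound39 (trBasis N) * nearBlkCntY θ.d₆ θ.ℓ₆ θ.hd' θ.hL' θ.b₀ θ.b₁ Mstar * ((max 1 (N : ℝ) * ((nbrCountY θ.d₆ θ.ℓ₆ θ.hd' θ.hL' θ.b₀ θ.b₁ 2 : ℝ) * p.C (B9RWSums347DefiniteFaces.exp261 (@geo9Y θ.d₆ θ.ℓ₆ θ.hd' θ.hL' θ.b₀ θ.b₁ Mstar) p.δ₀ p.α) * Real.exp (2 * ((1 - 2 * p.α) * p.δ₀)))) * (cR39 (basis39 (Matrix (Fin N) (Fin N) ℂ)) * Fintype.card (κ39 (Matrix (Fin N) (Fin N) ℂ)) * B39 * Real.exp (2 * δ39)) * (max 1 (N : ℝ)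 * ((nbrCountY θ.d₆ θ.ℓ₆ θ.hd' θ.hL' θ.b₀ θ.b₁ 2 : ℝ) * p.C (B9RWSums347DefiniteFaces.exp261 (@geo9Y θ.d₆ θ.ℓ₆ θ.hd' θ.hL' θ.b₀ θ.b₁ Mstar) p.δ₀ p.α) * Real.exp (2 * ((1 - 2 * p.α) * p.δ₀)))) * cg349 θ.d₆ θ.ℓ₆ θ.hd' θ.hL' θ.b₀ θ.b₁ ((1 - 2 * p.α) * p.δ₀) δ39) * Real.exp (2 * (min ((1 - 2 * p.α) * p.δ₀) δ39 / 8))) ≤ CP) (hBxW : ∀ β', 0 ≤ β' → β' < 1 → (cR39 (trBasis N))⁻¹ * ((wX (sch β'))⁻¹ * B45W β' + BhW β' * (CP * (((θ.ℓ₆ + 1 : ℕ) : ℝ))) * ((wX (sch β'))⁻¹ * ((((θ.ℓ₆ + 1 : ℕ) : ℝ)) * Real.exp ((δFW - αW * δFW - σW) * (rNear θ.d₆ θ.ℓ₆ + 1)))) * rowConst261 (@geo9Y θ.d₆ θ.ℓ₆ θ.hd' θ.hL' θ.b₀ θ.b₁ Mstar) σW * rowConst261 (@geo9Y θ.d₆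 θ.ℓ₆ θ.hd' θ.hL' θ.b₀ θ.b₁ Mstar) σW) ≤ Bx13 β') (hBiYge : ∀ β', 0 ≤ β' → β' < 1 → (((θ.ℓ₆ + 1 : ℕ) : ℝ)) * inputConst45 (exp261 (@geo9Y θ.d₆ θ.ℓ₆ θ.hd' θ.hL' θ.b₀ θ.b₁ Mstar) q.δ₀ q.α) q.δ₀ q.α q.NI q.NF (((θ.ℓ₆ + 1 : ℕ) : ℝ)) (holderConst (exp261 (@geo9Y θ.d₆ θ.ℓ₆ θ.hd' θ.hL' θ.b₀ θ.b₁ Mstar) q.δ₀ q.α) q.δ₀ q.α q.NH q.NF (const37 (exp261 (@geo9Y θ.d₆ θ.ℓ₆ θ.hd' θ.hL' θ.b₀ θ.b₁ Mstar) q.δ₀ q.α) q.δ₀ q.α q.ρ q.B₀ q.Nc q.N' q.Cℓ q.Kc) (q.Bl β') (q.Bt β')) (q.BI2 (sch β' - β') β') (q.θI (sch β')) ≤ BiY β') (hδ45Yle : δ45Y ≤ ((1 - q.αF) * ((1 - 2 * q.α) * q.δ₀) - q.α * q.δ₀))-- (editions 97∕99∕101) Thm 3.13's block-L² pair record of rows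 20–21 is ASSEMBLED from the legs `g0qstar_l2_letters_of_pins` (n06-l), `dv_letters_of_pins`, `rgdI_of_pinsR`, `rgdDs_rgdDd_of_pinsR` (n06-c); its `C₁` line is derived INSIDE dag-n06-l's face v1.6 `…StateSUCL` — no field displayed
    
    -- (K2) dag-n06-l P-U8S″: the (3.152)–(3.153) input letters FIELD-WISE — no `Letters313IML` record, hence no right form `tDv` and no θ_V letter
    (hZ : ∀ x : MemberY θ.d₆ θ.ℓ₆ θ.hd' θ.hL' θ.b₀ θ.b₁ Mstar, M12 ≤ (geo9Y x).M → ∀ α₀ : ℝ, 0 < α₀ → (geo9Y x).M * α₀ ≤ a12 → ∀ U : (bg9YR (Matrix (Fin N) (Fin N) ℂ) (specialUnitaryUnits (Fin N)) R₁ R₂ x).Cfg, (bg9YR (Matrix (Fin N) (Fin N) ℂ) (specialUnitaryUnits (Fin N)) R₁ R₂ x).Reg335 c α₀ U → (bg9YR (Matrix (Fin N) (Fin N) ℂ) (specialUnitaryUnits (Fin N)) R₁ R₂ x).Reg336 c α₀ U → QY x.toKIdx (parBY x.toKIdx) U ∘ₗ gradY x.toKIdx U ∘ₗ GpPhysY x.toKIdx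 (parSymY x.toKIdx) U ∘ₗ RY x.toKIdx (parSymY x.toKIdx) (GpPhysY x.toKIdx (parSymY x.toKIdx)) U = 0)  -- rows 20–21's `Letters313DZ ∕ DMZ` records SPLIT (edition 53): the four non-Hölder fields displayed, the Hölder entries `dgDH ∕ dgDHd` DERIVED (`N06DgLegAtPinsPhysPU`, ed. 61) from the (3.44) members `h44m` below
    (s44 : ℝ) (hs440 : 0 < s44) (hs441 : s44 < 1) (hws44 : 0 < w13 s44) (δ44 : ℝ) (hδ44 : δ12₃ < δ44) (Bi44 : ℝ) (hBi44 : 0 ≤ Bi44) (hB12₃d : ((θ.d₆ : ℝ) + 1) * ((1 + CLip θ.d₆ θ.ℓ₆) * Bi44 * (CJG θ.d₆ θ.ℓ₆ (trBasis N) s44 (thetaL θ.d₆ θ.ℓ₆ ϑF) (w13 s44) (δ12₃ + 1 + 1 / 2 * (δ44 - δ12₃)) * (((θ.ℓ₆ + 1 : ℕ) : ℝ))) * rowConst261 (@geo9Y θ.d₆ θ.ℓ₆ θ.hd' θ.hL' θ.b₀ θ.b₁ Mstar) 1) ≤ B12₃) (hB12₃p : ((θ.d₆ : ℝ) + 1)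 * (1 * (((θ.d₆ : ℝ) + 1) * ((1 + CLip θ.d₆ θ.ℓ₆) * Bi44 * (CJG θ.d₆ θ.ℓ₆ (trBasis N) s44 (thetaL θ.d₆ θ.ℓ₆ ϑF) (w13 s44) (δ12₃ + 1 + 1 / 2 * (δ44 - δ12₃)) * (((θ.ℓ₆ + 1 : ℕ) : ℝ))) * rowConst261 (@geo9Y θ.d₆ θ.ℓ₆ θ.hd' θ.hL' θ.b₀ θ.b₁ Mstar) 1)) * rowConst261 (@geo9Y θ.d₆ θ.ℓ₆ θ.hd' θ.hL' θ.b₀ θ.b₁ Mstar) 1) ≤ B12₃) (hBi44ge : (((θ.ℓ₆ + 1 : ℕ) : ℝ)) * inputConst44 (exp261 (@geo9Y θ.d₆ θ.ℓ₆ θ.hd' θ.hL' θ.b₀ θ.b₁ Mstar) q.δ₀ q.α) q.δ₀ q.α q.NI q.NF (const37 (exp261 (@geo9Y θ.d₆ θ.ℓ₆ θ.hd' θ.hL' θ.b₀ θ.b₁ Mstar) q.δ₀ q.α) q.δ₀ q.α q.ρ q.B₀ q.Nc q.N' q.Cℓ q.Kc) (((θ.ℓ₆ + 1 : ℕ) :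 ℝ)) (q.BI s44) (q.θI s44) ≤ Bi44) (hδ44le : δ44 ≤ ((1 - q.αF) * ((1 - 2 * q.α) * q.δ₀) - q.α * q.δ₀)) (hwX44 : 0 < wX s44) (B44G δ44G : ℝ) (hB44G : 0 ≤ B44G) (hδ44G : δFW - αW * δFW - 2 * σW ≤ δ44G) (hB44Gge : let Cσ : ℝ := ((((θ.ℓ₆ + 1 : ℕ) : ℝ)) * ((((θ.ℓ₆ + 1 : ℕ) : ℝ)) ^ 3 * (2 + 2 * coordBound39 (trBasis N) * basisBound39 (trBasis N) * (((θ.ℓ₆ + 1 : ℕ) : ℝ)) ^ 2)) * Real.exp ((1 - p.αF) * ((1 - 2 * p.α) * p.δ₀) * (2 * (rNear θ.d₆ θ.ℓ₆ + 1) + (((θ.d₆ : ℝ) + 1) * (((θ.ℓ₆ : ℝ) + 1) + 1) + 2)))); (((θ.ℓ₆ + 1 : ℕ) : ℝ)) * ((((θ.d₆ + 1 : ℕ) : ℝ)) * ((1 + CLip θ.d₆ θ.ℓ₆) * inputConst44 (exp261 (@geo9Y θ.d₆ θ.ℓ₆ θ.hd' θ.hL' θ.b₀ θ.b₁ Mstar)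 p.δ₀ p.α) p.δ₀ p.α p.NI p.N' (p.C (exp261 (@geo9Y θ.d₆ θ.ℓ₆ θ.hd' θ.hL' θ.b₀ θ.b₁ Mstar) p.δ₀ p.α)) (((θ.ℓ₆ + 1 : ℕ) : ℝ)) (p.BI s44) (p.θI s44) * Cσ * B6.c1 (exp261 (@geo9Y θ.d₆ θ.ℓ₆ θ.hd' θ.hL' θ.b₀ θ.b₁ Mstar) p.δ₀ p.α) p.δ₀ p.α)) ≤ B44G) (hδ44Gle : δ44G ≤ ((1 - p.αF) * ((1 - 2 * p.α) * p.δ₀) - 3 * (p.α * p.δ₀))) (hB₃wG : (cR39 (trBasis N))⁻¹ * ((wX s44)⁻¹ * B44G + (((θ.d₆ + 1 : ℕ) : ℝ) * p.C (B9RWSums347DefiniteFaces.exp261 (@geo9Y θ.d₆ θ.ℓ₆ θ.hd' θ.hL' θ.b₀ θ.b₁ Mstar) p.δ₀ p.α)) * (CP * (((θ.ℓ₆ + 1 : ℕ) : ℝ))) * ((wX s44)⁻¹ * ((((θ.ℓ₆ + 1 : ℕ) : ℝ)) * Real.exp ((δFW - αW * δFW - σW) * (rNear θ.d₆ θ.ℓ₆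 + 1)))) * rowConst261 (@geo9Y θ.d₆ θ.ℓ₆ θ.hd' θ.hL' θ.b₀ θ.b₁ Mstar) σW * rowConst261 (@geo9Y θ.d₆ θ.ℓ₆ θ.hd' θ.hL' θ.b₀ θ.b₁ Mstar) σW) ≤ B12₃) (BHG : ℝ) (hBHG : 0 ≤ BHG) (hwBhG : ∀ s, 0 < s → s < 1 → wX s * holderConst (exp261 (@geo9Y θ.d₆ θ.ℓ₆ θ.hd' θ.hL' θ.b₀ θ.b₁ Mstar) q.δ₀ q.α) q.δ₀ q.α q.NH q.NF (const37 (exp261 (@geo9Y θ.d₆ θ.ℓ₆ θ.hd' θ.hL' θ.b₀ θ.b₁ Mstar) q.δ₀ q.α) q.δ₀ q.α q.ρ q.B₀ q.Nc q.N' q.Cℓ q.Kc) (q.Bl s) (q.Bt s) ≤ BHG) (B43 δ43 : ℝ) (hB43 : 0 ≤ B43) (B₀D : ℝ) (hB₀D : 0 ≤ B₀D)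
    -- [B9 Thm 3.3 (3.43) p.397 for G′∇* — INPUT BUDGET of dag-n06-c's assembler `h43Gp_of_thm37PrintedSN` (rows 18 ⇒ rows 20–21): the s-profile of the (3.42)/(3.44) Hölder constants, weighted by `w13`, is ≤ B₀D]
    (hbudD : ∀ s : ℝ, 0 < s → s < 1 → w13 s * ((((θ.d₆ + 1 : ℕ) : ℝ)) * (B9RWSums343Holder.holderConst (B9RWSums347DefiniteFaces.exp261 (@geo9Y θ.d₆ θ.ℓ₆ θ.hd' θ.hL' θ.b₀ θ.b₁ Mstar) p.δ₀ p.α) p.δ₀ p.α p.NH p.N' (p.C (B9RWSums347DefiniteFaces.exp261 (@geo9Y θ.d₆ θ.ℓ₆ θ.hd' θ.hL' θ.b₀ θ.b₁ Mstar) p.δ₀ p.α)) (p.Bl s) (p.Bt s) + 2 * B9Thm39ReadingCoords.coordBound39 (trBasis N) * B9Thm39ReadingCoords.basisBound39 (trBasis N) * ((θ.ℓ₆ : ℝ) + 1) * Real.exp (((1 - 2 * p.α) * p.δ₀) * (((θ.d₆ : ℝ) + 1) * (((θ.ℓ₆ : ℝ) + 1) + 1) + 2)) * ((((θ.d₆ +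 1 : ℕ) : ℝ)) ^ 2 * (2 * (10 * ((θ.ℓ₆ + 1 : ℕ) : ℝ) * (p.a₁ / c)) * (1 + 10 * ((θ.ℓ₆ + 1 : ℕ) : ℝ) * (p.a₁ / c)) * Real.exp (4 * (10 * ((θ.ℓ₆ + 1 : ℕ) : ℝ) * (p.a₁ / c)))) * ((θ.ℓ₆ + 1 : ℕ) : ℝ) ^ 6) * (p.C (B9RWSums347DefiniteFaces.exp261 (@geo9Y θ.d₆ θ.ℓ₆ θ.hd' θ.hL' θ.b₀ θ.b₁ Mstar) p.δ₀ p.α)) + B9Thm39ReadingCoords.coordBound39 (trBasis N) * B9Thm39ReadingCoords.basisBound39 (trBasis N) * (p.C (B9RWSums347DefiniteFaces.exp261 (@geo9Y θ.d₆ θ.ℓ₆ θ.hd' θ.hL' θ.b₀ θ.b₁ Mstar) p.δ₀ p.α)) + (p.C (B9RWSums347DefiniteFaces.exp261 (@geo9Y θ.d₆ θ.ℓ₆ θ.hd' θ.hL' θ.b₀ θ.b₁ Mstar) p.δ₀ p.α)))) ≤ B₀D)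
    -- transfer numerics: the assembler's closed (3.43) constant and rate versus the displayed letters `B43 δ43` of rows 20–21
    (hB43ge : (((θ.ℓ₆ + 1 : ℕ) : ℝ)) * ((((θ.d₆ + 1 : ℕ) : ℝ)) * (p.C (B9RWSums347DefiniteFaces.exp261 (@geo9Y θ.d₆ θ.ℓ₆ θ.hd' θ.hL' θ.b₀ θ.b₁ Mstar) p.δ₀ p.α)) + B₀D) * Real.exp (((1 - 2 * p.α) * p.δ₀) * (rNear θ.d₆ θ.ℓ₆ + 1)) ≤ B43) (hδ43le : δ43 ≤ ((1 - 2 * p.α) * p.δ₀)) (ρrg : ℝ) (hρrg0 : 0 ≤ ρrg) (hbudrg : ρrg + σW + αW * δFW ≤ δFW) (hbud43 : ρrg + σW ≤ δ43) (hδ₃rg : δ12₃ ≤ ρrg) (hB₃rg : B43 * (cR39 (trBasis N))⁻¹ * rowConst261 (@geo9Y θ.d₆ θ.ℓ₆ θ.hd' θ.hL' θ.b₀ θ.b₁ Mstar) σW + CTel θ.d₆ θ.ℓ₆ (trBasis N) ρrg (CP * (((θ.ℓ₆ + 1 : ℕ) : ℝ)) * ((((θ.d₆ + 1 : ℕ)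 : ℝ) * p.C (B9RWSums347DefiniteFaces.exp261 (@geo9Y θ.d₆ θ.ℓ₆ θ.hd' θ.hL' θ.b₀ θ.b₁ Mstar) p.δ₀ p.α)) * (cR39 (trBasis N))⁻¹ * rowConst261 (@geo9Y θ.d₆ θ.ℓ₆ θ.hd' θ.hL' θ.b₀ θ.b₁ Mstar) σW) * rowConst261 (@geo9Y θ.d₆ θ.ℓ₆ θ.hd' θ.hL' θ.b₀ θ.b₁ Mstar) σW) (CP * (((θ.ℓ₆ + 1 : ℕ) : ℝ)) * ((((θ.d₆ + 1 : ℕ) : ℝ) * p.C (B9RWSums347DefiniteFaces.exp261 (@geo9Y θ.d₆ θ.ℓ₆ θ.hd' θ.hL' θ.b₀ θ.b₁ Mstar) p.δ₀ p.α)) * (cR39 (trBasis N))⁻¹ * rowConst261 (@geo9Y θ.d₆ θ.ℓ₆ θ.hd' θ.hL' θ.b₀ θ.b₁ Mstar) σW) * rowConst261 (@geo9Y θ.d₆ θ.ℓ₆ θ.hd' θ.hL' θ.b₀ θ.b₁ Mstar) σW) ≤ B12₃) {E14₁ E14₂ : ∀ x : MemberY θ.d₆ θ.ℓ₆ θ.hd'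 θ.hL' θ.b₀ θ.b₁ Mstar, B9.RWExpansion (geo9Y x) (bg9YR (Matrix (Fin N) (Fin N) ℂ) (specialUnitaryUnits (Fin N)) R₁ R₂ x)} (T14₁ : ∀ x : MemberY θ.d₆ θ.ℓ₆ θ.hd' θ.hL' θ.b₀ θ.b₁ Mstar, (E14₁ x).Walk → BondOpY (Matrix (Fin N) (Fin N) ℂ) x.toKIdx) (T14₂ : ∀ x : MemberY θ.d₆ θ.ℓ₆ θ.hd' θ.hL' θ.b₀ θ.b₁ Mstar, (E14₂ x).Walk → BondOpY (Matrix (Fin N) (Fin N) ℂ) x.toKIdx) (X14₁ : ∀ x : MemberY θ.d₆ θ.ℓ₆ θ.hd' θ.hL' θ.b₀ θ.b₁ Mstar, (E14₁ x).Walk → ℕ → (geo9Y x).Site → Prop) (M14₁ : ∀ x : MemberY θ.d₆ θ.ℓ₆ θ.hd' θ.hL' θ.b₀ θ.b₁ Mstar, (E14₁ x).Walk → ℕ → Prop) (X14₂ : ∀ x : MemberY θ.d₆ θ.ℓ₆ θ.hd' θ.hL' θ.b₀ θ.b₁ Mstar, (E14₂ x).Walk → ℕ → (geo9Y x).Site →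 Prop) (M14₂ : ∀ x : MemberY θ.d₆ θ.ℓ₆ θ.hd' θ.hL' θ.b₀ θ.b₁ Mstar, (E14₂ x).Walk → ℕ → Prop) (diam14 : MemberY θ.d₆ θ.ℓ₆ θ.hd' θ.hL' θ.b₀ θ.b₁ Mstar → ℝ) (r14 : ℝ) (hr14 : ∀ x, diam14 x ≤ r14) (near14₁ : ∀ (x : MemberY θ.d₆ θ.ℓ₆ θ.hd' θ.hL' θ.b₀ θ.b₁ Mstar) ω m p, M14₁ x ω m → X14₁ x ω m p → ∃ q, q ∈ OmegaC x.D x.D' ∧ tdistK (ℓ := θ.ℓ₆) (Mh := x.Mh) (k := x.k) (P := x.P') (kLab x p) q ≤ diam14 x) (first14₁ : ∀ (x : MemberY θ.d₆ θ.ℓ₆ θ.hd' θ.hL' θ.b₀ θ.b₁ Mstar) ω y, (E14₁ x).first ω y → X14₁ x ω 0 y)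
    (chain14₁ : ∀ (x : MemberY θ.d₆ θ.ℓ₆ θ.hd' θ.hL' θ.b₀ θ.b₁ Mstar) ω y y', (E14₁ x).first ω y → (E14₁ x).last ω y' → ∃ l : List (geo9Y x).Site, l.length = (E14₁ x).wlen ω ∧ (∀ (m : ℕ) (hm : m < l.length), X14₁ x ω (m + 1) (l[m])) ∧ B9Thm314.chainSum (geo9Y x).dist y l y' ≤ (E14₁ x).wdist ω y y') (near14₂ : ∀ (x : MemberY θ.d₆ θ.ℓ₆ θ.hd' θ.hL' θ.b₀ θ.b₁ Mstar) ω m p, M14₂ x ω m → X14₂ x ω m p → ∃ q, q ∈ OmegaC x.D x.D' ∧ tdistK (ℓ := θ.ℓ₆) (Mh := x.Mh) (k := x.k) (P := x.P') (kLab x p) q ≤ diam14 x) (first14₂ : ∀ (x : MemberY θ.d₆ θ.ℓ₆ θ.hd' θ.hL' θ.b₀ θ.b₁ Mstar) ω y, (E14₂ x).first ω y → X14₂ x ω 0 y) (chain14₂ : ∀ (x : MemberY θ.d₆ θ.ℓ₆ θ.hd' θ.hL' θ.b₀ θ.b₁ Mstar) ω y y', (E14₂ x).first ω y → (E14₂ x).last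 ω y' → ∃ l : List (geo9Y x).Site, l.length = (E14₂ x).wlen ω ∧ (∀ (m : ℕ) (hm : m < l.length), X14₂ x ω (m + 1) (l[m])) ∧ B9Thm314.chainSum (geo9Y x).dist y l y' ≤ (E14₂ x).wdist ω y y') (h14₁ : Thm310AllNormsPrinted c geo9Y (bg9YR (Matrix (Fin N) (Fin N) ℂ) (specialUnitaryUnits (Fin N)) R₁ R₂) E14₁ (fun x ω => kernelFamilyB x.toKIdx (bg9YR (Matrix (Fin N) (Fin N) ℂ) (specialUnitaryUnits (Fin N)) R₁ R₂ x) (fun U => U) (T14₁ x ω) (lettersYOfRecordV4P N θ.toStage3Params Mstar 𝔯 x).parB)) (h14₂ : Thm310AllNormsPrinted c geo9Y (bg9YR (Matrix (Fin N) (Fin N) ℂ) (specialUnitaryUnits (Fin N)) R₁ R₂) E14₂ (fun x ω => kernelFamilyB x.toKIdx (bg9YR (Matrix (Fin N) (Fin N) ℂ) (specialUnitaryUnits (Fin N)) R₁ R₂ x) (fun U => U) (T14₂ x ω) (lettersYOfRecordV4P N θ.toStage3Params Mstar 𝔯 x).parB)) (W14₁ : ∀ x : MemberY θ.d₆ θ.ℓ₆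 θ.hd' θ.hL' θ.b₀ θ.b₁ Mstar, ℕ → (geo9Y x).Site → (geo9Y x).Site → Finset (E14₁ x).Walk) (W14₂ : ∀ x : MemberY θ.d₆ θ.ℓ₆ θ.hd' θ.hL' θ.b₀ θ.b₁ Mstar, ℕ → (geo9Y x).Site → (geo9Y x).Site → Finset (E14₂ x).Walk) (hW14₁ : ∀ x, WalkSetsSpec (E14₁ x) (W14₁ x)) (hW14₂ : ∀ x, WalkSetsSpec (E14₂ x) (W14₂ x)) (hcnt14₁ : WalkWeightsSummable geo9Y (bg9YR (Matrix (Fin N) (Fin N) ℂ) (specialUnitaryUnits (Fin N)) R₁ R₂) E14₁ W14₁) (hcnt14₂ : WalkWeightsSummable geo9Y (bg9YR (Matrix (Fin N) (Fin N) ℂ) (specialUnitaryUnits (Fin N)) R₁ R₂) E14₂ W14₂) (hexp14 : ∀ (x : MemberY θ.d₆ θ.ℓ₆ θ.hd' θ.hL' θ.b₀ θ.b₁ Mstar) (U : (bg9YR (Matrix (Fin N) (Fin N) ℂ) (specialUnitaryUnits (Fin N)) R₁ R₂ x).Cfg), (E14₁ x).Converges U ∧ (E14₂ x).Converges U → ExpansionReads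 x.toKIdx (B := bg9YR (Matrix (Fin N) (Fin N) ℂ) (specialUnitaryUnits (Fin N)) R₁ R₂ x) (fun U => U) (lettersYOfRecordV4P N θ.toStage3Params Mstar 𝔯 x).Kdiff (pairOp (locDataY x (E14₁ x) (X14₁ x) (M14₁ x) (diam14 x)).Touches (locData₂ (locDataY x (E14₁ x) (X14₁ x) (M14₁ x) (diam14 x)) (X14₂ x) (M14₂ x)).Touches (T14₁ x) (T14₂ x)) (pairWalkSets (W14₁ x) (W14₂ x) (locDataY x (E14₁ x) (X14₁ x) (M14₁ x) (diam14 x)).Touches (locData₂ (locDataY x (E14₁ x) (X14₁ x) (M14₁ x) (diam14 x)) (X14₂ x) (M14₂ x)).Touches) U) {a₀E δ₁E B₁E : ℝ} (ha₀E : 0 < a₀E) (hδ₁E : 0 < δ₁E) (hB₁E : 0 < B₁E) (hE : ∀ (x : MemberY θ.d₆ θ.ℓ₆ θ.hd' θ.hL' θ.b₀ θ.b₁ Mstar), (Mstar : ℝ) ≤ (geo9Y x).M → ∀ (α₀ : ℝ), 0 < α₀ → (geo9Y x).M * α₀ ≤ a₀E → ∀ U : (bg9YR (Matrix (Fin N)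 (Fin N) ℂ) (specialUnitaryUnits (Fin N)) R₁ R₂ x).Cfg, (bg9YR (Matrix (Fin N) (Fin N) ℂ) (specialUnitaryUnits (Fin N)) R₁ R₂ x).Reg335 c α₀ U → (bg9YR (Matrix (Fin N) (Fin N) ℂ) (specialUnitaryUnits (Fin N)) R₁ R₂ x).Reg336 c α₀ U → givenBy3185stY x (lettersYOfRecordV4P N θ.toStage3Params Mstar 𝔯 x) (sectEStYOfRecordV7 N θ.toStage3Params Mstar 𝔢₀ x) U ∧ hasRWExpCY (𝔴 x) U δ₁E ∧ DecayMidOnStY x (lettersYOfRecordV4P N θ.toStage3Params Mstar 𝔯 x) (sectEStYOfRecordV7 N θ.toStage3Params Mstar 𝔢₀ x) B₁E U δ₁E)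
    -- U8 (№272 (5), №289): the state layer's weight loss τS, producer∕reading rate δP, the sup bound Bx13₀, the S-leaves' budget ρ12 + 2σ12 ≤ δP, and the U8 rate budget hU8a–l
    (τS δP Bx13₀ : ℝ) (hτS : 0 < τS) (hBx13₀ : 0 ≤ Bx13₀) (hwBx13 : ∀ s, 0 < s → s < 1 → wX s * Bx13 s ≤ Bx13₀) (hρP12 : ρ12 + 2 * σ12 ≤ δP) (hU8a : δK12 + 3 * σS + 4 * τS ≤ (1 - 2 * p.α) * p.δ₀) (hU8b : δK12 + 3 * σS + 4 * τS ≤ min ((1 - 2 * p.α) * p.δ₀) δ39 / 8) (hU8c : δK12 + 3 * σS + 4 * τS ≤ δ₂) (hU8d : δK12 + 3 * σS + 5 * τS ≤ δ44G) (hU8e : δK12 + 3 * σS + 4 * τS ≤ δB) (hU8f : δK12 + 2 * σS + τS ≤ δ43) (hU8g : δK12 + τS + σS ≤ δT12) (hU8h : δK12 + τS + σS ≤ δ12₃) (hU8i : δK12 + τS + σS ≤ δP) (hU8j : δP + 2 * τS ≤ δ12₀) (hU8k : δP + σS + 2 * τS ≤ δ12₃)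
    -- (edition 109, `hrgdd13` DERIVED) the LEG margin `τR` and the SECOND state layer's U8 budget at δK′ := δ12₃ + 5τR, δP′ := δK′ + τS + σS, δ13′ := δP′ + σS + 2τS
    (τR : ℝ) (hτR : 0 < τR) (hR8a : δ12₃ + 5 * τR + 3 * σS + 4 * τS ≤ (1 - 2 * p.α) * p.δ₀) (hR8b : δ12₃ + 5 * τR + 3 * σS + 4 * τS ≤ min ((1 - 2 * p.α) * p.δ₀) δ39 / 8) (hR8c : δ12₃ + 5 * τR + 3 * σS + 4 * τS ≤ δ₂) (hR8d : δ12₃ + 5 * τR + 3 * σS + 5 * τS ≤ δ44G) (hR8e : δ12₃ + 5 * τR + 3 * σS + 4 * τS ≤ δB) (hR8f : δ12₃ + 5 * τR + 2 * σS + τS ≤ δ43) (hR8g : δ12₃ + 5 * τR + τS + σS ≤ δT12) (hR8h : δ12₃ + 5 * τR + 2 * σS + 3 * τS < δ12₀) (hR8i : δ12₃ + 5 * τR + 2 * σS + 3 * τS < δ44) (hR8j : δ12₃ + 5 * τR + 2 * σS + 3 * τS < δ45) (hR8k : δ12₃ + 5 * τR + 2 * σS + 3 * τS < δ45Y)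
    -- (α3) SOCKET road (α) (director-ym №282 (B) ∕ №290 (1)(c)): the Sect.-B step is DERIVED over the coded carrier from dag-n06-c's CLOSED face
    -- `B9SectBStepUClosedSUOfSections.sectBStepU_C37GY_su_extraYPb_closed` (edition 79: its GUARDED Thm-3.11 input `hunitA` is dag-n06-j's THEOREM `hunitA_of_sections`, its basis∕neighbour bookkeeping is standard); displayed = the sub-family, the sections, the real basis
    {J : Type} (f : J → MemberY θ.d₆ θ.ℓ₆ θ.hd' θ.hL' θ.b₀ θ.b₁ Mstar) {ιR : Type} [Fintype ιR] [DecidableEq ιR] (bR : Module.Basis ιR ℝ (Matrix (Fin N) (Fin N) ℂ)) (ιB : ∀ j : J, BlkY (f j).toKIdx → IBondY (f j).toKIdx) (C38 : ∀ j : J, ℝ → CfgY (Matrix (Fin N) (Fin N) ℂ) (f j).toKIdx → AfldY (Matrix (Fin N) (Fin N) ℂ) (f j).toKIdx → Prop) (hι : ∀ (j : J) (s : BlkY (f j).toKIdx), β (f j).toKIdx.hN (f j).toKIdx.D (f j).toKIdx.hk (ιB j s) = s) [instNE : ∀ x : MemberY θ.d₆ θ.ℓ₆ θ.hd' θ.hL'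 θ.b₀ θ.b₁ Mstar, Nonempty (geo9Y x).Site]
    : B9LeafX (Y9OfRecordUPb N θ.toStage3Params Mstar (opsYNuStOfRecordV4PE N θ.toStage3Params Mstar 𝔯 (sectEStYOfRecordV7 N θ.toStage3Params Mstar 𝔢₀) 𝔴 𝔈) f bR ιB C38) := by
  have hΔ2 : ∀ (x : MemberY θ.d₆ θ.ℓ₆ θ.hd' θ.hL' θ.b₀ θ.b₁ Mstar) (U : (bg9YR (Matrix (Fin N) (Fin N) ℂ) (specialUnitaryUnits (Fin N)) R₁ R₂ x).Cfg), (∀ μ z, U μ z ∈ specialUnitaryUnits (Fin N)) → IsSymmTr (fun _ => (1 : ℝ)) ((𝔯 x).Δ2 U) := by subst h𝔯; exact resYOfC2P_Δ2_isSymmTr_SU θ.toStage3Params Mstar 𝔠 h𝔠real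
  let 𝔅 := fun (x : MemberY θ.d₆ θ.ℓ₆ θ.hd' θ.hL' θ.b₀ θ.b₁ Mstar) => bg9YR (Matrix (Fin N) (Fin N) ℂ) (specialUnitaryUnits (Fin N)) R₁ R₂ x; let rd : ∀ x : MemberY θ.d₆ θ.ℓ₆ θ.hd' θ.hL' θ.b₀ θ.b₁ Mstar, WalkReading (geo9Y x) (𝔅 x) (XSK (TrIdx N) x.toKIdx) ↥(cubes x.toKIdx.D.toDomains) := fun x => rdWalkY x (𝔅 x) (fun U => U) (parSymY x.toKIdx)
  obtain ⟨hβI, hlev, hβ1, hbI0⟩ := OpsYBondMapOfRecord.lawsY_of_eq hbI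
  obtain ⟨hEK39, hPD, hE37, hE310, hpinE, hpinH, hpinK⟩ := OpsYExpsOfRecordV2.pins_of_eq (𝔢 := sectEStYOfRecordV7 N θ.toStage3Params Mstar 𝔢₀) (𝔴 := 𝔴) h𝔈
  obtain ⟨hblk12, hblkW12, hblkY12, hG0co12, hGco12, hG1co12, hGGco12, hDco12, hDsco12, hblkZ12, hHm12, hH1m12, hS0co12, hTpico12, hT2co12, hQco12, hQsco12, hCco12, hC1co12, hDvco12, hDvsco12, hRco12⟩ := OpsYOps312OfRecord.pins312_of_eq h𝔬12
  let κ13 : ℝ := 1 + CLip θ.d₆ θ.ℓ₆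
  have hκ13 : ∀ (x : MemberY θ.d₆ θ.ℓ₆ θ.hd' θ.hL' θ.b₀ θ.b₁ Mstar) (U : (𝔅 x).Cfg), (bH13 x U).κ ≤ κ13 := hκ13_of_pinsP H w13 hw13₀ hw13₁ bH13 hbH13
  have hκX : ∀ (x : MemberY θ.d₆ θ.ℓ₆ θ.hd' θ.hL' θ.b₀ θ.b₁ Mstar) (U : (𝔅 x).Cfg), (bXH x U).κ ≤ κ13 := hκX_of_pinsP H wX hwX₀ hwX₁ bXH hbXH
  have hϑF₀ : 0 ≤ ϑF := budget_nonneg ha12.le hϑF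
  have hFϑ := plaqV_binder_of_regYR_budget_SU (N := N) hGR c hRP1 (M₀ := M12) (a₀ := a12) hϑF
  have hδ12₃0X : 0 ≤ δ12₃ := le_of_lt (lt_of_lt_of_le (add_pos hρ12 hσ12) hρ₃12)
  let 𝔬 : ∀ x : MemberY θ.d₆ θ.ℓ₆ θ.hd' θ.hL' θ.b₀ θ.b₁ Mstar, Ops (geo9Y x) (𝔅 x) (XSK (TrIdx N) x.toKIdx) (XSK (TrIdx N) x.toKIdx) ↥(cubes x.toKIdx.D.toDomains) := fun x => opsWalkY x (trBasis N) (𝔅 x) (fun U => U) (parSymY x.toKIdx) (bI x)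
  let 𝔡 : ∀ x : MemberY θ.d₆ θ.ℓ₆ θ.hd' θ.hL' θ.b₀ θ.b₁ Mstar, DirOps37 (𝔬 x) (Fin (θ.d₆ + 1)) := fun x => dirOpsWalkY x (trBasis N) (𝔅 x) (fun U => U) (parSymY x.toKIdx) (bI x)
  let 𝔩 : ∀ x : MemberY θ.d₆ θ.ℓ₆ θ.hd' θ.hL' θ.b₀ θ.b₁ Mstar, DirLetters37 (𝔬 x) (Fin (θ.d₆ + 1)) := fun x => dirLettersWalkY x (trBasis N) (𝔅 x) (fun U => U) (parSymY x.toKIdx) (bI x)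
  let κ : MemberY θ.d₆ θ.ℓ₆ θ.hd' θ.hL' θ.b₀ θ.b₁ Mstar → Sizes := fun x => kappaWalkY x (trBasis N)
  have hblkS : ∀ x : MemberY θ.d₆ θ.ℓ₆ θ.hd' θ.hL' θ.b₀ θ.b₁ Mstar, (𝔬 x).blk = blkSK x.toKIdx (sIK x.toKIdx (bI x)) := fun _ => rfl
  have hblkYS : ∀ x : MemberY θ.d₆ θ.ℓ₆ θ.hd' θ.hL' θ.b₀ θ.b₁ Mstar, (𝔬 x).blkY = blkSK x.toKIdx (sIK x.toKIdx (bI x)) := fun _ => rfl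
  have hhS : ∀ (x : MemberY θ.d₆ θ.ℓ₆ θ.hd' θ.hL' θ.b₀ θ.b₁ Mstar) (c : ↥(cubes x.toKIdx.D.toDomains)), (𝔬 x).h c = hWalkY x c := fun _ _ => rfl
  have hGsqF : ∀ (x : MemberY θ.d₆ θ.ℓ₆ θ.hd' θ.hL' θ.b₀ θ.b₁ Mstar) (U : (𝔅 x).Cfg) (c : ↥(cubes x.toKIdx.D.toDomains)), (𝔬 x).Gsq U c = gsqcoS x (trBasis N) (𝔅 x) (fun U => U) (parSymY x.toKIdx) c U := fun _ _ _ => rfl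
  have hGpS : ∀ (x : MemberY θ.d₆ θ.ℓ₆ θ.hd' θ.hL' θ.b₀ θ.b₁ Mstar) U, (𝔬 x).Gp U = GcoS x.toKIdx (trBasis N) (𝔅 x) (fun U => U) (lettersYOfRecordV4P N θ.toStage3Params Mstar 𝔯 x).Gp U := fun _ _ => rfl
  have hDS : ∀ (x : MemberY θ.d₆ θ.ℓ₆ θ.hd' θ.hL' θ.b₀ θ.b₁ Mstar) U, (𝔬 x).D U = DcoS x.toKIdx (trBasis N) (𝔅 x) (fun U => U) U := fun _ _ => rfl
  have hDsS : ∀ (x : MemberY θ.d₆ θ.ℓ₆ θ.hd' θ.hL' θ.b₀ θ.b₁ Mstar) U, (𝔬 x).Dstar U = DscoS x.toKIdx (trBasis N) (𝔅 x) (fun U => U) U := fun _ _ => rfl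
  have hLapS : ∀ (x : MemberY θ.d₆ θ.ℓ₆ θ.hd' θ.hL' θ.b₀ θ.b₁ Mstar) U, (𝔬 x).Lap U = LcoS x.toKIdx (trBasis N) (𝔅 x) (fun U => U) U := fun _ _ => rfl
  have h𝔡d : ∀ (x : MemberY θ.d₆ θ.ℓ₆ θ.hd' θ.hL' θ.b₀ θ.b₁ Mstar) (U : (𝔅 x).Cfg), (𝔡 x).Dd U = fun μ => (etaS x.toKIdx)⁻¹ • coordOpK (trBasis N) (fun _ : Fin (θ.d₆ + 1) => (cdSL x.toKIdx U μ).restrictScalars ℝ) := fun _ _ => rfl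
  have h𝔡s : ∀ (x : MemberY θ.d₆ θ.ℓ₆ θ.hd' θ.hL' θ.b₀ θ.b₁ Mstar) (U : (𝔅 x).Cfg), (𝔡 x).Dsd U = fun μ => (etaS x.toKIdx)⁻¹ • coordOpK (trBasis N) (fun _ : Fin (θ.d₆ + 1) => (cdsSL x.toKIdx U μ).restrictScalars ℝ) := fun _ _ => rfl
  have hst : ∀ x, StaticOK (𝔬 x) p.ρ p.Nc p.N' p.Cℓ (κ x) := fun x => staticOK_opsWalkY x (trBasis N) (𝔅 x) (fun U => U) (parSymY x.toKIdx) (bI x) (hβ1 x) (hlev x) (hMw x) hM3 hρ3 hNc hN' hCℓ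
  have hκ : ∀ x, (κ x).Bounded p.Kc p.θ₀ p.Cℓ (geo9Y x).M := fun x => bounded_kappaWalkY x (trBasis N) (le_trans (by positivity) hCℓ) hKc hθ₀
  have hloc : ∀ x, LocalityDir (𝔬 x) (𝔡 x) (𝔩 x) (rd x) := fun x => localityDir_opsWalkY_of_agree x (trBasis N) (𝔅 x) (fun U => U) (parSymY x.toKIdx) (bI x) (rd x) rfl
  have hrd : ∀ x : MemberY θ.d₆ θ.ℓ₆ θ.hd' θ.hL' θ.b₀ θ.b₁ Mstar, (rd x).OKRel (𝔬 x).blk (RelB x.toKIdx) := fun x => ⟨(off_bound_evSK (κ := TrIdx N) x.toKIdx (sIK_faithful x.toKIdx (hβI x))).1, (off_bound_evSK (κ := TrIdx N) x.toKIdx (sIK_faithful x.toKIdx (hβI x))).2, fun lam => geo9K_supNorm_nonneg x.toKIdx lam⟩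
  have h36 : ∀ x, p.M₁ ≤ (geo9Y x).M → ∀ α₀ : ℝ, 0 < α₀ → c * (geo9Y x).M * α₀ ≤ p.a₁ → ∀ U : (𝔅 x).Cfg, (𝔅 x).Reg335 c α₀ U → Local342 (𝔬 x) 1 (H x) p.B₀ p.δ₀ U ∧ Identities₂ (𝔬 x) (𝔡 x) (𝔩 x) 1 (H x) U := fun x hM α₀ hα ha U hU => ⟨h36 x hM α₀ hα ha U hU, identities₂_opsWalkY_of_reg335R x (bI x) hGR 1 (H x) (hβ1 x) (hlev x) hU⟩
  have hY335 : ∀ (x : MemberY θ.d₆ θ.ℓ₆ θ.hd' θ.hL' θ.b₀ θ.b₁ Mstar) (α₀ : ℝ) (U : (𝔅 x).Cfg), (𝔅 x).Reg335 c α₀ U → (bg9Y (Matrix (Fin N) (Fin N) ℂ) (specialUnitaryUnits (Fin N)) x).Reg335 c α₀ U := fun x α₀ U hU => regY335_of_regYP335 x c35Y_le_ten (hRP1 x α₀ U hU).1 (hRP1 x α₀ U hU).2 ((ten_L3_le_c35B θ.ℓ₆).trans hcB)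
  have hL3c : 10 * ((θ.ℓ₆ + 1 : ℕ) : ℝ) ^ 3 ≤ c := (ten_L3_le_c35B θ.ℓ₆).trans hcB; have hL4c : 10 * ((θ.ℓ₆ + 1 : ℕ) : ℝ) ^ 4 ≤ c := (ten_L4_le_c35B θ.ℓ₆).trans hcB; have hL1 : (1 : ℝ) ≤ ((θ.ℓ₆ + 1 : ℕ) : ℝ) := (by exact_mod_cast Nat.succ_le_succ (Nat.zero_le _))
  have hαFδ : 0 ≤ q.αF * ((1 - 2 * q.α) * q.δ₀) := mul_nonneg hq.αF_pos.le (mul_nonneg (by linarith only [hq.α_lt]) hq.δ₀_pos.le); have hρS : 0 ≤ ρS := (by linarith only [hσS.le, hσSK, hδKS, hαFδ]); have hδB : 0 ≤ δB := (by linarith only [hrTB, hδTr, hδT12, hσS.le, hαFδ]); have htJ0 : 0 ≤ tJ := le_trans (by positivity) htJ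
  have hBJ := fun (x : MemberY θ.d₆ θ.ℓ₆ θ.hd' θ.hL' θ.b₀ θ.b₁ Mstar) (hM : M12 ≤ (geo9Y x).M) (α₀ : ℝ) (hα : 0 < α₀) (ha : (geo9Y x).M * α₀ ≤ a12) (U : (𝔅 x).Cfg) (hU : (𝔅 x).Reg335 c α₀ U) (hU' : (𝔅 x).Reg336 c α₀ U) => hBJ_of_pins_P (N := N) H c35Y c35Y_le_ten (fun x => ops312RY (𝔬12 x)) bI hbI0 hβ1 hblk12 hblkW12 tJ δB M12 a12 ha1J hδB htJ x hM α₀ hα ha U (hRP1 x α₀ U hU).2 (hRP2 x α₀ U hU').2; have hN0 : 0 < N := Nat.pos_of_ne_zero (NeZero.ne N); have hac : 0 < q.a₁ / c := div_pos hq.a₁_pos hc; have hca : ∀ {M α₀ : ℝ}, M * α₀ ≤ q.a₁ / c → c * M * α₀ ≤ q.a₁ := fun {M α₀} h => (by have h' := (le_div_iff₀ hc).1 h; linarith only [h', show c * M * α₀ = M * α₀ * c by ring]); obtain ⟨MR, hM1R, hΔAc⟩ := row17_of_row19_letters₂ (N := N) hN0 specialUnitaryUnits_le_unitaryUnits (fun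 x => bg9YR (Matrix (Fin N) (Fin N) ℂ) (specialUnitaryUnits (Fin N)) R₁ R₂ x) (fun x U => U) (fun x c α₀ U hU => (mem_of_reg335R hGR x hU)) 𝔬A 𝔡A 𝔩A hq.θ₀_nn hq.δ₀_pos hstA (fun x hM α₀ hα ha U hU => (h36A x hM α₀ hα ha U hU).2.2) (fun x hM α₀ hα ha U hU => (h36A x hM α₀ hα ha U hU).2.1) hGcoA hGsqA; have hMR : 0 < MR := hq.M₁_pos.trans_le hM1R
  have hΔA : ∀ x : MemberY θ.d₆ θ.ℓ₆ θ.hd' θ.hL' θ.b₀ θ.b₁ Mstar, MR ≤ (geo9Y x).M → ∀ α₀ : ℝ, 0 < α₀ → (geo9Y x).M * α₀ ≤ q.a₁ / c → ∀ U : (𝔅 x).Cfg, (𝔅 x).Reg335 c α₀ U → PosDefTr (fun _ => (1 : ℝ)) (deltaAY x.toKIdx (parSymY x.toKIdx) (parBY x.toKIdx) (GpY x.toKIdx (parSymY x.toKIdx)) U) := fun x hM α₀ hα ha U hU => hΔAc x hM α₀ hα (hca ha) U hU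
  have t311 := t311_of_pins_opsYOfLettersR θ.toStage3Params Mstar (lettersYOfRecordV4P N θ.toStage3Params Mstar 𝔯) 𝔈 R₁ R₂ (fun x => B9Thm311PosAtRecordV4.proofLettersGA (lettersYOfRecordV4P N θ.toStage3Params Mstar 𝔯 x)) c 0 (q.a₁ / c) MR hac hMR (fun _ => rfl) (fun _ => rfl)
    (fun x hM α₀ hα₀ hMa U hU => B9Thm311SymmAtRecordV4.inputs311Y_of_five specialUnitaryUnits_le_unitaryUnits x (lettersYOfRecordV4P N θ.toStage3Params Mstar 𝔯 x) _ rfl rfl rfl rfl (mem_of_reg335R hGR x hU) (B9Thm311PosAtRecordV4.inputs311Y₅_of_four specialUnitaryUnits_le_unitaryUnits x (lettersYOfRecordV4P N θ.toStage3Params Mstar 𝔯 x) _ rfl (mem_of_reg335R hGR x hU)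
      (B9Thm311PosAtRecordV4.inputs311Y₄_of_posDefTr_deltaAY x (lettersYOfRecordV4P N θ.toStage3Params Mstar 𝔯 x) rfl le_rfl (hMR.le.trans hM) (hΔA x hM α₀ hα₀ hMa U hU)))) hPD
  have t315 := t315_opsYNuStOfRecordV4PE_sectEStYOfRecordV7_of_3185_onR N θ.toStage3Params Mstar 𝔯 𝔢₀ 𝔴 𝔈 hGR ha₀E hδ₁E hB₁E (fun x α₀ hα ha U hU hU' => hE x (mstar_le_M x) α₀ hα ha U hU hU')
  obtain ⟨t314, t314loc⟩ : B9.Thm314Printed c geo9Y (bg9YR (Matrix (Fin N) (Fin N) ℂ) (specialUnitaryUnits (Fin N)) R₁ R₂) (fun x => kernelFamilyR R₁ R₂ ((opsYNuStOfRecordV4PE N θ.toStage3Params Mstar 𝔯 (sectEStYOfRecordV7 N θ.toStage3Params Mstar 𝔢₀) 𝔴 𝔈) x).Kdiff) dOmegaY ∧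
      B9Thm314.Thm314LocalPrinted c geo9Y (bg9YR (Matrix (Fin N) (Fin N) ℂ) (specialUnitaryUnits (Fin N)) R₁ R₂) (fun x => kernelFamilyR R₁ R₂ ((opsYNuStOfRecordV4PE N θ.toStage3Params Mstar 𝔯 (sectEStYOfRecordV7 N θ.toStage3Params Mstar 𝔢₀) 𝔴 𝔈) x).Kdiff) OmKY dOmegaY :=
    thm314_pair_layerOfLettersR R₁ R₂ (lettersYOfRecordV4P N θ.toStage3Params Mstar 𝔯) 𝔈 T14₁ T14₂ (fun x => locDataY x (E14₁ x) (X14₁ x) (M14₁ x) (diam14 x)) X14₂ M14₂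
      (fun x => locDataY_laws x (E14₁ x) (near14₁ x) (first14₁ x) (chain14₁ x)) (fun x => locDataY_laws x (E14₂ x) (near14₂ x) (first14₂ x) (chain14₂ x)) r14 hr14
      (fun x => modelSignsOn_geo9K x.toKIdx) (fun x y y' => dOmegaY_nonneg x y y') h14₁ h14₂ W14₁ W14₂ hW14₁ hW14₂ hcnt14₁ hcnt14₂ hexp14
  have hGp := hGp_opsYOfLetters_holds N θ.toStage3Params Mstar (lettersYOfRecordV4P N θ.toStage3Params Mstar 𝔯) 𝔈; have hGA := hGA_opsYOfLetters N θ.toStage3Params Mstar (lettersYOfRecordV4P N θ.toStage3Params Mstar 𝔯) 𝔈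
  obtain ⟨t39, hksum⟩ := t39_hksum_oneCube_opsYOfLetters_FRC θ.toStage3Params Mstar (lettersYOfRecordV4P N θ.toStage3Params Mstar 𝔯) 𝔈 R₁ R₂ bI c α' r39 B39 δ39 a39 M39 hc hα'0 hα'1 hr39 hrδ39 hB39 ha39 hM39 h348 (fun _ => rfl) hβI hEK39
  have hsat : ∀ (x : MemberY θ.d₆ θ.ℓ₆ θ.hd' θ.hL' θ.b₀ θ.b₁ Mstar) (n : Fin 4) (B' δ' : ℝ), (∀ a a' b, RelB x.toKIdx a a' → maj342 (geo9Y x) n B' δ' a b = maj342 (geo9Y x) n B' δ' a' b) ∧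
      (∀ a b b', RelB x.toKIdx b b' → maj342 (geo9Y x) n B' δ' a b = maj342 (geo9Y x) n B' δ' a b') := fun x n B' δ' => ⟨fun a a' b h => maj342_relB_left x.toKIdx n B' δ' a a' b h, fun a b b' h => maj342_relB_right x.toKIdx n B' δ' a b b' h⟩
  have hmult : ∀ (x : MemberY θ.d₆ θ.ℓ₆ θ.hd' θ.hL' θ.b₀ θ.b₁ Mstar) (y' : (geo9Y x).Site), (Finset.univ.filter (fun y'' : (geo9Y x).Site => RelB x.toKIdx y'' y')).card ≤ 2 * (θ.d₆ + 1) := fun x y' => by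
    refine le_trans (Finset.card_le_card fun c hc => ?_) (card_sameCarrier_le_kIdx x.toKIdx y'); exact Finset.mem_filter.2 ⟨@Finset.mem_univ _ (_) c, (Finset.mem_filter.1 hc).2⟩
  have hRdist : ∀ (x : MemberY θ.d₆ θ.ℓ₆ θ.hd' θ.hL' θ.b₀ θ.b₁ Mstar) (a a' b : (geo9Y x).Site), RelB x.toKIdx a a' → (geo9Y x).dist a b = (geo9Y x).dist a' b := fun x a a' b h => dist_eq_of_relB x.toKIdx h (relB_refl x.toKIdx b)
  have hRlen : ∀ (x : MemberY θ.d₆ θ.ℓ₆ θ.hd' θ.hL' θ.b₀ θ.b₁ Mstar) (a a' : (geo9Y x).Site), RelB x.toKIdx a a' → (geo9Y x).len a = (geo9Y x).len a' := fun x a a' h => len_eq_of_relB x.toKIdx h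
  have hS := fun (x : MemberY θ.d₆ θ.ℓ₆ θ.hd' θ.hL' θ.b₀ θ.b₁ Mstar) (U : (𝔅 x).Cfg) => site_coReadings4_of_pins x.toKIdx (trBasis N) (𝔅 x) (fun U => U) (lettersYOfRecordV4P N θ.toStage3Params Mstar 𝔯 x).Gp (lettersYOfRecordV4P N θ.toStage3Params Mstar 𝔯 x).parS U (hβI x) (hlev x) (hblkS x) (hblkYS x) (hGpS x U) (hDS x U) (hDsS x U) (hLapS x U)
  have hco0 := fun x U => (hS x U).1; have hco1 := fun x U => (hS x U).2.1; have hco2 := fun x U => (hS x U).2.2.1; have hco3 := fun x U => (hS x U).2.2.2.1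
  have hgl0 := fun x U => (hS x U).2.2.2.2.1; have hgl1 := fun x U => (hS x U).2.2.2.2.2.1; have hgl2 := fun x U => (hS x U).2.2.2.2.2.2.1; have hgl3 := fun x U => (hS x U).2.2.2.2.2.2.2
  have hA := fun (x : MemberY θ.d₆ θ.ℓ₆ θ.hd' θ.hL' θ.b₀ θ.b₁ Mstar) (U : (𝔅 x).Cfg) => bond_coReadings3_of_pins x.toKIdx (trBasis N) (𝔅 x) (fun U => U) (lettersYOfRecordV4P N θ.toStage3Params Mstar 𝔯 x).GA (lettersYOfRecordV4P N θ.toStage3Params Mstar 𝔯 x).parB U (hβI x) (hlev x) (hblkA x) (hblkYA x) (hGcoA x U) (hDcoA x U) (hDscoA x U)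
  have hAL := fun (x : MemberY θ.d₆ θ.ℓ₆ θ.hd' θ.hL' θ.b₀ θ.b₁ Mstar) (U : (𝔅 x).Cfg) => bond_coReadingsLap_of_pins x.toKIdx (trBasis N) (𝔅 x) (fun U => U) (lettersYOfRecordV4P N θ.toStage3Params Mstar 𝔯 x).GA (lettersYOfRecordV4P N θ.toStage3Params Mstar 𝔯 x).parB U (hβI x) (hlev x) (hblkA x) (hGcoA x U) (hLcoA x U)
  have hcoA0 := fun x U => (hA x U).1; have hcoA1 := fun x U => (hA x U).2.1; have hcoA2 := fun x U => (hA x U).2.2.1; have hcoA3 := fun x U => (hAL x U).1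
  have hglA0 := fun x U => (hA x U).2.2.2.2.2.2.1; have hglA1 := fun x U => (hA x U).2.2.2.2.2.2.2.1; have hglA2 := fun x U => (hA x U).2.2.2.2.2.2.2.2; have hglA3 := fun x U => (hAL x U).2.2
  letI hF : ∀ x : MemberY θ.d₆ θ.ℓ₆ θ.hd' θ.hL' θ.b₀ θ.b₁ Mstar, Fintype (B9GeoNormsKLevelV1.geo9K x.toKIdx).Site := fun x => (inferInstance : Fintype (geo9Y x).Site)
  have hsymD : ∀ (x : MemberY θ.d₆ θ.ℓ₆ θ.hd' θ.hL' θ.b₀ θ.b₁ Mstar) (U : (𝔅 x).Cfg), (∀ μ z, U μ z ∈ specialUnitaryUnits (Fin N)) → IsSymmTr (fun _ => (1 : ℝ)) ((lettersYOfRecordV4P N θ.toStage3Params Mstar 𝔯 x).GD U) ∧ IsSymmTr (fun _ => (1 : ℝ)) ((lettersYOfRecordV4P N θ.toStage3Params Mstar 𝔯 x).G₁ U) ∧ IsSymmTr (fun _ => (1 : ℝ)) ((lettersYOfRecordV4P N θ.toStage3Params Mstar 𝔯 x).GG U) := lettersYOfRecordV4P_symmDG₁GG N θ.toStage3Params Mstar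 𝔯 hΔ2
  have hIR : ∀ x U, InputReadsFam (kernelFamilyR R₁ R₂ ((opsYNuStOfRecordV4PE N θ.toStage3Params Mstar 𝔯 (sectEStYOfRecordV7 N θ.toStage3Params Mstar 𝔢₀) 𝔴 𝔈) x).Gp) U (bHX x) 2 ((𝔬 x).blk ∘ Prod.fst) ((𝔭 x).blkPX ∘ Prod.fst) (fun β => sliceProbe ((𝔭 x).ΦX U β)) (evSK x.toKIdx) (familyOp fun r : Fin (θ.d₆ + 1) × Fin (θ.d₆ + 1) => (𝔡 x).Dd U r.1 ∘ₗ ((𝔬 x).Gp U ∘ₗ (𝔡 x).Dsd U r.2)) := fun x U =>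
    site_inputReadsFam_of_pinsSN x.toKIdx (trBasis N) (𝔅 x) (fun U => U) (lettersYOfRecordV4P N θ.toStage3Params Mstar 𝔯 x).Gp (lettersYOfRecordV4P N θ.toStage3Params Mstar 𝔯 x).parS U (hβI x) (hβ1 x) (h𝔭 x) (hbHX x) (hblkS x) (hGpS x U) (h𝔡d x U) (h𝔡s x U)
  have hH1 : ∀ x U, H1ReadsNbr (kernelFamilyR R₁ R₂ ((opsYNuStOfRecordV4PE N θ.toStage3Params Mstar 𝔯 (sectEStYOfRecordV7 N θ.toStage3Params Mstar 𝔢₀) 𝔴 𝔈) x).Gp) U (𝔭 x) (RelB x.toKIdx) 2 (𝔬 x).blk (𝔬 x).blkY (evSK x.toKIdx) (evSK x.toKIdx) ((𝔬 x).D U ∘ₗ (𝔬 x).Gp U) ((𝔬 x).Gp U ∘ₗ (𝔬 x).Dstar U) := fun x U => by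
    rw [h𝔭 x]; exact site_h1ReadsNbr_of_pinsSN x.toKIdx (trBasis N) (𝔅 x) (fun U => U) (lettersYOfRecordV4P N θ.toStage3Params Mstar 𝔯 x).Gp (lettersYOfRecordV4P N θ.toStage3Params Mstar 𝔯 x).parS U (hβI x) (hβ1 x) (hblkS x) (hblkYS x) (hGpS x U) (hDS x U) (hDsS x U)
  have hH1A : ∀ x U, H1ReadsNbr (kernelFamilyR R₁ R₂ ((opsYNuStOfRecordV4PE N θ.toStage3Params Mstar 𝔯 (sectEStYOfRecordV7 N θ.toStage3Params Mstar 𝔢₀) 𝔴 𝔈) x).GA) U (𝔭A x) (RelB x.toKIdx) 2 (𝔬A x).blk (𝔬A x).blkY (evBK x.toKIdx) (evBK x.toKIdx) ((𝔬A x).D U ∘ₗ (𝔬A x).G U) ((𝔬A x).G U ∘ₗ (𝔬A x).Dstar U) := fun x U => by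
    rw [h𝔭A x]; exact bond_h1ReadsNbr_of_pinsA x.toKIdx (trBasis N) (𝔅 x) (fun U => U) (lettersYOfRecordV4P N θ.toStage3Params Mstar 𝔯 x).GA (lettersYOfRecordV4P N θ.toStage3Params Mstar 𝔯 x).parB U (hβI x) (hβ1 x) (hblkA x) (hblkYA x) (hGcoA x U) (hDcoA x U) (hDscoA x U)
  have hHCN : ∀ (x : MemberY θ.d₆ θ.ℓ₆ θ.hd' θ.hL' θ.b₀ θ.b₁ Mstar) (U : (𝔅 x).Cfg), CoReadsHHolderNbr (hKernelR R₁ R₂ ((opsYNuStOfRecordV4PE N θ.toStage3Params Mstar 𝔯 (sectEStYOfRecordV7 N θ.toStage3Params Mstar 𝔢₀) 𝔴 𝔈) x).H) U (θ.d₆ + 1) (𝔭A x) 2 (𝔬12 x).blkZ ((𝔬12 x).D U ∘ₗ (𝔬12 x).Hm U) ∧ CoReadsHHolderNbr (hKernelR R₁ R₂ ((opsYNuStOfRecordV4PE N θ.toStage3Params Mstar 𝔯 (sectEStYOfRecordV7 N θ.toStage3Params Mstar 𝔢₀) 𝔴 𝔈) x).H₁) U (θ.d₆ + 1) (𝔭A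 x) 2 (𝔬12 x).blkZ ((𝔬12 x).D U ∘ₗ (𝔬12 x).H1m U) := fun x U =>
    ⟨bond_coReadsHHolderNbr_of_pinsA x.toKIdx (trBasis N) (𝔅 x) (fun U => U) (lettersYOfRecordV4P N θ.toStage3Params Mstar 𝔯 x).H (lettersYOfRecordV4P N θ.toStage3Params Mstar 𝔯 x).parB U (hβ1 x) (h𝔭A x) (hblkZ12 x) (hHm12 x U) (hDco12 x U),
      bond_coReadsHHolderNbr_of_pinsA x.toKIdx (trBasis N) (𝔅 x) (fun U => U) (lettersYOfRecordV4P N θ.toStage3Params Mstar 𝔯 x).H₁ (lettersYOfRecordV4P N θ.toStage3Params Mstar 𝔯 x).parB U (hβ1 x) (h𝔭A x) (hblkZ12 x) (hH1m12 x U) (hDco12 x U)⟩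
  have hIRA : ∀ x U, InputReadsFam (kernelFamilyR R₁ R₂ ((opsYNuStOfRecordV4PE N θ.toStage3Params Mstar 𝔯 (sectEStYOfRecordV7 N θ.toStage3Params Mstar 𝔢₀) 𝔴 𝔈) x).GA) U (bHXA x) 2 ((𝔬A x).blk ∘ Prod.fst) ((𝔭A x).blkPX ∘ Prod.fst) (fun β => sliceProbe ((𝔭A x).ΦX U β)) (evBK x.toKIdx) (familyOp fun r : Fin (θ.d₆ + 1) × Fin (θ.d₆ + 1) => (𝔡A x).Dd U r.1 ∘ₗ ((𝔬A x).G U ∘ₗ (𝔡A x).Dsd U r.2)) := fun x U =>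
    bond_inputReadsFam_of_pinsA x.toKIdx (trBasis N) (𝔅 x) (fun U => U) (lettersYOfRecordV4P N θ.toStage3Params Mstar 𝔯 x).GA (lettersYOfRecordV4P N θ.toStage3Params Mstar 𝔯 x).parB U (hβI x) (hβ1 x) (h𝔭A x) (hbHXA x) (hblkA x) (hGcoA x U) (h𝔡Ad x U) (h𝔡As x U)
  have hIF : ∀ (x : MemberY θ.d₆ θ.ℓ₆ θ.hd' θ.hL' θ.b₀ θ.b₁ Mstar) (U : (𝔅 x).Cfg), InputReadsFam (kernelFamilyR R₁ R₂ ((opsYNuStOfRecordV4PE N θ.toStage3Params Mstar 𝔯 (sectEStYOfRecordV7 N θ.toStage3Params Mstar 𝔢₀) 𝔴 𝔈) x).GD) U (bHXA x) 2 ((𝔬12 x).blk ∘ Prod.fst) ((𝔭A x).blkPX ∘ Prod.fst) (fun β => sliceProbe ((𝔭A x).ΦX U β)) (evBK x.toKIdx) (familyOp fun q : Fin (θ.d₆ + 1) × Fin (θ.d₆ + 1) => (𝔡A x).Dd U q.1 ∘ₗ ((𝔬12 x).G U ∘ₗ (𝔡A x).Dsd U q.2)) ∧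
      InputReadsFam (kernelFamilyR R₁ R₂ ((opsYNuStOfRecordV4PE N θ.toStage3Params Mstar 𝔯 (sectEStYOfRecordV7 N θ.toStage3Params Mstar 𝔢₀) 𝔴 𝔈) x).G₁) U (bHXA x) 2 ((𝔬12 x).blk ∘ Prod.fst) ((𝔭A x).blkPX ∘ Prod.fst) (fun β => sliceProbe ((𝔭A x).ΦX U β)) (evBK x.toKIdx) (familyOp fun q : Fin (θ.d₆ + 1) × Fin (θ.d₆ + 1) => (𝔡A x).Dd U q.1 ∘ₗ ((𝔬12 x).G1 U ∘ₗ (𝔡A x).Dsd U q.2)) ∧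
      InputReadsFam (kernelFamilyR R₁ R₂ ((opsYNuStOfRecordV4PE N θ.toStage3Params Mstar 𝔯 (sectEStYOfRecordV7 N θ.toStage3Params Mstar 𝔢₀) 𝔴 𝔈) x).GG) U (bHXA x) 2 ((𝔬12 x).blk ∘ Prod.fst) ((𝔭A x).blkPX ∘ Prod.fst) (fun β => sliceProbe ((𝔭A x).ΦX U β)) (evBK x.toKIdx) (familyOp fun q : Fin (θ.d₆ + 1) × Fin (θ.d₆ + 1) => (𝔡A x).Dd U q.1 ∘ₗ ((𝔬12 x).GG U ∘ₗ (𝔡A x).Dsd U q.2)) := fun x U =>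
    ⟨bond_inputReadsFam_of_pinsA x.toKIdx (trBasis N) (𝔅 x) (fun U => U) (lettersYOfRecordV4P N θ.toStage3Params Mstar 𝔯 x).GD (lettersYOfRecordV4P N θ.toStage3Params Mstar 𝔯 x).parB U (hβI x) (hβ1 x) (h𝔭A x) (hbHXA x) (hblk12 x) (hGco12 x U) (h𝔡Ad x U) (h𝔡As x U),
      bond_inputReadsFam_of_pinsA x.toKIdx (trBasis N) (𝔅 x) (fun U => U) (lettersYOfRecordV4P N θ.toStage3Params Mstar 𝔯 x).G₁ (lettersYOfRecordV4P N θ.toStage3Params Mstar 𝔯 x).parB U (hβI x) (hβ1 x) (h𝔭A x) (hbHXA x) (hblk12 x) (hG1co12 x U) (h𝔡Ad x U) (h𝔡As x U),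
      bond_inputReadsFam_of_pinsA x.toKIdx (trBasis N) (𝔅 x) (fun U => U) (lettersYOfRecordV4P N θ.toStage3Params Mstar 𝔯 x).GG (lettersYOfRecordV4P N θ.toStage3Params Mstar 𝔯 x).parB U (hβI x) (hβ1 x) (h𝔭A x) (hbHXA x) (hblk12 x) (hGGco12 x U) (h𝔡Ad x U) (h𝔡As x U)⟩
  have hH1N : ∀ (x : MemberY θ.d₆ θ.ℓ₆ θ.hd' θ.hL' θ.b₀ θ.b₁ Mstar) (U : (𝔅 x).Cfg), H1ReadsNbr (kernelFamilyR R₁ R₂ ((opsYNuStOfRecordV4PE N θ.toStage3Params Mstar 𝔯 (sectEStYOfRecordV7 N θ.toStage3Params Mstar 𝔢₀) 𝔴 𝔈) x).GD) U (𝔭A x) (RelB x.toKIdx) 2 (𝔬12 x).blk (𝔬12 x).blkY (evBK x.toKIdx) (evBK x.toKIdx) ((𝔬12 x).D U ∘ₗ (𝔬12 x).G U) ((𝔬12 x).G U ∘ₗ (𝔬12 x).Dstar U) ∧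
      H1ReadsNbr (kernelFamilyR R₁ R₂ ((opsYNuStOfRecordV4PE N θ.toStage3Params Mstar 𝔯 (sectEStYOfRecordV7 N θ.toStage3Params Mstar 𝔢₀) 𝔴 𝔈) x).G₁) U (𝔭A x) (RelB x.toKIdx) 2 (𝔬12 x).blk (𝔬12 x).blkY (evBK x.toKIdx) (evBK x.toKIdx) ((𝔬12 x).D U ∘ₗ (𝔬12 x).G1 U) ((𝔬12 x).G1 U ∘ₗ (𝔬12 x).Dstar U) ∧
      H1ReadsNbr (kernelFamilyR R₁ R₂ ((opsYNuStOfRecordV4PE N θ.toStage3Params Mstar 𝔯 (sectEStYOfRecordV7 N θ.toStage3Params Mstar 𝔢₀) 𝔴 𝔈) x).GG) U (𝔭A x) (RelB x.toKIdx) 2 (𝔬12 x).blk (𝔬12 x).blkY (evBK x.toKIdx) (evBK x.toKIdx) ((𝔬12 x).D U ∘ₗ (𝔬12 x).GG U) ((𝔬12 x).GG U ∘ₗ (𝔬12 x).Dstar U) := fun x U => by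
    rw [h𝔭A x]; exact ⟨bond_h1ReadsNbr_of_pinsA x.toKIdx (trBasis N) (𝔅 x) (fun U => U) (lettersYOfRecordV4P N θ.toStage3Params Mstar 𝔯 x).GD (lettersYOfRecordV4P N θ.toStage3Params Mstar 𝔯 x).parB U (hβI x) (hβ1 x) (hblk12 x) (hblkY12 x) (hGco12 x U) (hDco12 x U) (hDsco12 x U),
      bond_h1ReadsNbr_of_pinsA x.toKIdx (trBasis N) (𝔅 x) (fun U => U) (lettersYOfRecordV4P N θ.toStage3Params Mstar 𝔯 x).G₁ (lettersYOfRecordV4P N θ.toStage3Params Mstar 𝔯 x).parB U (hβI x) (hβ1 x) (hblk12 x) (hblkY12 x) (hG1co12 x U) (hDco12 x U) (hDsco12 x U),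
      bond_h1ReadsNbr_of_pinsA x.toKIdx (trBasis N) (𝔅 x) (fun U => U) (lettersYOfRecordV4P N θ.toStage3Params Mstar 𝔯 x).GG (lettersYOfRecordV4P N θ.toStage3Params Mstar 𝔯 x).parB U (hβI x) (hβ1 x) (hblk12 x) (hblkY12 x) (hGGco12 x U) (hDco12 x U) (hDsco12 x U)⟩
  have hLA := fun (x : MemberY θ.d₆ θ.ℓ₆ θ.hd' θ.hL' θ.b₀ θ.b₁ Mstar) (U : (𝔅 x).Cfg) => bond_l2ReadsNbr3_of_pins x.toKIdx (trBasis N) (𝔅 x) (fun U => U) (lettersYOfRecordV4P N θ.toStage3Params Mstar 𝔯 x).GA (lettersYOfRecordV4P N θ.toStage3Params Mstar 𝔯 x).parB U (R := (1 : ℝ)) (H := H x) (hβI x) (hβ1 x) (hblkA x) (hblkYA x) (hGcoA x U) (hDcoA x U) (hDscoA x U); have hlA0 := fun x U => (hLA x U).1; have hlA1 := fun x U => (hLA x U).2.1; have hlA2 := fun x U => (hLA x U).2.2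
  have hLA3 := fun (x : MemberY θ.d₆ θ.ℓ₆ θ.hd' θ.hL' θ.b₀ θ.b₁ Mstar) (U : (𝔅 x).Cfg) => bond_l2ReadsNbr345_of_pins x.toKIdx (trBasis N) (𝔅 x) (fun U => U) (lettersYOfRecordV4P N θ.toStage3Params Mstar 𝔯 x).GA (lettersYOfRecordV4P N θ.toStage3Params Mstar 𝔯 x).parB U (R := (1 : ℝ)) (H := H x) (hβI x) (hβ1 x) (hblkA x) (hGcoA x U) (h𝔡Ad x U) (h𝔡As x U); have hlA3 := fun x U => (hLA3 x U).1; have hlA4 := fun x U => (hLA3 x U).2.1; have hlA5 := fun x U => (hLA3 x U).2.2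
  have hLS := fun (x : MemberY θ.d₆ θ.ℓ₆ θ.hd' θ.hL' θ.b₀ θ.b₁ Mstar) (U : (𝔅 x).Cfg) => site_l2ReadsNbr012_of_pins x.toKIdx (trBasis N) (𝔅 x) (fun U => U) (lettersYOfRecordV4P N θ.toStage3Params Mstar 𝔯 x).Gp (lettersYOfRecordV4P N θ.toStage3Params Mstar 𝔯 x).parS U (R := (1 : ℝ)) (H := H x) (sIK_faithful x.toKIdx (hβI x)) (sIK_dist_le_one x.toKIdx (hβ1 x)) (hblkS x) (hblkYS x) (hGpS x U) (hDS x U) (hDsS x U); have hl0 := fun x U => (hLS x U).1; have hl1 := fun x U => (hLS x U).2.1; have hl2 := fun x U => (hLS x U).2.2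
  have hLS3 := fun (x : MemberY θ.d₆ θ.ℓ₆ θ.hd' θ.hL' θ.b₀ θ.b₁ Mstar) (U : (𝔅 x).Cfg) => site_l2ReadsNbr345_of_pins x.toKIdx (trBasis N) (𝔅 x) (fun U => U) (lettersYOfRecordV4P N θ.toStage3Params Mstar 𝔯 x).Gp (lettersYOfRecordV4P N θ.toStage3Params Mstar 𝔯 x).parS U (R := (1 : ℝ)) (H := H x) (sIK_faithful x.toKIdx (hβI x)) (sIK_dist_le_one x.toKIdx (hβ1 x)) (hblkS x) (hGpS x U) (h𝔡d x U) (h𝔡s x U); have hl3 := fun x U => (hLS3 x U).1; have hl4 := fun x U => (hLS3 x U).2.1; have hl5 := fun x U => (hLS3 x U).2.2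
  have hRd₂ : ∀ (x : MemberY θ.d₆ θ.ℓ₆ θ.hd' θ.hL' θ.b₀ θ.b₁ Mstar) (a b b' : (geo9Y x).Site), RelB x.toKIdx b b' → (geo9Y x).dist a b = (geo9Y x).dist a b' := fun x a b b' h => dist_eq_of_relB x.toKIdx (relB_refl x.toKIdx a) h
  have hsym : ∀ x : MemberY θ.d₆ θ.ℓ₆ θ.hd' θ.hL' θ.b₀ θ.b₁ Mstar, p.M₁ ≤ (geo9Y x).M → ∀ α₀ : ℝ, 0 < α₀ → c * (geo9Y x).M * α₀ ≤ p.a₁ → ∀ U : (𝔅 x).Cfg, (𝔅 x).Reg335 c α₀ U → IsTransposePair ((𝔬 x).Gp U) ((𝔬 x).Gp U) := fun x _ α₀ _ _ U hU => by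
    rw [hGpS x U]; exact isTransposePair_GcoS_trBasis x.toKIdx (𝔅 x) (fun U => U) (lettersYOfRecordV4P N θ.toStage3Params Mstar 𝔯 x).Gp U (GpY_isSymmTr x.toKIdx (parSymY x.toKIdx) U (symm0_parSymY x.toKIdx specialUnitaryUnits_le_unitaryUnits (mem_of_reg335R hGR x hU)))
  have htr : ∀ x : MemberY θ.d₆ θ.ℓ₆ θ.hd' θ.hL' θ.b₀ θ.b₁ Mstar, p.M₁ ≤ (geo9Y x).M → ∀ α₀ : ℝ, 0 < α₀ → c * (geo9Y x).M * α₀ ≤ p.a₁ → ∀ U : (𝔅 x).Cfg, (𝔅 x).Reg335 c α₀ U → IsTransposePair ((𝔬 x).D U ∘ₗ (𝔬 x).Gp U) ((𝔬 x).Gp U ∘ₗ (𝔬 x).Dstar U) := fun x _ α₀ _ _ U hU => by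
    rw [hDS x U, hGpS x U, hDsS x U]; exact isTransposePair_DcoS_GcoS_trBasis x.toKIdx (𝔅 x) (fun U => U) (lettersYOfRecordV4P N θ.toStage3Params Mstar 𝔯 x).Gp U (GpY_isSymmTr x.toKIdx (parSymY x.toKIdx) U (symm0_parSymY x.toKIdx specialUnitaryUnits_le_unitaryUnits (mem_of_reg335R hGR x hU))) (fun μ z => specialUnitaryUnits_le_unitaryUnits ((mem_of_reg335R hGR x hU) μ z))
  have hsymA : ∀ x : MemberY θ.d₆ θ.ℓ₆ θ.hd' θ.hL' θ.b₀ θ.b₁ Mstar, q.M₁ ≤ (geo9Y x).M → ∀ α₀ : ℝ, 0 < α₀ → c * (geo9Y x).M * α₀ ≤ q.a₁ → ∀ U : (𝔅 x).Cfg, (𝔅 x).Reg335 c α₀ U → IsTransposePair ((𝔬A x).G U) ((𝔬A x).G U) := fun x _ α₀ _ _ U hU => by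
    rw [hGcoA x U]; exact isTransposePair_GcoK_trBasis x.toKIdx (𝔅 x) (fun U => U) (lettersYOfRecordV4P N θ.toStage3Params Mstar 𝔯 x).GA U (symmG_parSymY x.toKIdx specialUnitaryUnits_le_unitaryUnits (mem_of_reg335R hGR x hU))
  have htrA : ∀ x : MemberY θ.d₆ θ.ℓ₆ θ.hd' θ.hL' θ.b₀ θ.b₁ Mstar, q.M₁ ≤ (geo9Y x).M → ∀ α₀ : ℝ, 0 < α₀ → c * (geo9Y x).M * α₀ ≤ q.a₁ → ∀ U : (𝔅 x).Cfg, (𝔅 x).Reg335 c α₀ U → IsTransposePair ((𝔬A x).D U ∘ₗ (𝔬A x).G U) ((𝔬A x).G U ∘ₗ (𝔬A x).Dstar U) := fun x _ α₀ _ _ U hU => by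
    rw [hDcoA x U, hGcoA x U, hDscoA x U]; exact isTransposePair_DcoK_GcoK_trBasis x.toKIdx (𝔅 x) (fun U => U) (lettersYOfRecordV4P N θ.toStage3Params Mstar 𝔯 x).GA U (symmG_parSymY x.toKIdx specialUnitaryUnits_le_unitaryUnits (mem_of_reg335R hGR x hU)) (fun μ z => specialUnitaryUnits_le_unitaryUnits ((mem_of_reg335R hGR x hU) μ z))
  have hgeoOK : ∀ x : MemberY θ.d₆ θ.ℓ₆ θ.hd' θ.hL' θ.b₀ θ.b₁ Mstar, GeoOK (geo9Y x) := fun x => ⟨geo9Y_dist_triangle x, geo9Y_dist_comm x, geo9K_dist_nonneg x.toKIdx, geo9Y_len_pos x⟩; have hN : 0 < N := Nat.pos_of_ne_zero (NeZero.ne N); have hcR : cR39 (trBasis N) ≠ 0 := (cR39_trBasis_pos hN).ne'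
  have hpos12 : ∀ x : MemberY θ.d₆ θ.ℓ₆ θ.hd' θ.hL' θ.b₀ θ.b₁ Mstar, max M12 MR ≤ (geo9Y x).M → ∀ α₀ : ℝ, 0 < α₀ → (geo9Y x).M * α₀ ≤ min a12 (q.a₁ / c) → ∀ U : (𝔅 x).Cfg, (𝔅 x).Reg335 c α₀ U →
      (𝔅 x).Reg336 c α₀ U → PosDefEnd ((𝔬12 x).S0 U) := fun x hM α₀ hα ha U hU _ => by
    rw [hS0co12 x U]; exact posDefEnd_S0coK_of_posDefTr_phys x.toKIdx (𝔅 x) (fun U => U) U hN (by rw [deltaAY_GpPhysY]; exact hΔA x ((le_max_right _ _).trans hM) α₀ hα (ha.trans (min_le_right _ _)) U hU)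
  have hinv12 : ∀ x : MemberY θ.d₆ θ.ℓ₆ θ.hd' θ.hL' θ.b₀ θ.b₁ Mstar, max M12 MR ≤ (geo9Y x).M → ∀ α₀ : ℝ, 0 < α₀ → (geo9Y x).M * α₀ ≤ min a12 (q.a₁ / c) → ∀ U : (𝔅 x).Cfg, (𝔅 x).Reg335 c α₀ U →
      (𝔅 x).Reg336 c α₀ U → (𝔬12 x).G0 U * (𝔬12 x).S0 U = 1 := fun x hM α₀ hα ha U hU _ => by
    rw [hG0co12 x U, hS0co12 x U, lettersYOfRecordV4P_GA_phys]; exact GcoK_GAY_mul_S0coK hcR (isUnit_deltaAY_phys_of_posDefTr _ (hΔA x ((le_max_right _ _).trans hM) α₀ hα (ha.trans (min_le_right _ _)) U hU))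
  have hIdOfForm : ∀ x : MemberY θ.d₆ θ.ℓ₆ θ.hd' θ.hL' θ.b₀ θ.b₁ Mstar, max M12 MR ≤ (geo9Y x).M → ∀ α₀ : ℝ, 0 < α₀ → (geo9Y x).M * α₀ ≤ min a12 (q.a₁ / c) → ∀ U : (𝔅 x).Cfg, (𝔅 x).Reg335 c α₀ U →
      (𝔅 x).Reg336 c α₀ U → ∀ r : ℝ, r < 1 → FormSmall (𝔬12 x) r U → B9Thm312Whole.Identities (𝔬12 x) U := fun x hM α₀ hα ha U hU hU' r hr hF =>
    identities_of_def_3124 (identitiesDef_of_pins_phys x.toKIdx (𝔅 x) (fun U => U) (𝔯 x).Δ2 (𝔬12 x) U hN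
      specialUnitaryUnits_le_unitaryUnits (mem_of_reg335R hGR x hU) (isUnit_of_posDefTr (hΔA x ((le_max_right _ _).trans hM) α₀ hα (ha.trans (min_le_right _ _)) U hU))
      (isUnit_deltaPiAY_of_formSmall_phys x.toKIdx (𝔅 x) (fun U => U) (𝔬12 x) U hN hF hr (hS0co12 x U) (hTpico12 x U))
      (isUnit_deltaOneY_of_formSmall_phys x.toKIdx (𝔅 x) (fun U => U) (𝔯 x).Δ2 (𝔬12 x) U hN hF hr (hS0co12 x U) (hTpico12 x U) (hT2co12 x U))
      (isUnit_QGQOfY_G1Y_recordP_of_posDefTr x.toKIdx specialUnitaryUnits_le_unitaryUnits (mem_of_reg335R hGR x hU) (𝔯 x).Δ2 (posDefTr_deltaOneY_of_formSmall_pins_phys x.toKIdx (𝔅 x) (fun U => U) (𝔯 x).Δ2 (𝔬12 x) U hN hF hr (hS0co12 x U) (hTpico12 x U) (hT2co12 x U)))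
      (hG0co12 x U) (hS0co12 x U) (hTpico12 x U) (hT2co12 x U) (hGco12 x U) (hG1co12 x U) (hGGco12 x U) (hQco12 x U) (hQsco12 x U) (hCco12 x U) (hC1co12 x U)
      (hHm12 x U) (hH1m12 x U) (hDvco12 x U) (hDvsco12 x U) (hRco12 x U)) (ids3124_ids3152_of_hZ_pins x.toKIdx (𝔅 x) (fun U => U) (𝔯 x).Δ2 (𝔬12 x) U hN specialUnitaryUnits_le_unitaryUnits (mem_of_reg335R hGR x hU) (cf_mul_etaS_of_hcfk x.toKIdx x.hcfk) (isUnit_deltaOneY_of_formSmall_phys x.toKIdx (𝔅 x) (fun U => U) (𝔯 x).Δ2 (𝔬12 x) U hN hF hr (hS0co12 x U) (hTpico12 x U) (hT2co12 x U)) (hG1co12 x U) (hQco12 x U) (hQsco12 x U) (hDvco12 x U) (hDvsco12 x U) (hRco12 x U) (hZ x ((le_max_left _ _).trans hM) α₀ hα (ha.trans (min_le_left _ _)) U hU hU')).1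
  have hNQ : ∀ x : MemberY θ.d₆ θ.ℓ₆ θ.hd' θ.hL' θ.b₀ θ.b₁ Mstar, (Fintype.card (Fin (θ.d₆ + 1)) : ℝ) ≤ ((θ.d₆ + 1 : ℕ) : ℝ) := (fun _ => by rw [Fintype.card_fin]); have hfac := (h36H_with_factor_of_pinsR θ Mstar c hc hY335 H bI hlev hβ1 𝔬 𝔡 𝔩 hblkS hhS hGsqF h𝔡d h𝔡s p hp pM κ hst hκ h36 h36H hM1fac ha1fac hδfac hθfac); have hmix := (l2MixedLegs37_of_pinsR θ Mstar c hc hY335 H bI hlev hβ1 𝔬 𝔡 hblkS hhS hGsqF h𝔡d h𝔡s p pM hM1mix ha1mix hBMmix hδmix); have h36H' := h36H_of_dir_pins₃SN (R := (1 : ℝ)) (H := H) hGR 𝔬 𝔡 𝔭 (fun x => (lettersYOfRecordV4P N θ.toStage3Params Mstar 𝔯 x).Gp) (fun x => (lettersYOfRecordV4P N θ.toStage3Params Mstar 𝔯 x).parS) h𝔭 hblkS hblkYS hGpS hDS hDsS h𝔡d h𝔡s hGsqF hY335 (fun x hM α₀ hα ha U hU => by obtain ⟨h₁, h₂, h₃₄,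 h₅₆, h₈⟩ := hfac x hM α₀ hα ha U hU; exact ⟨h₁, h₂, h₃₄, h₅₆, hmix x hM α₀ hα ha U hU, h₈⟩); have h36HA' := h36HA_of_dir_pinsR (R := (1 : ℝ)) (H := H) 𝔬A 𝔡A 𝔭A (fun x => (lettersYOfRecordV4P N θ.toStage3Params Mstar 𝔯 x).GA) (fun x => (lettersYOfRecordV4P N θ.toStage3Params Mstar 𝔯 x).parB) h𝔭A hblkA hblkYA hGcoA hDcoA hDscoA h𝔡Ad h𝔡As hY335 h36HA; have h36A4 := h36A_of_dirSq_pinsR (R := (1 : ℝ)) (H := H) 𝔬A 𝔡A hblkA hblkYA hDcoA hDscoA h𝔡Ad h𝔡As hGsqAS h36A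
  obtain ⟨t37', c38', t310', hsum'⟩ := rows131819_definite_geo9Y_pairM_dir₄ (bg := (bg9YR (Matrix (Fin N) (Fin N) ℂ) (specialUnitaryUnits (Fin N)) R₁ R₂)) p q hp hq p3 q3 hp3 hq3 pM qM hpM hqM ((θ.d₆ + 1 : ℕ) : ℝ) (Nat.cast_nonneg _) hc H
    (fun x => RelB x.toKIdx) (2 * (θ.d₆ + 1)) (nbrCountY θ.d₆ θ.ℓ₆ θ.hd' θ.hL' θ.b₀ θ.b₁ 2) (Real.sqrt ((θ.d₆ + 1) * Fintype.card (TrIdx N))) (Real.sqrt_nonneg _) hRlen hRdist hRd₂ hmult (hnbr_two_of_le hM₀) 𝔬 rd 𝔭 𝔡 𝔩 bHX (fun x => kernelFamilyR R₁ R₂ ((opsYNuStOfRecordV4PE N θ.toStage3Params Mstar 𝔯 (sectEStYOfRecordV7 N θ.toStage3Params Mstar 𝔢₀) 𝔴 𝔈) x).Gp) (fun x => evSK x.toKIdx) (fun x => evSK x.toKIdx) κ SH S3 SI (fun x => SblkY x (bI x)) hst hκ hrd hloc (h36_of_dirSq_pinsR (R := (1 : ℝ)) (H := H) 𝔬 𝔡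 hblkS hblkYS hDS hDsS h𝔡d h𝔡s (fun x U j => ⟨_, _, hGsqF x U j⟩) h36) h36H'
    hco0 hco1 hco2 hco3 hgl0 hgl1 hgl2 hgl3 hl0 hl1 hl2 hl3 hl4 hl5 hH1 hIR hsym htr hcntH hcnt3 hNQ hcntI (hcntM_of_walkCnt bI hβ1 (fun x => SblkY x (bI x)) (fun _ => rfl) hMw hNMw) 𝔬A rdA 𝔭A 𝔡A 𝔩A bHXA (fun x => kernelFamilyR R₁ R₂ ((opsYNuStOfRecordV4PE N θ.toStage3Params Mstar 𝔯 (sectEStYOfRecordV7 N θ.toStage3Params Mstar 𝔢₀) 𝔴 𝔈) x).GA) (fun x => evBK x.toKIdx) (fun x => evBK x.toKIdx)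
    κA SHA S3A SIA SMA hstA hκA hrdA hlocA h36A4 h36HA' hcoA0 hcoA1 hcoA2 hcoA3 hglA0 hglA1 hglA2 hglA3 hlA0 hlA1 hlA2 hlA3 hlA4 hlA5 hH1A hIRA hsymA htrA hcntHA hcnt3A hNQ hcntIA hcntMA
  obtain ⟨M31, a31, hM31, ha31, h31⟩ := thm31GpMaj_of_t37_pairMR (trBasis N) (lettersYOfRecordV4P N θ.toStage3Params Mstar 𝔯) 𝔬 rd H hp t37' hbI0 hblkS hblkYS hGpS hDS hDsS
  have hδ39 : 0 < δ39 := hr39.trans_le hrδ39; have hθ49 : 0 < min ((1 - 2 * p.α) * p.δ₀) δ39 / 8 := (by have := lt_min (PinPrims.rate_pos hp) hδ39; positivity); have hrT0 : rT ≤ (1 - 2 * p.α) * p.δ₀ := hrTP.trans (by have h1 := min_le_left ((1 - 2 * p.α) * p.δ₀) δ39; linarith only [h1, hθ49])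
  obtain ⟨M49, a49, hM49, ha49, h49⟩ := proj349Maj_of_t37_display348_rateR_ge θ.toStage3Params Mstar hGR (lettersYOfRecordV4P N θ.toStage3Params Mstar 𝔯) (fun _ => rfl) (fun _ => rfl) (trBasis N) (cR39_trBasis_pos hN) hc hbI0 hlev hβ1 (hnbr_two_of_le hM₀) 𝔬 rd H hp t37' hblkS hblkYS hGpS hDS hB39.le hδ39 ha39 h348 (min ((1 - 2 * p.α) * p.δ₀) δ39 / 8) (cg349 θ.d₆ θ.ℓ₆ θ.hd' θ.hL' θ.b₀ θ.b₁ ((1 - 2 * p.α) * p.δ₀) δ39) (thrM349 θ.d₆ θ.ℓ₆ θ.hd' θ.hL' θ.b₀ θ.b₁ ((1 - 2 * p.α) * p.δ₀) δ39) hθ49.le (cg349_pos _ _).le (fun i hM parS Gp U B₀ B₁' hB₀ hB₁' => fineEntryS_le_named (PinPrims.rate_pos hp) hδ39 i hM parS Gp U hB₀ hB₁') CP hCPge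
  have hCP : 0 ≤ CP := (cP349_nonneg θ.toStage3Params Mstar (trBasis N) (nbrCountY θ.d₆ θ.ℓ₆ θ.hd' θ.hL' θ.b₀ θ.b₁ 2) hp hB39.le δ39 (min ((1 - 2 * p.α) * p.δ₀) δ39 / 8) (cg349_pos _ _).le).trans hCPge
  have hδTr2 : δT12 + 2 * σS + 3 * (q.αF * ((1 - 2 * q.α) * q.δ₀)) ≤ rT := (by linarith only [hδTr, hσS]); set M46c : ℝ := M46 θ.d₆ θ.ℓ₆ θ.hd' θ.hL' θ.b₀ θ.b₁ Mstar N c hc with hM46cdef; set a46c : ℝ := a46 θ.d₆ θ.ℓ₆ θ.hd' θ.hL' θ.b₀ θ.b₁ Mstar N c hc with ha46cdef; set B₄ : ℝ := B46 θ.d₆ θ.ℓ₆ θ.hd' θ.hL' θ.b₀ θ.b₁ Mstar N c hc with hB₄def; set δ₄ : ℝ := δ46 θ.d₆ θ.ℓ₆ θ.hd' θ.hL' θ.b₀ θ.b₁ Mstar N c hc with hδ₄def; have hM46c : 0 < M46c := M46_pos θ.d₆ θ.ℓ₆ θ.hd' θ.hL' θ.b₀ θ.b₁ Mstar N c hc;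 have ha46c : 0 < a46c := a46_pos θ.d₆ θ.ℓ₆ θ.hd' θ.hL' θ.b₀ θ.b₁ Mstar N c hc; have hB₄ : 0 ≤ B₄ := (B46_pos θ.d₆ θ.ℓ₆ θ.hd' θ.hL' θ.b₀ θ.b₁ Mstar N c hc).le; have h46 : ∀ x : MemberY θ.d₆ θ.ℓ₆ θ.hd' θ.hL' θ.b₀ θ.b₁ Mstar, max M12 M46c ≤ (geo9Y x).M → ∀ α₀ : ℝ, 0 < α₀ → (geo9Y x).M * α₀ ≤ min a12 a46c → ∀ U : (𝔅 x).Cfg, (𝔅 x).Reg335 c α₀ U → B9SectDL2Decay.BlockBd (g := toB6 (geo9Y x) 1 (H x)) (𝔬12 x).blk (𝔬12 x).blk (DvcoKH x.toKIdx (trBasis N) (𝔅 x) (fun U => U) U ∘ₗ GcoS x.toKIdx (trBasis N) (𝔅 x) (fun U => U) (GpY x.toKIdx (parSymY x.toKIdx)) U ∘ₗ DvscoKH x.toKIdx (trBasis N) (𝔅 x) (fun U => U) U) (fun (y y' : (geo9Y x).Site) => B₄ * Real.exp (-(δ₄ * (geo9Y x).dist y y'))) := fun x hM α₀ hα ha U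 hU => by rw [hblk12 x]; exact blockBd_DvGcoSDvs_memberY_at θ.d₆ θ.ℓ₆ θ.hd' θ.hL' θ.b₀ θ.b₁ Mstar N c hc B7Prop2SpecialUnitary.specialUnitaryUnits_le_unitaryUnits x ((le_max_right _ _).trans hM) α₀ hα (ha.trans (min_le_right _ _)) U (hY335 x α₀ U hU) (hlev x) (hβ1 x) 1 (H x)
  set tT : ℝ := max t12 (2 * const3131 (cR39 (trBasis N))⁻¹ (((θ.d₆ + 1 : ℕ) : ℝ) * p.C (B9RWSums347DefiniteFaces.exp261 (@geo9Y θ.d₆ θ.ℓ₆ θ.hd' θ.hL' θ.b₀ θ.b₁ Mstar) p.δ₀ p.α)) CP (rowConst261 (@geo9Y θ.d₆ θ.ℓ₆ θ.hd' θ.hL' θ.b₀ θ.b₁ Mstar) σS) ((θ.ℓ₆ + 1 : ℕ) : ℝ) * tJ) with htTdef; have ht12c : 2 * const3131 (cR39 (trBasis N))⁻¹ (((θ.d₆ + 1 : ℕ) : ℝ) * p.C (B9RWSums347DefiniteFaces.exp261 (@geo9Y θ.d₆ θ.ℓ₆ θ.hd' θ.hL' θ.b₀ θ.b₁ Mstar)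 p.δ₀ p.α)) CP (rowConst261 (@geo9Y θ.d₆ θ.ℓ₆ θ.hd' θ.hL' θ.b₀ θ.b₁ Mstar) σS) ((θ.ℓ₆ + 1 : ℕ) : ℝ) * tJ ≤ tT := le_max_right _ _; have ht12T : 0 ≤ tT := ht12.trans (le_max_left _ _)
  obtain ⟨M43, a43, hM43, ha43, h43'⟩ := h43Gp_of_thm37PrintedSN (G := specialUnitaryUnits (Fin N)) (bg := fun x => bg9YR (Matrix (Fin N) (Fin N) ℂ) (specialUnitaryUnits (Fin N)) R₁ R₂ x) (κ := TrIdx N) (c35 := c) (c10 := c35Y) (ι := fun x => ↥(cubes x.toKIdx.D.toDomains)) (Q := fun _ => Fin (θ.d₆ + 1)) (bI := bI) (fun u hu => B9SectBStepUClosedSU.norm_le_one_of_mem_su u hu) (fun x U => U) (trBasis N) c35Y_le_ten (fun x α₀ U hU => (hRP1 x α₀ U hU).2.1) 𝔬 𝔡 𝔩 𝔭 H (fun x => (lettersYOfRecordV4P N θ.toStage3Params Mstar 𝔯 x).Gp) hlev hβ1 hbI0 (fun x => B9SmoothHolderClassTClosure.abs_cf_eq_nKT x.toKIdx x.hcfk)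 (fun x => by rw [h𝔭 x, lettersYOfRecordV4P_parS]) hblkS hblkYS hGpS hDsS κ SH p.Bl p.Bt hc hp.α_pos hp.α_lt hp.N'_nn hp.NH_nn hp.B₀_pos hp.δ₀_pos hp.a₁_pos hp.M₁_pos hp.αF_pos (by linarith only [hp.αF_lt]) (p.C_nonneg hp _) (PinPrims.rate_pos hp).le (by nlinarith only [hp.α_pos, hp.δ₀_pos]) hp.Bl_nn hp.Bt_nn hst hκ hcntH
    (fun x hM α₀ hα ha U hU => by obtain ⟨h1, h2, h3⟩ := h36_of_dirSq_pinsR (R := (1 : ℝ)) (H := H) 𝔬 𝔡 hblkS hblkYS hDS hDsS h𝔡d h𝔡s (fun x U j => ⟨_, _, hGsqF x U j⟩) h36 x hM α₀ hα ha U hU; exact ⟨h1, h2, h3, (h36H x hM α₀ hα ha U hU).1, (h36H x hM α₀ hα ha U hU).2.1⟩) _ t37' (fun _ _ h => h.1) w13 hw13₀ hw13₁ hB₀D hbudD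
  have h43Gp : ∀ x : MemberY θ.d₆ θ.ℓ₆ θ.hd' θ.hL' θ.b₀ θ.b₁ Mstar, letI : Fintype (B9GeoNormsKLevelV1.geo9K x.toKIdx).Site := (inferInstance : Fintype (geo9Y x).Site); max M12 M43 ≤ (geo9Y x).M → ∀ α₀ : ℝ, 0 < α₀ → (geo9Y x).M * α₀ ≤ min a12 a43 → ∀ U : (𝔅 x).Cfg, (𝔅 x).Reg335 c α₀ U → (𝔅 x).Reg336 c α₀ U → HasMaj (cNorm 1 (H x) (𝔬12 x).blk (fun y => (geo9Y_len_pos x y).le) 0) (bH13 x U) (GcoS x.toKIdx (trBasis N) (bg9YR (Matrix (Fin N) (Fin N) ℂ) (specialUnitaryUnits (Fin N)) R₁ R₂ x) (fun U => U) (GpY x.toKIdx (parSymY x.toKIdx)) U ∘ₗ DvscoKH x.toKIdx (trBasis N) (bg9YR (Matrix (Fin N) (Fin N) ℂ) (specialUnitaryUnits (Fin N)) R₁ R₂ x) (fun U => U) U) (fun a b => B43 * Real.exp (-(δ43 * (geo9Y x).dist a b))) := fun x hM α₀ hα ha U hU _ => by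
    rw [hblk12 x, hbH13 x U, ← lettersYOfRecordV4P_Gp]; exact (h43' x ((le_max_right _ _).trans hM) α₀ hα (ha.trans (min_le_right _ _)) U hU).mono (kernel_mono (hgeoOK x) (by have h0 := p.C_nonneg hp (B9RWSums347DefiniteFaces.exp261 (@geo9Y θ.d₆ θ.ℓ₆ θ.hd' θ.hL' θ.b₀ θ.b₁ Mstar) p.δ₀ p.α); positivity) hB43ge hδ43le)
  obtain ⟨MpW, apW, hMpW, hapW, hPW⟩ := hpDGW_of_thm37PrintedSN_unif (G := specialUnitaryUnits (Fin N)) (bg := fun x => bg9YR (Matrix (Fin N) (Fin N) ℂ) (specialUnitaryUnits (Fin N)) R₁ R₂ x) (κ := TrIdx N) (c35 := c) (c10 := c35Y) (ι := fun x => ↥(cubes x.toKIdx.D.toDomains)) (Q := fun _ => Fin (θ.d₆ + 1)) (bI := bI) (fun u hu => B9SectBStepUClosedSU.norm_le_one_of_mem_su u hu) (fun x U => U) (trBasis N) c35Y_le_ten (fun x α₀ U hU => ((B9BackgroundsKLevelV1P.reg335YP_iff _ _ _ _).1 (hRP1 x α₀ U hU).2).1) 𝔬 𝔡 𝔩 𝔭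 H (fun x => (lettersYOfRecordV4P N θ.toStage3Params Mstar 𝔯 x).Gp) hlev hβ1 hbI0 (fun x => B9SmoothHolderClassTClosure.abs_cf_eq_nKT x.toKIdx x.hcfk) (fun x => by rw [h𝔭 x, lettersYOfRecordV4P_parS]) hblkS hblkYS hGpS hDS κ SH p.Bl p.Bt hc hp.α_pos hp.α_lt hp.N'_nn hp.NH_nn hp.B₀_pos hp.δ₀_pos hp.a₁_pos hp.M₁_pos hp.αF_pos (by linarith only [hp.αF_lt]) (p.C_nonneg hp _) (PinPrims.rate_pos hp).le (by nlinarith only [hp.α_pos, hp.δ₀_pos]) hp.Bl_nn hp.Bt_nn hst hκ hcntH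
    (fun x hM α₀ hα ha U hU => by obtain ⟨h1, h2, h3⟩ := h36_of_dirSq_pinsR (R := (1 : ℝ)) (H := H) 𝔬 𝔡 hblkS hblkYS hDS hDsS h𝔡d h𝔡s (fun x U j => ⟨_, _, hGsqF x U j⟩) h36 x hM α₀ hα ha U hU; exact ⟨h1, h2, h3, (h36H x hM α₀ hα ha U hU).1, (h36H x hM α₀ hα ha U hU).2.1⟩) _ t37' (fun _ _ h => h.1)
  have hpDGW : ∀ x : MemberY θ.d₆ θ.ℓ₆ θ.hd' θ.hL' θ.b₀ θ.b₁ Mstar, letI : Fintype (B9GeoNormsKLevelV1.geo9K x.toKIdx).Site := (inferInstance : Fintype (geo9Y x).Site); max M12 MpW ≤ (geo9Y x).M → ∀ α₀ : ℝ, 0 < α₀ → (geo9Y x).M * α₀ ≤ min a12 apW → ∀ U : (𝔅 x).Cfg, (𝔅 x).Reg335 c α₀ U → (𝔅 x).Reg336 c α₀ U → ∀ (β' : ℝ), 0 ≤ β' → β' < 1 → HasMaj (cNormR 1 (H x) (𝔬12 x).blkW (fun y => (geo9Y_len_pos x y).le) 0) (cNormR 1 (H x) (𝔭A x).blkPX (fun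 y => (geo9Y_len_pos x y).le) (β' - 1)) ((𝔭A x).ΦX U β' ∘ₗ (𝔬12 x).Dv U ∘ₗ GcoS x.toKIdx (trBasis N) (bg9YR (Matrix (Fin N) (Fin N) ℂ) (specialUnitaryUnits (Fin N)) R₁ R₂ x) (fun U => U) (GpY x.toKIdx (parSymY x.toKIdx)) U) (fun a b => BhW β' * Real.exp (-(δhW * (geo9Y x).dist a b))) := fun x hM α₀ hα ha U hU _ β' h0 h1 => by
    rw [hblkW12 x, hDvco12 x U, h𝔭A x, lettersYOfRecordV4P_parB, ← lettersYOfRecordV4P_Gp]; exact (hPW x ((le_max_right _ _).trans hM) α₀ hα (ha.trans (min_le_right _ _)) U hU β' h0 h1).mono (fun a b => mul_le_mul (hBhWge β' h0 h1) (Real.exp_le_exp.2 (neg_le_neg (mul_le_mul_of_nonneg_right hδhWle ((hgeoOK x).dnn a b)))) (Real.exp_nonneg _) (hBhW β' h0 h1))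
  obtain ⟨MG0, aG0, hMG0, haG0, HG0⟩ := h44m_h45X_h45Y_of_local3107 (bg := 𝔅) (bP := bI) (fun x U => U) (trBasis N) hc q hq H 𝔬A 𝔡A 𝔩A 𝔭A 𝔬12 (fun x => (hblk12 x).trans (hblkA x).symm) (fun x => (hblkY12 x).trans (hblkYA x).symm) (fun x U => (hG0co12 x U).trans (hGcoA x U).symm) (fun x U => (hDco12 x U).trans (hDcoA x U).symm) (fun x U => (hDsco12 x U).trans (hDscoA x U).symm) (fun x U f f' => (lettersYOfRecordV4P N θ.toStage3Params Mstar 𝔯 x).parB U f.src f'.src) (fun x U β' => B9CoReadingCoordsHolderAdm.wKA x.toKIdx β') (fun x U β' => B9CoReadingCoordsHolder.w₀K x.toKIdx β') (fun x U β' => by rw [h𝔭A x]; rfl) (fun x U β' => by rw [h𝔭A x]; rfl) (fun x => by rw [h𝔭A x]; rfl) (fun x => by rw [h𝔭A x]; rfl) hDco12 h𝔡Ad bHXTA hbHXTA κA SHA SIA hstA hκA hcntHA hcntIA h36A4 (fun x hM α₀ hα ha U hU => by have h := h36HA' x hM α₀ hα ha U hU; exact ⟨h.1, h.2.1, h.2.2.2.1.2.2,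 h.2.2.2.2.2.2⟩) hopIA sch hschβ hsch1 hs440 hs441
  obtain ⟨MT, aT, hMT, haT, hG0CT'⟩ := thm33G0DirT_of_local3107 (bg := 𝔅) hc q hq H 𝔬A 𝔡A 𝔩A 𝔭A 𝔬12 (fun x => (hblk12 x).trans (hblkA x).symm) (fun x => (hblkY12 x).trans (hblkYA x).symm) (fun x U => (hG0co12 x U).trans (hGcoA x U).symm) (fun x U => (hDco12 x U).trans (hDcoA x U).symm) (fun x U => (hDsco12 x U).trans (hDscoA x U).symm) bHXTA κA SHA SIA hstA hκA hcntHA hcntIA h36A4 (fun x hM α₀ hα ha U hU => by have h := h36HA' x hM α₀ hα ha U hU; exact ⟨h.1, h.2.1, h.2.2.2.1.2.2, h.2.2.2.2.2.2⟩) hopIA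
  have hδ12₀F : δ12₀ ≤ (1 - q.αF) * ((1 - 2 * q.α) * q.δ₀) := hδ12₀.trans (mul_le_mul_of_nonneg_right (by linarith only [hq.αF_pos]) (PinPrims.rate_pos hq).le)
  obtain ⟨MDL, BdT, Bd2T, hMDL, hBdT, hBd2T, hLEG⟩ := dgDvd_pdgDvd_of_pinsT_all (N := N) H bI hβ1 𝔬12 𝔭A (fun x => (𝔡A x).Dd) (fun x => (𝔡A x).Dsd) h𝔡As hDvco12 bHXT hbHXT bHXTA hbHXTA c35Y_le_ten (fun x α₀ U hU => (hRP1 x α₀ U hU).2.1) haT hδ12₃0X hδ₃₀.le (fun ε hε hε1 => inputConst44_pins_nonneg q hq (const37_pins_nonneg q hq (exp261 (@geo9Y θ.d₆ θ.ℓ₆ θ.hd' θ.hL' θ.b₀ θ.b₁ Mstar) q.δ₀ q.α)) (Nat.cast_nonneg (θ.ℓ₆ + 1)) ε hε hε1) (fun ε β' hε hε1 h0 h1 => inputConst45_pins_nonneg q hq (const37_pins_nonneg q hq (exp261 (@geo9Y θ.d₆ θ.ℓ₆ θ.hd' θ.hL' θ.b₀ θ.b₁ Mstar) q.δ₀ q.α))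 (Nat.cast_nonneg (θ.ℓ₆ + 1)) ε β' hε hε1 h0 h1) (fun x hM α₀ hα ha U hU _ => hG0CT' x hM α₀ hα ha U hU δ12₀ hδ12₀F)
  obtain ⟨MLR, c₁R, hrowR⟩ := rowSum261_geo9Y (d := θ.d₆) (ℓ := θ.ℓ₆) (hd := θ.hd') (hL := θ.hL') (b₀ := θ.b₀) (b₁ := θ.b₁) (Mstar := Mstar) 1 one_pos
  have h44m := fun (x : MemberY θ.d₆ θ.ℓ₆ θ.hd' θ.hL' θ.b₀ θ.b₁ Mstar) (hM : max M12 MG0 ≤ (geo9Y x).M) (α₀ : ℝ) (hα : 0 < α₀) (ha : (geo9Y x).M * α₀ ≤ min a12 aG0) (U : (𝔅 x).Cfg) (hU : (𝔅 x).Reg335 c α₀ U) (_ : (𝔅 x).Reg336 c α₀ U) (ν μ : Fin (θ.d₆ + 1)) => ((HG0 x ((le_max_right _ _).trans hM) α₀ hα (ha.trans (min_le_right _ _)) U hU).1 ν μ).mono (fun a b => mul_le_mul hBi44ge (Real.exp_le_exp.2 (neg_le_neg (mul_le_mul_of_nonneg_right hδ44le ((hgeoOK x).dnn a b)))) (Real.exp_nonneg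 _) hBi44)
  have h45X := fun (x : MemberY θ.d₆ θ.ℓ₆ θ.hd' θ.hL' θ.b₀ θ.b₁ Mstar) (hM : max M12 MG0 ≤ (geo9Y x).M) (α₀ : ℝ) (hα : 0 < α₀) (ha : (geo9Y x).M * α₀ ≤ min a12 aG0) (U : (𝔅 x).Cfg) (hU : (𝔅 x).Reg335 c α₀ U) (_ : (𝔅 x).Reg336 c α₀ U) (ν μ : Fin (θ.d₆ + 1)) (β' : ℝ) (h0 : 0 ≤ β') (h1 : β' < 1) => ((HG0 x ((le_max_right _ _).trans hM) α₀ hα (ha.trans (min_le_right _ _)) U hU).2.1 ν μ β' h0 h1).mono (fun a b => mul_le_mul (hBZge β' h0 h1) (Real.exp_le_exp.2 (neg_le_neg (mul_le_mul_of_nonneg_right hδ45le ((hgeoOK x).dnn a b)))) (Real.exp_nonneg _) (hBZ β' h0 h1))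
  have h45Y := fun (x : MemberY θ.d₆ θ.ℓ₆ θ.hd' θ.hL' θ.b₀ θ.b₁ Mstar) (hM : max M12 MG0 ≤ (geo9Y x).M) (α₀ : ℝ) (hα : 0 < α₀) (ha : (geo9Y x).M * α₀ ≤ min a12 aG0) (U : (𝔅 x).Cfg) (hU : (𝔅 x).Reg335 c α₀ U) (_ : (𝔅 x).Reg336 c α₀ U) (β' : ℝ) (h0 : 0 ≤ β') (h1 : β' < 1) (μ : Fin (θ.d₆ + 1)) => ((HG0 x ((le_max_right _ _).trans hM) α₀ hα (ha.trans (min_le_right _ _)) U hU).2.2 β' h0 h1 μ).mono (fun a b => mul_le_mul (hBiYge β' h0 h1) (Real.exp_le_exp.2 (neg_le_neg (mul_le_mul_of_nonneg_right hδ45Yle ((hgeoOK x).dnn a b)))) (Real.exp_nonneg _) (hBiY β' h0 h1))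
  obtain ⟨M44, a44, hM44, ha44, H44⟩ := h44G_hp45W_of_thm37PrintedSN (G := specialUnitaryUnits (Fin N)) (bg := 𝔅) (κ := TrIdx N) (c35 := c) (c10 := c35Y) (ι := fun x => ↥(cubes x.toKIdx.D.toDomains)) (bI := bI) (fun u hu => B9SectBStepUClosedSU.norm_le_one_of_mem_su u hu) (fun x U => U) (trBasis N) c35Y_le_ten (fun x α₀ U hU => ((B9BackgroundsKLevelV1P.reg335YP_iff _ _ _ _).1 (hRP1 x α₀ U hU).2).1) 𝔬 𝔡 𝔩 𝔭 H (fun x => (lettersYOfRecordV4P N θ.toStage3Params Mstar 𝔯 x).Gp) hlev hβ1 hbI0 (fun x => B9SmoothHolderClassTClosure.abs_cf_eq_nKT x.toKIdx x.hcfk) (fun x => by rw [h𝔭 x, lettersYOfRecordV4P_parS]) hblkS hGpS (fun x U ν => congrFun (h𝔡d x U) ν) (fun x U μ => congrFun (h𝔡s x U) μ) bHXT hbHXT κ SH SI p.Bl p.Bt p.BI p.θI p.BI2 sch hc hp.α_pos hp.α_lt hp.N'_nn hp.NH_nn hp.NI_nn hp.B₀_pos hp.δ₀_pos hp.a₁_pos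 hp.M₁_pos hp.αF_pos (by linarith only [hp.αF_lt]) hα3 (p.C_nonneg hp _) le_rfl hp.Bl_nn hp.Bt_nn hp.BI_nn hp.BI2_nn hp.θI_nn hschβ hsch1 hst hκ hcntH hcntI
    (fun x hM α₀ hα ha U hU => by obtain ⟨h1, h2, h3⟩ := h36_of_dirSq_pinsR (R := (1 : ℝ)) (H := H) 𝔬 𝔡 hblkS hblkYS hDS hDsS h𝔡d h𝔡s (fun x U j => ⟨_, _, hGsqF x U j⟩) h36 x hM α₀ hα ha U hU; exact ⟨h1, h2, h3, (h36H x hM α₀ hα ha U hU).1, (h36H x hM α₀ hα ha U hU).2.1⟩) (fun x hM α₀ hα ha U hU => by have h := h36H' x hM α₀ hα ha U hU; exact ⟨h.2.2.2.2.2.2, h.2.2.2.1.2.2⟩) hopI _ t37' (fun _ _ h => h.1) hs440 hs441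
  have h44G : ∀ x : MemberY θ.d₆ θ.ℓ₆ θ.hd' θ.hL' θ.b₀ θ.b₁ Mstar, letI : Fintype (B9GeoNormsKLevelV1.geo9K x.toKIdx).Site := (inferInstance : Fintype (geo9Y x).Site); max M12 M44 ≤ (geo9Y x).M → ∀ α₀ : ℝ, 0 < α₀ → (geo9Y x).M * α₀ ≤ min a12 a44 → ∀ U : (𝔅 x).Cfg, (𝔅 x).Reg335 c α₀ U → (𝔅 x).Reg336 c α₀ U → HasMaj (bHZKP (κ := TrIdx N) x.toKIdx (trBasis N) (taxiB x.toKIdx (𝔅 x) (fun U => U) U) (R := (1 : ℝ)) (H := H x) hs440.le hs441.le) (cNorm 1 (H x) (𝔬12 x).blk (fun y => (geo9Y_len_pos x y).le) 1)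
          ((𝔬12 x).Dv U ∘ₗ GcoS x.toKIdx (trBasis N) (𝔅 x) (fun U => U) (GpY x.toKIdx (parSymY x.toKIdx)) U ∘ₗ (𝔬12 x).Dvstar U) (fun a b => B44G * Real.exp (-(δ44G * (geo9Y x).dist a b))) := fun x hM α₀ hα ha U hU _ => by rw [hblk12 x, hDvco12 x U, hDvsco12 x U, ← lettersYOfRecordV4P_Gp]; exact (H44 x ((le_max_right _ _).trans hM) α₀ hα (ha.trans (min_le_right _ _)) U hU).1.mono (fun a b => mul_le_mul hB44Gge (Real.exp_le_exp.2 (neg_le_neg (mul_le_mul_of_nonneg_right hδ44Gle ((hgeoOK x).dnn a b)))) (Real.exp_nonneg _) hB44G)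
  have hp45W : ∀ x : MemberY θ.d₆ θ.ℓ₆ θ.hd' θ.hL' θ.b₀ θ.b₁ Mstar, letI : Fintype (B9GeoNormsKLevelV1.geo9K x.toKIdx).Site := (inferInstance : Fintype (geo9Y x).Site); max M12 M44 ≤ (geo9Y x).M → ∀ α₀ : ℝ, 0 < α₀ → (geo9Y x).M * α₀ ≤ min a12 a44 → ∀ U : (𝔅 x).Cfg, (𝔅 x).Reg335 c α₀ U → (𝔅 x).Reg336 c α₀ U → ∀ (β' : ℝ) (h0 : 0 ≤ β') (h1 : β' < 1), HasMaj (bHZKP (κ := TrIdx N) x.toKIdx (trBasis N) (taxiB x.toKIdx (𝔅 x) (fun U => U) U) (R := (1 : ℝ)) (H := H x) (hsch0 β' h0 h1).le (hsch1 β' h0 h1).le) (cNormR 1 (H x) (𝔭A x).blkPX (fun y => (geo9Y_len_pos x y).le) (β' - 1)) ((𝔭A x).ΦX U β' ∘ₗ ((𝔬12 x).Dv U ∘ₗ GcoS x.toKIdx (trBasis N) (𝔅 x) (fun U => U) (GpY x.toKIdx (parSymY x.toKIdx)) U ∘ₗ (𝔬12 x).Dvstar U)) (fun a b => B45W β' *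 Real.exp (-(δ45W * (geo9Y x).dist a b))) := fun x hM α₀ hα ha U hU _ β' h0 h1 => by rw [hDvco12 x U, hDvsco12 x U, h𝔭A x, lettersYOfRecordV4P_parB, ← lettersYOfRecordV4P_Gp]; exact ((H44 x ((le_max_right _ _).trans hM) α₀ hα (ha.trans (min_le_right _ _)) U hU).2 β' h0 h1).mono (fun a b => mul_le_mul (hB45Wge β' h0 h1) (Real.exp_le_exp.2 (neg_le_neg (mul_le_mul_of_nonneg_right hδ45Wle ((hgeoOK x).dnn a b)))) (Real.exp_nonneg _) (hB45W β' h0 h1))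
  obtain ⟨MXd, BdX, hBdX, hXd⟩ := hXd_of_pinsP_geo9Y (N := N) (M₀ := max M12 MG0) (a₀ := min a12 aG0) H bI hβ1 hbI0 hGR c hϑF₀ (fun x hM α₀ hα ha U hU hU' => hFϑ x ((le_max_left _ _).trans hM) α₀ hα (ha.trans (min_le_left _ _)) U hU hU') w13 hw13₀ hw13₁ sch hsch0 hsch1 hwsch bH13 hbH13 𝔬A 𝔬12 hDvco12 𝔡A h𝔡As 𝔭A hδ12₃0X hδ45 hBZ h45X
  obtain ⟨MDg, hDg⟩ := dgDH_dgDHd_of_pinsP_geo9Y (N := N) (M₀ := max M12 MG0) (a₀ := min a12 aG0) H bI hβ1 hbI0 hGR c hϑF₀ (fun x hM α₀ hα ha U hU hU' => hFϑ x ((le_max_left _ _).trans hM) α₀ hα (ha.trans (min_le_left _ _)) U hU hU') w13 hw13₀ hw13₁ hs440 hs441 hws44 bH13 hbH13 𝔬A 𝔬12 hDvco12 𝔡A h𝔡As h𝔡Ad hblk12 hblkY12 hDco12 hδ12₃0X hδ44 hBi44 hB12₃d hB12₃p h44m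
  obtain ⟨MYd, BhD13, hBhD13, hYd⟩ := pYDH_of_pinsP_geo9Y (N := N) (M₀ := max M12 MG0) (a₀ := min a12 aG0) H bI hβ1 hbI0 hGR c hϑF₀ (fun x hM α₀ hα ha U hU hU' => hFϑ x ((le_max_left _ _).trans hM) α₀ hα (ha.trans (min_le_left _ _)) U hU hU') w13 hw13₀ hw13₁ sch hsch0 hsch1 hwsch bH13 hbH13 𝔬A 𝔬12 hDvco12 𝔡A h𝔡As 𝔭A hδ12₃0X hδ45Y hBiY h45Y
  have h31m := fun (x : MemberY θ.d₆ θ.ℓ₆ θ.hd' θ.hL' θ.b₀ θ.b₁ Mstar) (hM : max (max M12 M43) (max M31 M49) ≤ (geo9Y x).M) (α₀ : ℝ) (hα : 0 < α₀) (ha : (geo9Y x).M * α₀ ≤ min (min a12 a43) (min a31 a49)) (U : (𝔅 x).Cfg) (hU : (𝔅 x).Reg335 c α₀ U) => h31 x (((le_max_left _ _).trans (le_max_right _ _)).trans hM) α₀ hα (ha.trans ((min_le_right _ _).trans (min_le_left _ _))) U hU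
  have h49m := fun (x : MemberY θ.d₆ θ.ℓ₆ θ.hd' θ.hL' θ.b₀ θ.b₁ Mstar) (hM : max (max M12 M43) (max M31 M49) ≤ (geo9Y x).M) (α₀ : ℝ) (hα : 0 < α₀) (ha : (geo9Y x).M * α₀ ≤ min (min a12 a43) (min a31 a49)) (U : (𝔅 x).Cfg) (hU : (𝔅 x).Reg335 c α₀ U) => h49 x (((le_max_right _ _).trans (le_max_right _ _)).trans hM) α₀ hα (ha.trans ((min_le_right _ _).trans (min_le_right _ _))) U hU
  have h43m := fun (x : MemberY θ.d₆ θ.ℓ₆ θ.hd' θ.hL' θ.b₀ θ.b₁ Mstar) (hM : max (max M12 M43) (max M31 M49) ≤ (geo9Y x).M) (α₀ : ℝ) (hα : 0 < α₀) (ha : (geo9Y x).M * α₀ ≤ min (min a12 a43) (min a31 a49)) (U : (𝔅 x).Cfg) (hU : (𝔅 x).Reg335 c α₀ U) (hU' : (𝔅 x).Reg336 c α₀ U) => h43Gp x ((le_max_left _ _).trans hM) α₀ hα (ha.trans (min_le_left _ _)) U hU hU'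
  obtain ⟨MLT, hT4⟩ := split_majorants_of_letter_schemasR (N := N) c q hq H 𝔬12 (((θ.d₆ + 1 : ℕ) : ℝ) * p.C (B9RWSums347DefiniteFaces.exp261 (@geo9Y θ.d₆ θ.ℓ₆ θ.hd' θ.hL' θ.b₀ θ.b₁ Mstar) p.δ₀ p.α)) ((1 - 2 * p.α) * p.δ₀) CP (min ((1 - 2 * p.α) * p.δ₀) δ39 / 8) tJ δB rT δT12 σS tT (max (max (max M12 M46c) M31) M49) (min (min (min a12 a46c) a31) a49)
    (mul_nonneg (Nat.cast_nonneg _) (PinPrims.C_nonneg hp _)) hCP htJ0 hσS (lt_max_of_lt_left (lt_max_of_lt_left (lt_max_of_lt_left hM12))) hrT0 hrTP hrTB hδT12 hδTr2 ht12c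
    (fun x hM α₀ hα ha U hU _ => by rw [hblkW12 x, hblk12 x]; exact h31 x ((le_max_right _ _).trans ((le_max_left _ _).trans hM)) α₀ hα (ha.trans ((min_le_left _ _).trans (min_le_right _ _))) U hU)
    (fun x hM α₀ hα ha U hU _ => by rw [hblkW12 x, hblk12 x]; exact h49 x ((le_max_right _ _).trans hM) α₀ hα (ha.trans (min_le_right _ _)) U hU) (fun x hM α₀ hα ha U hU hU' => hBJ x ((le_max_left _ _).trans ((le_max_left _ _).trans ((le_max_left _ _).trans hM))) α₀ hα (ha.trans (((min_le_left _ _).trans (min_le_left _ _)).trans (min_le_left _ _))) U hU hU')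
  obtain ⟨ML2, hS2⟩ := stepL2_of_letter_schemas_residualR (N := N) q hq H R₁ R₂ hGR c (fun x => ops312RY (𝔬12 x)) (fun x => (𝔯 x).Δ2) (((θ.d₆ + 1 : ℕ) : ℝ) * p.C (B9RWSums347DefiniteFaces.exp261 (@geo9Y θ.d₆ θ.ℓ₆ θ.hd' θ.hL' θ.b₀ θ.b₁ Mstar) p.δ₀ p.α)) ((1 - 2 * p.α) * p.δ₀) CP (min ((1 - 2 * p.α) * p.δ₀) δ39 / 8) tJ δB B₄ δ₄ rT δT12 σS (constL2 (cR39 (trBasis N))⁻¹ (((θ.d₆ + 1 : ℕ) : ℝ) * p.C (B9RWSums347DefiniteFaces.exp261 (@geo9Y θ.d₆ θ.ℓ₆ θ.hd' θ.hL' θ.b₀ θ.b₁ Mstar) p.δ₀ p.α)) CP B₄ (rowConst261 (@geo9Y θ.d₆ θ.ℓ₆ θ.hd' θ.hL' θ.b₀ θ.b₁ Mstar) σS) ((θ.ℓ₆ + 1 : ℕ) : ℝ) * tJ) θ₂ δ₂ (θ₂ * constL2Pi (cR39 (trBasis N))⁻¹ (((θ.d₆ + 1 : ℕ) : ℝ)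 * p.C (B9RWSums347DefiniteFaces.exp261 (@geo9Y θ.d₆ θ.ℓ₆ θ.hd' θ.hL' θ.b₀ θ.b₁ Mstar) p.δ₀ p.α)) CP B₄ (rowConst261 (@geo9Y θ.d₆ θ.ℓ₆ θ.hd' θ.hL' θ.b₀ θ.b₁ Mstar) σS) ((θ.ℓ₆ + 1 : ℕ) : ℝ)) (max (max (max M12 M46c) M31) M49) (min (min (min a12 a46c) a31) a49) (mul_nonneg (Nat.cast_nonneg _) (PinPrims.C_nonneg hp _)) hCP htJ0 hB₄ hθ₂ hσS (lt_max_of_lt_left (lt_max_of_lt_left (lt_max_of_lt_left hM12))) hrT0 hrTP hrTB hrT4 hrT2 hδT12 hδTr le_rfl le_rfl hTpico12 hT2co12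
    (fun x hM α₀ hα ha U hU _ => by rw [show (ops312RY (𝔬12 x)).blkW = _ from hblkW12 x, show (ops312RY (𝔬12 x)).blk = _ from hblk12 x]; exact h31 x ((le_max_right _ _).trans ((le_max_left _ _).trans hM)) α₀ hα (ha.trans ((min_le_left _ _).trans (min_le_right _ _))) U hU) (fun x hM α₀ hα ha U hU _ => h46 x ((le_max_left _ _).trans ((le_max_left _ _).trans hM)) α₀ hα (ha.trans ((min_le_left _ _).trans (min_le_left _ _))) U hU)
    (fun x hM α₀ hα ha U hU _ => by rw [show (ops312RY (𝔬12 x)).blkW = _ from hblkW12 x, show (ops312RY (𝔬12 x)).blk = _ from hblk12 x]; exact h49 x ((le_max_right _ _).trans hM) α₀ hα (ha.trans (min_le_right _ _)) U hU) (fun x hM α₀ hα ha U hU hU' => hBJ x ((le_max_left _ _).trans ((le_max_left _ _).trans ((le_max_left _ _).trans hM))) α₀ hα (ha.trans (((min_le_left _ _).trans (min_le_left _ _)).trans (min_le_left _ _))) U hU hU') (fun x hM α₀ hα ha U hU hU' => B9PerturbationL2Delta2.blockBd_d2coK_of_sup_symm x.toKIdx _ _ _ (hgeoOK x) (mul_nonneg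 hθ₂ (mul_nonneg (B9GeoLemma21KLevelV1.geo9K_M_nonneg x.toKIdx) hα.le)) (hD2sup x ((le_max_left _ _).trans ((le_max_left _ _).trans ((le_max_left _ _).trans hM))) α₀ hα (ha.trans (((min_le_left _ _).trans (min_le_left _ _)).trans (min_le_left _ _))) U hU hU') (hΔ2 x U (mem_of_reg335R hGR x hU)))
  set θ2S : ℝ := constL2 (cR39 (trBasis N))⁻¹ (((θ.d₆ + 1 : ℕ) : ℝ) * p.C (B9RWSums347DefiniteFaces.exp261 (@geo9Y θ.d₆ θ.ℓ₆ θ.hd' θ.hL' θ.b₀ θ.b₁ Mstar) p.δ₀ p.α)) CP B₄ (rowConst261 (@geo9Y θ.d₆ θ.ℓ₆ θ.hd' θ.hL' θ.b₀ θ.b₁ Mstar) σS) ((θ.ℓ₆ + 1 : ℕ) : ℝ) * tJ + θ₂ * constL2Pi (cR39 (trBasis N))⁻¹ (((θ.d₆ + 1 : ℕ) : ℝ) * p.C (B9RWSums347DefiniteFaces.exp261 (@geo9Y θ.d₆ θ.ℓ₆ θ.hd' θ.hL' θ.b₀ θ.b₁ Mstar) p.δ₀ p.α)) CP B₄ (rowConst261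 (@geo9Y θ.d₆ θ.ℓ₆ θ.hd' θ.hL' θ.b₀ θ.b₁ Mstar) σS) ((θ.ℓ₆ + 1 : ℕ) : ℝ) with hθ2Sdef; have hθ2S : 0 ≤ θ2S := add_nonneg (mul_nonneg (constL2_nonneg (inv_nonneg.2 (cR39_trBasis_pos hN).le) (mul_nonneg (Nat.cast_nonneg _) (PinPrims.C_nonneg hp _)) hCP hB₄ (B9RowSum261DefiniteFaces.rowConst261_nonneg _ _) (Nat.cast_nonneg _)) htJ0) (mul_nonneg hθ₂ (constL2Pi_nonneg _ _ _ _ _ _))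
  obtain ⟨MW, hW⟩ := hWE_of_pinsP_geo9Y_budget (N := N) H bI hlev hβ1 hbI0 c (M₀ := max (max (max M12 MpW) M44) M49) (a₀ := min (min (min a12 apW) a44) a49) hαW0 hαW1 hσW hδFW wX hwX₀ hwX₁ sch hsch0 hsch1 hwschX bXH hbXH 𝔬12 hblk12 hblkW12 hDvco12 hDvsco12 hRco12 𝔭A hCP hδFP (fun _ => rfl) (fun _ => rfl) (fun x hM α₀ hα ha U hU => h49 x ((le_max_right _ _).trans hM) α₀ hα (ha.trans (min_le_right _ _)) U hU) (δ45 := δ45W) (δh := δhW) (δ₃ := δ12₃) hB45W hBhW hbudW hδ45W hδhW hδ3W hBxW (fun x hM α₀ hα ha U hU hU' => hp45W x ((max_le ((le_max_left _ _).trans ((le_max_left _ _).trans (le_max_left _ _))) ((le_max_right _ _).trans (le_max_left _ _))).trans hM) α₀ hα (ha.trans (le_min ((min_le_left _ _).trans ((min_le_left _ _).trans (min_le_left _ _))) ((min_le_left _ _).trans (min_le_right _ _)))) U hU hU') (fun x hM α₀ hα ha U hU hU' => hpDGW x (((le_max_left _ _).trans (le_max_left _ _)).trans hM) α₀ hα (ha.trans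 ((min_le_left _ _).trans (min_le_left _ _))) U hU hU')
  have hδFWr : δFW ≤ (1 - 2 * p.α) * p.δ₀ := hδFP.trans (by have h1 := min_le_left ((1 - 2 * p.α) * p.δ₀) δ39; linarith only [h1, hθ49])
  obtain ⟨M13, h13⟩ := hwGp_of_pinsP_geo9Y (N := N) H bI hlev hβ1 hbI0 c (M₀ := max (max (max M12 M44) M43) (max M31 M49)) (a₀ := min (min (min a12 a44) a43) (min a31 a49)) hαW0 hαW1 hσW hδFW wX hwX₀ hwX₁ hs440 hs441 hwX44 bXH hbXH 𝔬12 hblk12 hblkW12 hDvco12 hDvsco12 hRco12 (B₃ := B12₃) (δ₃ := δ12₃) (mul_nonneg (Nat.cast_nonneg _) (p.C_nonneg hp _)) hCP hB44G hδFWr hδFP hbudW hδ44G hB₃wG hδ3W (fun _ => rfl) (fun _ => rfl)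
    (fun x hM α₀ hα ha U hU => h31m x ((max_le_max (max_le_max (le_max_left _ _) le_rfl) le_rfl).trans hM) α₀ hα (ha.trans (min_le_min (min_le_min (min_le_left _ _) le_rfl) le_rfl)) U hU)
    (fun x hM α₀ hα ha U hU => h49m x ((max_le_max (max_le_max (le_max_left _ _) le_rfl) le_rfl).trans hM) α₀ hα (ha.trans (min_le_min (min_le_min (min_le_left _ _) le_rfl) le_rfl)) U hU)
    (fun x hM α₀ hα ha U hU hU' => h44G x ((le_max_left _ _).trans ((le_max_left _ _).trans hM)) α₀ hα ((ha.trans (min_le_left _ _)).trans (min_le_left _ _)) U hU hU')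
  obtain ⟨Mrg, hrg⟩ := hrgdH_of_pinsP43_geo9Y (N := N) H bI hlev hβ1 hGR c (M₀ := max (max M12 M43) (max M31 M49)) (a₀ := min (min a12 a43) (min a31 a49)) hαW0 hαW1 hσW hδFW w13 hw13₀ hw13₁ bH13 hbH13 𝔬12 hblk12 hblkW12 hDvsco12 hRco12
    (mul_nonneg (Nat.cast_nonneg _) (p.C_nonneg hp _)) hCP hB43 hδFWr hδFP hρrg0 hbudrg hbud43 hB₃rg hδ₃rg (fun _ => rfl) (fun _ => rfl)
    h31m
    h49m
    h43m
  obtain ⟨CA3, hCA3, hCA30⟩ : ∃ CA3 : ℝ, B9PerturbationMajorantAlgebra.constA (cR39 (trBasis N))⁻¹ (((θ.d₆ + 1 : ℕ) : ℝ) * p.C (B9RWSums347DefiniteFaces.exp261 (@geo9Y θ.d₆ θ.ℓ₆ θ.hd' θ.hL' θ.b₀ θ.b₁ Mstar) p.δ₀ p.α)) CP (rowConst261 (@geo9Y θ.d₆ θ.ℓ₆ θ.hd' θ.hL' θ.b₀ θ.b₁ Mstar) σW) (((θ.ℓ₆ + 1 : ℕ) : ℝ)) ≤ CA3 ∧ 0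 ≤ CA3 := ⟨max (B9PerturbationMajorantAlgebra.constA (cR39 (trBasis N))⁻¹ (((θ.d₆ + 1 : ℕ) : ℝ) * p.C (B9RWSums347DefiniteFaces.exp261 (@geo9Y θ.d₆ θ.ℓ₆ θ.hd' θ.hL' θ.b₀ θ.b₁ Mstar) p.δ₀ p.α)) CP (rowConst261 (@geo9Y θ.d₆ θ.ℓ₆ θ.hd' θ.hL' θ.b₀ θ.b₁ Mstar) σW) (((θ.ℓ₆ + 1 : ℕ) : ℝ))) 0, le_max_left _ _, le_max_right _ _⟩
  obtain ⟨Mr2, hr2⟩ := hrgd2_of_pinsP_geo9Y (N := N) H bI c (M₀ := max (max M12 M43) (max M31 M49)) (a₀ := min (min a12 a43) (min a31 a49)) hαW0 hαW1 hσW hδFW 𝔬12 hblk12 hblkW12 hDvco12 hDvsco12 hRco12 (B₃ := CA3) (δ₃ := δ12₃) (mul_nonneg (Nat.cast_nonneg _) (p.C_nonneg hp _)) hCP hδFWr hδFP hbudW hCA3 hδ3W (fun _ => rfl) (fun _ => rfl)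
    h31m
    h49m
  set M12T : ℝ := max (max (max (max (max (max (max (max (max (max (max (max (max (max M12 M46c) M31) M49) ML2) MLT) MR) MXd) MDg) MYd) MW) M13) Mrg) (max M12 M43)) M44 with hM12Tdef; set a12T : ℝ := min (min (min (min (min (min (min (min (min a12 a46c) a31) a49) (q.a₁ / c)) a43) apW) a44) aG0) (p.a₁ / c) with ha12Tdef; have hM12T : M12 ≤ M12T := (((((((le_max_left M12 M46c).trans (le_max_left _ M31)).trans (le_max_left _ M49)).trans (le_max_left _ ML2)).trans (le_max_left _ MLT)).trans (le_max_left _ MR)).trans ((le_max_left _ MXd).trans ((le_max_left _ MDg).trans ((le_max_left _ MYd).trans ((le_max_left _ MW).trans ((le_max_left _ M13).trans ((le_max_left _ Mrg).trans (le_max_left _ (max M12 M43))))))))).trans (le_max_left _ M44); have hMXT : MXd ≤ M12T := ((le_max_right _ MXd).trans ((le_max_left _ MDg).trans ((le_max_left _ MYd).trans ((le_max_left _ MW).trans ((le_max_left _ M13).trans ((le_max_left _ Mrg).trans (le_max_left _ (max M12 M43)))))))).trans (le_max_left _ M44); have hMDgT : MDg ≤ M12T := ((le_max_right _ MDg).trans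 ((le_max_left _ MYd).trans ((le_max_left _ MW).trans ((le_max_left _ M13).trans ((le_max_left _ Mrg).trans (le_max_left _ (max M12 M43))))))).trans (le_max_left _ M44); have hMYT : MYd ≤ M12T := ((le_max_right _ MYd).trans ((le_max_left _ MW).trans ((le_max_left _ M13).trans ((le_max_left _ Mrg).trans (le_max_left _ (max M12 M43)))))).trans (le_max_left _ M44); have hMWT : MW ≤ M12T := ((le_max_right _ MW).trans ((le_max_left _ M13).trans ((le_max_left _ Mrg).trans (le_max_left _ (max M12 M43))))).trans (le_max_left _ M44); have hM13T : M13 ≤ M12T := ((le_max_right _ M13).trans ((le_max_left _ Mrg).trans (le_max_left _ (max M12 M43)))).trans (le_max_left _ M44); have hMrgT : Mrg ≤ M12T := ((le_max_right _ Mrg).trans (le_max_left _ (max M12 M43))).trans (le_max_left _ M44); have ha12T : a12T ≤ a12 := (min_le_left _ (p.a₁ / c)).trans (((min_le_left _ aG0).trans (min_le_left _ a44)).trans ((((((min_le_left _ _).trans (min_le_left _ _)).trans (min_le_left _ _)).trans (min_le_left _ _)).trans (min_le_left _ _)).trans (min_le_left _ _))); have ha43T : a12T ≤ a43 := (min_le_left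 _ (p.a₁ / c)).trans (((min_le_left _ aG0).trans (min_le_left _ a44)).trans ((min_le_left _ _).trans (min_le_right _ _))); have haWT : a12T ≤ apW := (min_le_left _ (p.a₁ / c)).trans (((min_le_left _ aG0).trans (min_le_left _ a44)).trans (min_le_right _ _)); have hM43T : M43 ≤ M12T := ((le_max_right M12 M43).trans (le_max_right _ _)).trans (le_max_left _ M44); have hM12RT : max M12 MR ≤ M12T := max_le hM12T ((((((le_max_right _ MR).trans (le_max_left _ MXd)).trans (le_max_left _ MDg)).trans (le_max_left _ MYd)).trans ((le_max_left _ MW).trans ((le_max_left _ M13).trans ((le_max_left _ Mrg).trans (le_max_left _ (max M12 M43)))))).trans (le_max_left _ M44)); have hM12T0 : max (max (max (max (max M12 M46c) M31) M49) ML2) MLT ≤ M12T := (((((le_max_left _ MR).trans (le_max_left _ MXd)).trans (le_max_left _ MDg)).trans (le_max_left _ MYd)).trans ((le_max_left _ MW).trans ((le_max_left _ M13).trans ((le_max_left _ Mrg).trans (le_max_left _ (max M12 M43)))))).trans (le_max_left _ M44); have ha12T0 : a12T ≤ min (min (min a12 a46c) a31) a49 := (min_le_left _ (p.a₁ / c)).trans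 (((min_le_left _ aG0).trans (min_le_left _ a44)).trans ((min_le_left _ _).trans ((min_le_left _ _).trans (min_le_left _ _)))); have ha12RT : a12T ≤ min a12 (q.a₁ / c) := le_min ha12T ((min_le_left _ (p.a₁ / c)).trans (((min_le_left _ aG0).trans (min_le_left _ a44)).trans ((min_le_left _ _).trans ((min_le_left _ _).trans (min_le_right _ _))))); have hM12Tpos : 0 < M12T := lt_of_lt_of_le hM12 hM12T; have ha12Tpos : 0 < a12T := lt_min (lt_min (lt_min (lt_min (lt_min (lt_min (lt_min (lt_min (lt_min ha12 ha46c) ha31) ha49) hac) ha43) hapW) ha44) haG0) (div_pos hp.a₁_pos hc); have hM44T : M44 ≤ M12T := le_max_right _ M44; have ha44T : a12T ≤ a44 := (min_le_left _ (p.a₁ / c)).trans ((min_le_left _ aG0).trans (min_le_right _ a44)); have haGT : a12T ≤ aG0 := (min_le_left _ (p.a₁ / c)).trans (min_le_right _ aG0); have haPT : a12T ≤ p.a₁ / c := min_le_right _ _; have hcaP : ∀ {M α₀ : ℝ}, M * α₀ ≤ p.a₁ / c → c * M * α₀ ≤ p.a₁ := fun {M α₀} h => (by have h' := (le_div_iff₀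 hc).1 h; linarith only [h', show c * M * α₀ = M * α₀ * c by ring])
  have hWE : ∀ x : MemberY θ.d₆ θ.ℓ₆ θ.hd' θ.hL' θ.b₀ θ.b₁ Mstar, M12T ≤ (geo9Y x).M → ∀ α₀ : ℝ, 0 < α₀ → (geo9Y x).M * α₀ ≤ min (min (min a12 apW) a44) a49 → ∀ U : (𝔅 x).Cfg, (𝔅 x).Reg335 c α₀ U → (𝔅 x).Reg336 c α₀ U → ∀ β : ℝ, 0 ≤ β → β < 1 → HasMaj (bXH x U) (cNormR 1 (H x) (𝔭A x).blkPX (fun y => (geo9Y_len_pos x y).le) (β - 1)) ((𝔭A x).ΦX U β ∘ₗ ((𝔬12 x).Dv U ∘ₗ GcoS x.toKIdx (trBasis N) (𝔅 x) (fun U => U) (GpY x.toKIdx (parSymY x.toKIdx)) U ∘ₗ (𝔬12 x).R U ∘ₗ (𝔬12 x).Dvstar U)) (fun a b => Bx13 β * Real.exp (-(δ12₃ * (geo9Y x).dist a b))) := fun x hM α₀ hα ha U hU hU' β h0 h1 => hW x (hMWT.trans hM) α₀ hα ha U hU hU' β h0 h1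
  have hM31T : M31 ≤ M12T := (le_max_right _ _).trans ((le_max_left _ _).trans ((le_max_left _ _).trans ((le_max_left _ _).trans hM12T0))); have hM49T : M49 ≤ M12T := (le_max_right _ _).trans ((le_max_left _ _).trans ((le_max_left _ _).trans hM12T0)); have hM46T : M46c ≤ M12T := (le_max_right _ _).trans ((le_max_left _ _).trans ((le_max_left _ _).trans ((le_max_left _ _).trans ((le_max_left _ _).trans hM12T0)))); have ha46T : a12T ≤ a46c := (min_le_left _ (p.a₁ / c)).trans (((min_le_left _ aG0).trans (min_le_left _ a44)).trans ((min_le_left _ _).trans ((min_le_left _ _).trans ((min_le_left _ _).trans ((min_le_left _ _).trans ((min_le_left _ _).trans (min_le_right _ _))))))); have ha31T : a12T ≤ a31 := (min_le_left _ (p.a₁ / c)).trans (((min_le_left _ aG0).trans (min_le_left _ a44)).trans ((min_le_left _ _).trans ((min_le_left _ _).trans ((min_le_left _ _).trans ((min_le_left _ _).trans (min_le_right _ _)))))); have ha49T : a12T ≤ a49 := (min_le_left _ (p.a₁ / c)).trans (((min_le_left _ aG0).trans (min_le_left _ a44)).trans ((min_le_left _ _).trans ((min_le_left _ _).trans ((min_le_left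 _ _).trans (min_le_right _ _))))); have hαFδq : 0 ≤ q.αF * ((1 - 2 * q.α) * q.δ₀) := mul_nonneg hq.αF_pos.le (mul_nonneg (by linarith only [hq.α_lt]) hq.δ₀_pos.le)
  have hta := fun (x : MemberY θ.d₆ θ.ℓ₆ θ.hd' θ.hL' θ.b₀ θ.b₁ Mstar) (hM : M12T ≤ (geo9Y x).M) (α₀ : ℝ) (hα : 0 < α₀) (ha : (geo9Y x).M * α₀ ≤ a12T) (U : (𝔅 x).Cfg) (hU : (𝔅 x).Reg335 c α₀ U) (hU' : (𝔅 x).Reg336 c α₀ U) => (hT4 x ((le_max_right (max (max (max (max M12 M46c) M31) M49) ML2) MLT).trans (hM12T0.trans hM)) ((le_max_left (max (max (max M12 M46c) M31) M49) ML2).trans ((le_max_left (max (max (max (max M12 M46c) M31) M49) ML2) MLT).trans (hM12T0.trans hM))) α₀ hα (ha.trans ha12T0) U hU hU').1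
  have hKT : δK12 ≤ δT12 := (by have hτ : 0 ≤ q.αF * ((1 - 2 * q.α) * q.δ₀) := mul_nonneg hq.αF_pos.le (mul_nonneg (by linarith only [hq.α_lt]) hq.δ₀_pos.le); linarith only [hδKS, hρST, hτ]); have hstepL2 : ∀ x : MemberY θ.d₆ θ.ℓ₆ θ.hd' θ.hL' θ.b₀ θ.b₁ Mstar, M12T ≤ (geo9Y x).M → ∀ α₀ : ℝ, 0 < α₀ → (geo9Y x).M * α₀ ≤ a12T → ∀ U : (𝔅 x).Cfg, (𝔅 x).Reg335 c α₀ U → (𝔅 x).Reg336 c α₀ U → StepL2 (𝔬12 x) 1 (H x) (θ2S * ((geo9Y x).M * α₀)) δK12 U := fun x hM α₀ hα ha U hU hU' =>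
    (fun (h : StepL2 (ops312RY (𝔬12 x)) 1 (H x) (θ2S * ((geo9Y x).M * α₀)) δT12 U) (hk : ∀ y y' : (geo9Y x).Site, θ2S * ((geo9Y x).M * α₀) * ((geo9Y x).len y)⁻¹ * ((geo9Y x).len y')⁻¹ * Real.exp (-(δT12 * (geo9Y x).dist y y')) ≤ θ2S * ((geo9Y x).M * α₀) * ((geo9Y x).len y)⁻¹ * ((geo9Y x).len y')⁻¹ * Real.exp (-(δK12 * (geo9Y x).dist y y'))) => (⟨h.t.mono hk, h.t1.mono hk⟩ : StepL2 (𝔬12 x) 1 (H x) (θ2S * ((geo9Y x).M * α₀)) δK12 U)) (hS2 x ((le_max_right (max (max (max M12 M46c) M31) M49) ML2).trans ((le_max_left (max (max (max (max M12 M46c) M31) M49) ML2) MLT).trans (hM12T0.trans hM))) ((le_max_left (max (max (max M12 M46c) M31) M49) ML2).trans ((le_max_left (max (max (max (max M12 M46c) M31) M49) ML2) MLT).trans (hM12T0.trans hM))) α₀ hα (ha.trans ha12T0) U hU hU') (fun y y' => mul_le_mul_of_nonneg_left (Real.exp_le_exp.2 (neg_le_neg (mul_le_mul_of_nonneg_right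 hKT (geo9K_dist_nonneg x.toKIdx y y')))) (mul_nonneg (mul_nonneg (mul_nonneg hθ2S (mul_nonneg (hM12Tpos.le.trans hM) hα.le)) (inv_nonneg.2 (geo9Y_len_pos x y).le)) (inv_nonneg.2 (geo9Y_len_pos x y').le)))
  obtain ⟨B12₀, Bi12, Bi2₁₂, B12₂, r12, M₀, a₀, hB12₀, hBh12, hBi12, hBi2₁₂, hB12₂, hr12, hM₀g, ha₀g, hMM, haa, hmodel12, he1G, hG0C⟩ := g0_layer_of_thm310_coreDir₃USP (bg := (bg9YR (Matrix (Fin N) (Fin N) ℂ) (specialUnitaryUnits (Fin N)) R₁ R₂)) hc q hq q3 hq3 qM hqM H 𝔬A 𝔭A 𝔡A 𝔩A bHXA κA SHA S3A SIA SMA S2A hstA hκA h36A4 h36HA' h36A2 hcntHA hcnt3A hcntIA hcntMA hcnt2A hsymA htrA 𝔬12 (fun x => (hblk12 x).trans (hblkA x).symm) (fun x => (hblkY12 x).trans (hblkYA x).symm) (fun x U => (hG0co12 x U).trans (hGcoA x U).symm) (fun x U => (hDco12 x U).trans (hDcoA x U).symm) (fun x U => (hDsco12 x U).trans (hDscoA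 x U).symm) θ2S δ12₀ δK12 a12T M12T ρS σS ha12Tpos hM12Tpos hθ2S hδ12₀ hσS hρS hρS₀ hσSK (fun x hM α₀ hα ha U hU hU' => hpos12 x (hM12RT.trans hM) α₀ hα (ha.trans ha12RT) U hU hU') (fun x hM α₀ hα ha U hU hU' => hinv12 x (hM12RT.trans hM) α₀ hα (ha.trans ha12RT) U hU hU') (fun x hM α₀ hα ha U hU hU' => hIdOfForm x (hM12RT.trans hM) α₀ hα (ha.trans ha12RT) U hU hU') hstepL2
  set BhC : ℝ → ℝ := fun β => holderConst (exp261 (@geo9Y θ.d₆ θ.ℓ₆ θ.hd' θ.hL' θ.b₀ θ.b₁ Mstar) q.δ₀ q.α) q.δ₀ q.α q.NH q.NF (const37 (exp261 (@geo9Y θ.d₆ θ.ℓ₆ θ.hd' θ.hL' θ.b₀ θ.b₁ Mstar) q.δ₀ q.α) q.δ₀ q.α q.ρ q.B₀ q.Nc q.N' q.Cℓ q.Kc) (q.Bl β) (q.Bt β) with hBhCdef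
  -- (edition 109) `hrgdd13` DERIVED: level-13 letters at δ13′, the U8 layer a SECOND time at (δK′, δP′) above δ12₃, dag-n06-c's LEG `rgdd_of_pinsT` (this seat's `…N06Rgdd13AtPinsPUW`)
  obtain ⟨MR13, aR13, BrR, hMR13, haR13₀, haR13₁, hBrR, hRG13⟩ := hrgdd13_of_pinsP_geo9Y (N := N) θ.toStage3Params Mstar H bI hlev hβ1 hbI0 hGR c c35Y_le_ten (fun x α₀ U hU => (hRP1 x α₀ U hU).2.1) (M₀ := max (max M₀ MT) MG0) (a₀ := min a₀ aT) (hM₀g.le.trans ((le_max_left _ _).trans (le_max_left _ _))) (lt_min ha₀g haT) hσS hτS w13 hw13₀ hw13₁ wX hwX₀ hwX₁ hs440 hs441 hws44 hwX44 sch hsch0 hsch1 hwsch bH13 hbH13 hκ13 bXH hbXH bHXA hbHXA bHXT hbHXT bHXTA hbHXTA 𝔬12 hblk12 hblkW12 hblkY12 hblkZ12 (fun x => (lettersYOfRecordV4P N θ.toStage3Params Mstar 𝔯 x).GA) hG0co12 hDco12 hDsco12 (fun x => (𝔯 x).Δ2) hTpico12 hT2co12 hDvco12 hDvsco12 hRco12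 hQsco12 𝔭A (fun _ => rfl) h𝔭A 𝔬A 𝔡A h𝔡Ad h𝔡As (hB₀ := mul_nonneg (Nat.cast_nonneg _) (p.C_nonneg hp _)) (hCP := hCP) (htJ := htJ0) (hB43 := hB43) (htA := ht12T) (hθ₂ := hθ₂) (hB44 := hB44G) (hB12₀ := hB12₀) (hB12₂ := hB12₂) (hBh12 := hBh12) (hBi12 := hBi12) (hBi2₁₂ := hBi2₁₂) (hBHG := hBHG) (hwBhG := hwBhG) (hϑF := hϑF₀) (hBi44 := hBi44) (hBZ := hBZ) (hBiY := hBiY) (hBiT := fun ε hε hε1 => inputConst44_pins_nonneg q hq (const37_pins_nonneg q hq (exp261 (@geo9Y θ.d₆ θ.ℓ₆ θ.hd' θ.hL' θ.b₀ θ.b₁ Mstar) q.δ₀ q.α)) (Nat.cast_nonneg (θ.ℓ₆ + 1)) ε hε hε1) (hBi2T := fun ε β' hε hε1 h0 h1 => inputConst45_pins_nonneg q hq (const37_pins_nonneg q hq (exp261 (@geo9Y θ.d₆ θ.ℓ₆ θ.hd' θ.hL' θ.b₀ θ.b₁ Mstar) q.δ₀ q.α)) (Nat.cast_nonneg (θ.ℓ₆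 + 1)) ε β' hε hε1 h0 h1) (δK := δ12₃ + 5 * τR) (δP := δ12₃ + 5 * τR + τS + σS) (δ13 := δ12₃ + 5 * τR + 2 * σS + 3 * τS) (hδ30 := hδ12₃0X) (hτR := hτR) (h3₀ := by linarith only [hR8h, hτR, hσS, hτS]) (h3P := by linarith only [hτR, hσS, hτS]) (h3K := le_rfl) (h349 := by linarith only [hR8b, hτR, hσS, hτS]) (hr0 := hR8a) (hr49 := hR8b) (hr2 := hR8c) (hr44 := hR8d) (hrB := hR8e) (hr43 := hR8f) (hrT := hR8g) (hK3d := by linarith only [hσS, hτS]) (hKP := le_rfl) (hP0 := by linarith only [hR8h, hσS, hτS]) (hP3 := by linarith only [hτS]) (h130 := hR8h) (h1344 := hR8i) (h1345 := hR8j) (h1345Y := hR8k) (h31 := fun x hM α₀ hα ha U hU => h31 x (hM31T.trans (hMM.trans (((le_max_left _ _).trans (le_max_left _ _)).trans hM))) α₀ hα ((ha.trans ((min_le_left _ _).trans haa)).trans ha31T) U hU) (h49 := fun x hM α₀ hα ha U hU => h49 x (hM49T.trans (hMM.trans (((le_max_left _ _).trans (le_max_left _ _)).trans hM))) α₀ hα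 ((ha.trans ((min_le_left _ _).trans haa)).trans ha49T) U hU) (h43 := fun x hM α₀ hα ha U hU hU' => h43Gp x ((max_le hM12T hM43T).trans (hMM.trans (((le_max_left _ _).trans (le_max_left _ _)).trans hM))) α₀ hα ((ha.trans ((min_le_left _ _).trans haa)).trans (le_min ha12T ha43T)) U hU hU') (h44G := fun x hM α₀ hα ha U hU hU' => h44G x ((max_le hM12T hM44T).trans (hMM.trans (((le_max_left _ _).trans (le_max_left _ _)).trans hM))) α₀ hα ((ha.trans ((min_le_left _ _).trans haa)).trans (le_min ha12T ha44T)) U hU hU') (hD2 := fun x hM α₀ hα ha U hU hU' => hD2sup x (hM12T.trans (hMM.trans (((le_max_left _ _).trans (le_max_left _ _)).trans hM))) α₀ hα ((ha.trans ((min_le_left _ _).trans haa)).trans ha12T) U hU hU') (hta := fun x hM α₀ hα ha U hU hU' => hta x (hMM.trans (((le_max_left _ _).trans (le_max_left _ _)).trans hM)) α₀ hα (ha.trans ((min_le_left _ _).trans haa)) U hU hU') (hBJ := fun x hM α₀ hα ha U hU hU' => hBJ x (hM12T.trans (hMM.trans (((le_max_left _ _).trans (le_max_left _ _)).trans hM)))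 α₀ hα ((ha.trans ((min_le_left _ _).trans haa)).trans ha12T) U hU hU')
    (hG0 := fun x hM α₀ hα ha U hU hU' => (hmodel12 x (((le_max_left _ _).trans (le_max_left _ _)).trans hM) α₀ hα (ha.trans (min_le_left _ _)) U hU hU').1) (hG0D := fun x hM α₀ hα ha U hU hU' => (hG0C x (((le_max_left _ _).trans (le_max_left _ _)).trans hM) α₀ hα (ha.trans (min_le_left _ _)) U hU hU').1) (hG0DR := fun x hM α₀ hα ha U hU hU' => (hG0C x (((le_max_left _ _).trans (le_max_left _ _)).trans hM) α₀ hα (ha.trans (min_le_left _ _)) U hU hU').2.1) (hG0L2M := fun x hM α₀ hα ha U hU hU' => (hG0C x (((le_max_left _ _).trans (le_max_left _ _)).trans hM) α₀ hα (ha.trans (min_le_left _ _)) U hU hU').2.2) (he1 := fun x hM α₀ hα ha U hU hU' => he1G x (((le_max_left _ _).trans (le_max_left _ _)).trans hM) α₀ hα (ha.trans (min_le_left _ _)) U hU hU') (hI := fun x hM α₀ hα ha U hU hU' => (hmodel12 x (((le_max_left _ _).trans (le_max_left _ _)).trans hM) α₀ hα (ha.trans (min_le_left _ _)) U hU hU').2.2)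 (hG0CT := fun x hM α₀ hα ha U hU _ => hG0CT' x (((le_max_right _ _).trans (le_max_left _ _)).trans hM) α₀ hα (ha.trans (min_le_right _ _)) U hU δ12₀ hδ12₀F) (hF := fun x hM α₀ hα ha U hU hU' => hFϑ x (hM12T.trans (hMM.trans (((le_max_left _ _).trans (le_max_left _ _)).trans hM))) α₀ hα ((ha.trans ((min_le_left _ _).trans haa)).trans ha12T) U hU hU') (h45X := fun x hM α₀ hα ha U hU hU' => h45X x ((max_le (hM12T.trans (hMM.trans ((le_max_left _ _).trans (le_max_left _ _)))) (le_max_right _ _)).trans hM) α₀ hα ((ha.trans ((min_le_left _ _).trans haa)).trans (le_min ha12T haGT)) U hU hU') (h44m := fun x hM α₀ hα ha U hU hU' => h44m x ((max_le (hM12T.trans (hMM.trans ((le_max_left _ _).trans (le_max_left _ _)))) (le_max_right _ _)).trans hM) α₀ hα ((ha.trans ((min_le_left _ _).trans haa)).trans (le_min ha12T haGT)) U hU hU') (h45Y := fun x hM α₀ hα ha U hU hU' => h45Y x ((max_le (hM12T.trans (hMM.trans ((le_max_left _ _).trans (le_max_left _ _)))) (le_max_right _ _)).trans hM) α₀ hα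 ((ha.trans ((min_le_left _ _).trans haa)).trans (le_min ha12T haGT)) U hU hU')
  set aZ : ℝ := min (min a₀ (1 / (2 * r12 + 2))) aR13 with haZdef; have haZ0 : aZ ≤ a₀ := (min_le_left _ _).trans (min_le_left _ _); have haZR : aZ ≤ aR13 := min_le_right _ _; have haZT : aZ ≤ aT := haZR.trans (haR13₁.trans (min_le_right _ _)); have haZg : 0 < aZ := lt_min (lt_min ha₀g (by positivity)) haR13₀; have haaZ : aZ ≤ a12T := haZ0.trans haa
  have hids : ∀ x : MemberY θ.d₆ θ.ℓ₆ θ.hd' θ.hL' θ.b₀ θ.b₁ Mstar, M₀ ≤ (geo9Y x).M → ∀ α₀ : ℝ, 0 < α₀ → (geo9Y x).M * α₀ ≤ aZ → ∀ U : (𝔅 x).Cfg, (𝔅 x).Reg335 c α₀ U → (𝔅 x).Reg336 c α₀ U → Ids3124 (𝔬12 x) U ∧ Ids3152 (𝔬12 x) (fun U => GcoS x.toKIdx (trBasis N) (𝔅 x) (fun U => U) (GpY x.toKIdx (parSymY x.toKIdx)) U) U := fun x hM α₀ hα ha U hU hU' => by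
    have hr1 : r12 * ((geo9Y x).M * α₀) < 1 := by
      have h2 : 0 < 2 * r12 + 2 := by positivity
      calc r12 * ((geo9Y x).M * α₀) ≤ r12 * (1 / (2 * r12 + 2)) := mul_le_mul_of_nonneg_left (ha.trans ((min_le_left _ _).trans (min_le_right _ _))) hr12
        _ < 1 := by rw [mul_one_div, div_lt_one h2]; linarith
    exact ids3124_ids3152_of_hZ_pins x.toKIdx (𝔅 x) (fun U => U) (𝔯 x).Δ2 (𝔬12 x) U hN specialUnitaryUnits_le_unitaryUnits (mem_of_reg335R hGR x hU) (cf_mul_etaS_of_hcfk x.toKIdx x.hcfk) (isUnit_deltaOneY_of_formSmall_phys x.toKIdx (𝔅 x) (fun U => U) (𝔯 x).Δ2 (𝔬12 x) U hN (hmodel12 x hM α₀ hα (ha.trans haZ0) U hU hU').2.1 hr1 (hS0co12 x U) (hTpico12 x U) (hT2co12 x U)) (hG1co12 x U) (hQco12 x U) (hQsco12 x U) (hDvco12 x U) (hDvsco12 x U) (hRco12 x U) (hZ x (hM12T.trans (hMM.trans hM)) α₀ hα ((ha.trans haaZ).trans ha12T) U hU hU')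
  obtain ⟨ML2, BL2, hM0L2, hBL2, hLQ⟩ := g0qstar_l2_letters_of_pins θ.toStage3Params Mstar hGR bI hβ1 H 𝔬12 (fun x => (𝔡A x).Dd) (fun x => (𝔡A x).Dsd) hblk12 hblkZ12 hQsco12 hQco12 (M12 := M₀) (a12 := aZ) hB12₂ hδ12₃0X hδ₃₀.le (fun x hM α₀ hα ha U hU hU' => (hG0C x hM α₀ hα (ha.trans haZ0) U hU hU').2.2)
  obtain ⟨MDv, BZv, BXv, BLv, hMDv, hBZv, hBXv, hBLv, hDV⟩ := dv_letters_of_pins θ.toStage3Params Mstar hGR bI hβ1 H 𝔬12 𝔭A (fun x => (lettersYOfRecordV4P N θ.toStage3Params Mstar 𝔯 x).parB) h𝔭A (fun x => (lettersYOfRecordV4P N θ.toStage3Params Mstar 𝔯 x).GA) (fun x => (𝔡A x).Dd) (fun x => (𝔡A x).Dsd) h𝔡Ad h𝔡As hblk12 hblkW12 hblkY12 hG0co12 hDco12 hDsco12 hDvco12 (M12 := M₀) (a12 := aZ) hB12₀ hB12₂ hBh12 hδ12₃0X hδ₃₀ (fun x hM α₀ hα ha U hU hU' => (hG0C x hM α₀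 hα (ha.trans haZ0) U hU hU').2.1) (fun x hM α₀ hα ha U hU hU' => (hG0C x hM α₀ hα (ha.trans haZ0) U hU hU').2.2) (fun x hM α₀ hα ha U hU hU' => (hG0C x hM α₀ hα (ha.trans haZ0) U hU hU').1.h43R)
  obtain ⟨MDx, KX, hMDx, hKX, hPX⟩ := pXDv_of_pins_KX θ.toStage3Params Mstar hGR bI hβ1 H 𝔬12 𝔭A (fun x => (lettersYOfRecordV4P N θ.toStage3Params Mstar 𝔯 x).parB) h𝔭A (fun x => (lettersYOfRecordV4P N θ.toStage3Params Mstar 𝔯 x).GA) (fun x => (𝔡A x).Dsd) h𝔡As hblk12 hblkW12 hblkY12 hG0co12 hDsco12 hDvco12 (M12 := M₀) (a12 := aZ) (Bh12 := BhC) hBh12 hδ12₃0X hδ₃₀.le (fun x hM α₀ hα ha U hU hU' => (hG0C x hM α₀ hα (ha.trans haZ0) U hU hU').1.h43R) -- (edition 105) rows 20–21 Dv-letter Φ^X_β ∘ G₀ ∘ ∇_U (the former displayed `hpXDv`): dag-n06-c's BX-handle leg v1.1 keyed on the G₀ layer's Hölder row `h43R` (closed constant `BhC`)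
  obtain ⟨MDw, hMDw1, hMDw2, hMDw3, hMDw4⟩ : ∃ MDw : ℝ, MDv ≤ MDw ∧ MDx ≤ MDw ∧ MDL ≤ MDw ∧ MLR ≤ MDw := ⟨max (max MDv MDx) (max MDL MLR), (le_max_left _ _).trans (le_max_left _ _), (le_max_right _ _).trans (le_max_left _ _), (le_max_left _ _).trans (le_max_right _ _), (le_max_right _ _).trans (le_max_right _ _)⟩; have hBxK : ∀ β : ℝ, 0 ≤ β → β < 1 → 0 ≤ KX * BhC β := fun β h0 h1 => mul_nonneg hKX (hBh12 β h0 h1)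
  obtain ⟨McI, B4I, hMcI, hB4I, hRGI⟩ := rgdI_of_pinsR (N := N) hGR H bI 𝔬12 hblk12 hblkW12 hDvco12 hDvsco12 hRco12 q hq (max (max B13₄ BLv) BL2) (mul_nonneg (Nat.cast_nonneg _) (p.C_nonneg hp _)) hCP hσS (by linarith only [hδTr, hδT12, hαFδq, hσS]) hrT0 hrTP hδ12₃0X hδ₃T (fun x hM α₀ hα ha U hU => h31 x (hM31T.trans (hMM.trans hM)) α₀ hα ((ha.trans haaZ).trans ha31T) U hU) (fun x hM α₀ hα ha U hU => h49 x (hM49T.trans (hMM.trans hM)) α₀ hα ((ha.trans haaZ).trans ha49T) U hU) (fun x hM α₀ hα ha U hU hU' => (hids x hM α₀ hα ha U hU hU').2)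
  obtain ⟨McD, B4D, hMcD, hB4D, hRGD⟩ := rgdDs_rgdDd_of_pinsR (N := N) hGR H bI hβ1 𝔬12 hblk12 hblkY12 hblkW12 hDvco12 hDvsco12 hDsco12 hRco12 (fun x => (𝔡A x).Dsd) h𝔡As 𝔬 𝔡 𝔩 (fun x => (lettersYOfRecordV4P N θ.toStage3Params Mstar 𝔯 x).Gp) hblkS hGpS h𝔡s κ S3 p hp p3 hp3 hst hκ hcnt3 (fun x hM α₀ hα ha U hU => h36_of_dirSq_pinsR (R := (1 : ℝ)) (H := H) 𝔬 𝔡 hblkS hblkYS hDS hDsS h𝔡d h𝔡s (fun x U j => ⟨_, _, hGsqF x U j⟩) h36 x hM α₀ hα ha U hU) (fun x hM α₀ hα ha U hU => (h36H' x hM α₀ hα ha U hU).2.2.1) B4I hCP hσS hδ12₃0X hδ12₃F (by have hrT00 : 0 ≤ rT := (by linarith only [hδTr, hδT12, hσS, hαFδq]); have h1 : (1 - 2 * q.αF) * rT ≤ rT := (by nlinarith only [hq.αF_pos, hrT00]); linarith only [hδ₃T, h1, hrTP]) (fun x hM α₀ hα ha U hU => h49 x (hM49T.trans (hMM.trans hM))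 α₀ hα ((ha.trans haaZ).trans ha49T) U hU) (fun x hM α₀ hα ha U hU hU' => (hids x hM α₀ hα ha U hU hU').2)
  obtain ⟨Mc, B4c, -, hB4c, hcut⟩ := vDRDG_vGDRD_of_pinsR (N := N) hGR H bI 𝔬12 hblk12 hblkW12 hDvco12 hDvsco12 hRco12 q hq hc B4D (mul_nonneg (Nat.cast_nonneg _) (p.C_nonneg hp _)) hCP hσS (by linarith only [hδTr, hδT12, hαFδq, hσS]) hrT0 hrTP hrT4 hδ₃T (fun x hM α₀ hα ha U hU => h31 x (hM31T.trans (hMM.trans hM)) α₀ hα ((ha.trans haaZ).trans ha31T) U hU) (fun x hM α₀ hα ha U hU => h49 x (hM49T.trans (hMM.trans hM)) α₀ hα ((ha.trans haaZ).trans ha49T) U hU) (fun x hM α₀ hα ha U hU => h46 x (max_le (hM12T.trans (hMM.trans hM)) (hM46T.trans (hMM.trans hM))) α₀ hα (le_min ((ha.trans haaZ).trans ha12T) ((ha.trans haaZ).trans ha46T)) U hU) (fun x hM α₀ hα ha U hU hU' => (hids x hM α₀ hα ha U hU hU').2)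
  have hB4Ic : B4I ≤ B4c := hB4D.trans hB4c; have hB4c13 : B13₄ ≤ B4c := ((le_max_left _ _).trans (le_max_left _ _)).trans (hB4I.trans hB4Ic); have hBLvc : BLv ≤ B4c := ((le_max_right _ _).trans (le_max_left _ _)).trans (hB4I.trans hB4Ic); have hBL2c : BL2 ≤ B4c := (le_max_right _ _).trans (hB4I.trans hB4Ic); have km0 : ∀ {B₁ B₂ e : ℝ}, B₁ ≤ B₂ → 0 ≤ e → B₁ * e ≤ B₂ * e := fun h he => mul_le_mul_of_nonneg_right h he; have km : ∀ {B₁ B₂ w e : ℝ}, B₁ ≤ B₂ → 0 ≤ w → 0 ≤ e → B₁ * w * e ≤ B₂ * w * e := fun h hw he => mul_le_mul_of_nonneg_right (mul_le_mul_of_nonneg_right h hw) he; have km2 : ∀ {B₁ B₂ w v e : ℝ}, B₁ ≤ B₂ → 0 ≤ w → 0 ≤ v → 0 ≤ e → B₁ * w * v * e ≤ B₂ * w * v * e := fun h hw hv he => mul_le_mul_of_nonneg_right (mul_le_mul_of_nonneg_right (mul_le_mul_of_nonneg_right h hw) hv) he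
  have hδ12₀0 : 0 ≤ δ12₀ := (by linarith only [hρS, hσS, hρS₀])
  obtain ⟨MD, BiD, hBiD, hdivDs⟩ := hdivDs_of_pinsR (N := N) H bI hβ1 𝔭A (fun x => (𝔡A x).Dd) (fun x => (𝔡A x).Dsd) h𝔡Ad bHXA hbHXA 𝔬12 hblk12 hblkW12 hDvsco12 hBi12 hδ12₀0 hY335 (fun x hM α₀ hα ha U hU hU' => (hG0C x hM α₀ hα ha U hU hU').1)
  have hδ12₃0 : 0 ≤ δ12₃ := (by linarith only [hρ₃12, hρ12, hσ12])
  obtain ⟨Md, Bd, Bqd, hM0d, hBd, hBqd, hGQ⟩ := g0qstar_letters_of_pins θ.toStage3Params Mstar hGR bI hβ1 H 𝔬12 𝔭A (fun x => (𝔡A x).Dd) hblk12 hblkZ12 hQsco12 (M12 := M₀) (a12 := aZ) hB12₀ hBh12 hσ12 hδ12₃0 hδ₃₀.le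
    (fun x hM α₀ hα ha U hU hU' => (hG0C x hM α₀ hα (ha.trans haZ0) U hU hU').1.e1d) (fun x hM α₀ hα ha U hU hU' => (hG0C x hM α₀ hα (ha.trans haZ0) U hU hU').1.h43d)
  obtain ⟨Mz, Bz, Bxz, hM0z, hBz, hBxz, hGT⟩ := g0qstar_transfer_letters_of_pins θ.toStage3Params Mstar hGR bI hlev hβ1 H 𝔬12 𝔭A (fun x => parBY x.toKIdx) (fun _ => rfl) h𝔭A (fun x => (𝔡A x).Dd) h𝔡Ad hblk12 hblkZ12 hQsco12 (M12 := M₀) (a12 := aZ) hB12₀ hδ12₃0 hδ₃₀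
    (fun x hM α₀ hα ha U hU hU' => (hmodel12 x hM α₀ hα (ha.trans haZ0) U hU hU').1.e0) (fun x hM α₀ hα ha U hU hU' => (hG0C x hM α₀ hα (ha.trans haZ0) U hU hU').1.e1d)
  have hBxM : ∀ β : ℝ, 0 ≤ β → β < 1 → 0 ≤ max (max (Bx13 β) Bxz) (KX * BhC β) := fun β h0 h1 => ((hBx13 β h0 h1).trans (le_max_left _ _)).trans (le_max_left _ _)
  have hBx0M : 0 ≤ max (max Bx13₀ Bxz) (KX * BHG) := (hBx13₀.trans (le_max_left _ _)).trans (le_max_left _ _)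
  have hwBxM : ∀ s : ℝ, 0 < s → s < 1 → wX s * max (max (Bx13 s) Bxz) (KX * BhC s) ≤ max (max Bx13₀ Bxz) (KX * BHG) := fun s h0 h1 => by
    rw [mul_max_of_nonneg _ _ (hwX₀ s), mul_max_of_nonneg _ _ (hwX₀ s)]
    exact max_le_max (max_le_max (hwBx13 s h0 h1) (mul_le_of_le_one_left hBxz (hwX₁ s))) (by rw [mul_left_comm]; exact mul_le_mul_of_nonneg_left (hwBhG s h0 h1) hKX)
  obtain ⟨MQ, BQ, hBQ, hLHHQ, hDMQ⟩ := hLHH_of_pinsRU (N := N) H bI hβ1 𝔭A (fun x => (𝔡A x).Dd) (fun x => (𝔡A x).Dsd) bHXA 𝔬12 hblk12 hblkZ12 hQsco12 bH13 Bqd hBqd (hB12₃.trans (le_max_left B12₃ Bd)) hBh12 hδ12₃0 hδ₃₀.le hY335 (fun x hM α₀ hα ha U hU hU' => (hG0C x hM α₀ hα ha U hU hU').1)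
  have htJ0 : 0 ≤ tJ := le_trans (by positivity) htJ; have hM12g : M12 ≤ M₀ := hM12T.trans hMM; have haa12 : aZ ≤ a12 := haaZ.trans ha12T; have hM43g : max M12 M43 ≤ M₀ := max_le hM12g (hM43T.trans hMM); have haa43 : aZ ≤ min a12 a43 := le_min haa12 (haaZ.trans ha43T); have hM44g : max M12 M44 ≤ M₀ := max_le hM12g (hM44T.trans hMM); have haa44 : aZ ≤ min a12 a44 := le_min haa12 (haaZ.trans ha44T); have haaG : aZ ≤ min a12 aG0 := le_min haa12 (haaZ.trans haGT); have haGT2 : a12T ≤ min a12 aG0 := le_min ha12T haGT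
  obtain ⟨MTS, θS, θD12, A₀S, AWS, AQS, ADS, AQ1S, CRS, θH12, AIS, AVS, hθS, hθD12, hθH12, hA₀S, hAWS, hAQS, hADS, hAQ1S, hCRS, hAIS, hAVS, hST⟩ :=
    hStateTuplesW_of_pinsP_geo9Y (N := N) (H := H) (bI := bI) (hlev := hlev) (hβ1 := hβ1) (hbI0 := hbI0) (hGR := hGR) (c := c) (M₀ := max M₀ (max Mz MDw)) (a₀ := aZ) (hM₀ := hM₀g.le.trans (le_max_left M₀ (max Mz MDw))) (hσ := hσS) (hτ := hτS)
      (w13 := w13) (hw13₀ := hw13₀) (hw13₁ := hw13₁) (wX := wX) (hwX₀ := hwX₀) (hwX₁ := hwX₁) (hs440 := hs440) (hs441 := hs441) (hw1344 := hws44) (hwX44 := hwX44) (bH13 := bH13) (hbH13 := hbH13) (hκ13 := hκ13) (bXH := bXH) (hbXH := hbXH) (bHXA := bHXA) (hbHXA := hbHXA) (bW := fun x U => bHXT x U) (CW := (Real.exp (1 * (rNear θ.d₆ θ.ℓ₆ + 1)) * max c₁R 0 * Real.exp ((δ12₃ - τS) * (rNear θ.d₆ θ.ℓ₆ + 1))))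 (hCW := by positivity) (htransW := fun x hMz U ε hε K hK h => by letI : Fintype (B9GeoNormsKLevelV1.geo9K x.toKIdx).Site := (inferInstance : Fintype (geo9Y x).Site); rw [hbHXT x U]; exact (hasMaj_bHZPIfam_of_supBlocks x.toKIdx (trBasis N) (hβ1 x) (B9SmoothHolderClassTClosure.abs_cf_eq_nKT x.toKIdx x.hcfk) (taxiS x.toKIdx (𝔅 x) (fun U => U) U) ε (fun y => (hrowR x (hMDw4.trans (((le_max_right Mz MDw).trans (le_max_right M₀ (max Mz MDw))).trans hMz)) y).trans (le_max_left c₁R 0)) zero_le_one hK (by linarith only [hU8k, hρP12, hρ12, hσ12, hσS, hτS]) h).mono fun a a' => le_of_eq rfl) (𝔬12 := 𝔬12) (hblk12 := hblk12) (hblkW12 := hblkW12) (Δ2 := fun x => (𝔯 x).Δ2) (hTpico12 := hTpico12) (hT2co12 := hT2co12) (hDvco12 := hDvco12) (hDvsco12 := hDvsco12) (𝔭A := 𝔭A) (hparB := fun _ => rfl) (h𝔭A := h𝔭A) (Dd := fun x => (𝔡A x).Dd) (Dsd := fun x => (𝔡A x).Dsd) (hDd := h𝔡Ad) (Gp :=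 fun x => GpY x.toKIdx (parSymY x.toKIdx)) (hGp := fun _ => rfl) (parS := fun x => parSymY x.toKIdx) (hparS := fun _ => rfl)
      (hB₀ := mul_nonneg (Nat.cast_nonneg _) (p.C_nonneg hp _)) (hCP := hCP) (htJ := htJ0) (hB43 := hB43) (htA := ht12T) (hθ₂ := hθ₂) (hB44 := hB44G) (B12₃ := max B12₃ (max Bz BZv)) (Bx13 := fun β => max (max (Bx13 β) Bxz) (KX * BhC β)) (hB12₃ := hB12₃.trans (le_max_left B12₃ (max Bz BZv))) (hBx13 := hBxM) (hBx13₀ := hBx0M) (hwBx13 := hwBxM) (hB12₀ := hB12₀) (hBh12 := hBh12) (hBi := hBi12) (B₀G := B12₀) (δ₀G := δ12₀) (hB₀G := hB12₀) (hBhG := fun s hs0 hs1 => hBh12 s hs0.le hs1) (hBHG := hBHG) (hwBhG := hwBhG) (hBd := hBdT) (hB₃ := hB12₃) (hBhD := hBhD13) (hBdX := hBdX) (hδK := by linarith) (hr0 := hU8a) (hr49 := hU8b) (hr2 := hU8c) (hr44 := hU8d) (hrB := hU8e) (hr43 := hU8f) (hrT := hU8g) (hK3d := hU8h) (hKP :=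 hU8i) (hP0 := hU8j) (hP3 := hU8k) (hPG := by linarith only [hU8j, hτS]) (h31 := fun x hMz α₀ hα ha U hU => have hM := (le_max_left M₀ (max Mz MDw)).trans hMz; h31 x (hM31T.trans (hMM.trans hM)) α₀ hα ((ha.trans haaZ).trans ha31T) U hU)
      (h49 := fun x hMz α₀ hα ha U hU => have hM := (le_max_left M₀ (max Mz MDw)).trans hMz; h49 x (hM49T.trans (hMM.trans hM)) α₀ hα ((ha.trans haaZ).trans ha49T) U hU) (h43 := (fun x hMz α₀ hα ha => have hM := (le_max_left M₀ (max Mz MDw)).trans hMz; h43Gp x (hM43g.trans hM) α₀ hα (ha.trans haa43))) (h44G := (fun x hMz α₀ hα ha => have hM := (le_max_left M₀ (max Mz MDw)).trans hMz; h44G x (hM44g.trans hM) α₀ hα (ha.trans haa44))) (hD2 := (fun x hMz α₀ hα ha => have hM := (le_max_left M₀ (max Mz MDw)).trans hMz; hD2sup x (hM12g.trans hM) α₀ hα (ha.trans haa12))) (hta := (fun x hMz α₀ hα ha => have hM := (le_max_left M₀ (max Mz MDw)).trans hMz; hta x (hMM.trans hM) α₀ hα (ha.trans haaZ))) (hBJ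 := (fun x hMz α₀ hα ha => have hM := (le_max_left M₀ (max Mz MDw)).trans hMz; hBJ x (hM12g.trans hM) α₀ hα (ha.trans haa12))) (hZ81 := fun x hMz α₀ hα ha U hU hU' => ((hDV x (hMDw1.trans (((le_max_right Mz MDw).trans (le_max_right M₀ (max Mz MDw))).trans hMz)) α₀ hα ha U hU hU').1).mono (kernel_mono (hgeoOK x) hBZv ((le_max_right Bz BZv).trans (le_max_right B12₃ (max Bz BZv))) le_rfl)) (hpXDv := (fun x hMz α₀ hα ha U hU hU' β h0 h1 => (hPX x (hMDw2.trans (((le_max_right Mz MDw).trans (le_max_right M₀ (max Mz MDw))).trans hMz)) α₀ hα ha U hU hU' β h0 h1).mono (kernel_mono (hgeoOK x) (hBxK β h0 h1) (le_max_right (max (Bx13 β) Bxz) (KX * BhC β)) le_rfl))) (he0 := fun x hMz α₀ hα ha U hU hU' => have hM := (le_max_left M₀ (max Mz MDw)).trans hMz; (hmodel12 x hM α₀ hα (ha.trans haZ0) U hU hU').1.e0) (he1d := fun x hMz α₀ hα ha U hU hU' => have hM := (le_max_left M₀ (max Mz MDw)).trans hMz; (hG0C x hM α₀ hα (ha.trans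 haZ0) U hU hU').1.e1d) (he2 := fun x hMz α₀ hα ha U hU hU' => have hM := (le_max_left M₀ (max Mz MDw)).trans hMz; (hmodel12 x hM α₀ hα (ha.trans haZ0) U hU hU').1.e2) (h43RG := fun x hMz α₀ hα ha U hU hU' s' hs0 hs1 => have hM := (le_max_left M₀ (max Mz MDw)).trans hMz; (hG0C x hM α₀ hα (ha.trans haZ0) U hU hU').1.h43R s' hs0.le hs1)
      (hgQs1 := fun x hMz α₀ hα ha U hU hU' => ((hGT x (((le_max_left Mz MDw).trans (le_max_right M₀ (max Mz MDw))).trans hMz) α₀ hα ha U hU hU').1).mono (kernel_mono (hgeoOK x) hBz ((le_max_left Bz BZv).trans (le_max_right B12₃ (max Bz BZv))) le_rfl)) (hpXQs := (fun x hMz α₀ hα ha U hU hU' β h0 h1 => ((hGT x (((le_max_left Mz MDw).trans (le_max_right M₀ (max Mz MDw))).trans hMz) α₀ hα ha U hU hU').2 β h0 h1).mono (kernel_mono (hgeoOK x) hBxz ((le_max_right (Bx13 β) Bxz).trans (le_max_left (max (Bx13 β) Bxz) (KX * BhC β))) le_rfl))) (hDirR := fun x hMz α₀ hα ha U hU hU'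 => have hM := (le_max_left M₀ (max Mz MDw)).trans hMz; (hG0C x hM α₀ hα (ha.trans haZ0) U hU hU').2.1) (hDir := fun x hMz α₀ hα ha U hU hU' => have hM := (le_max_left M₀ (max Mz MDw)).trans hMz; (hG0C x hM α₀ hα (ha.trans haZ0) U hU hU').1.h44m) (hdgDvd := fun x hMz α₀ hα ha U hU hU' ν ε hε => (hLEG x (hMDw3.trans (((le_max_right Mz MDw).trans (le_max_right M₀ (max Mz MDw))).trans hMz)) α₀ hα (ha.trans haZT) U hU hU').1 ν ε hε) (he1 := fun x hMz α₀ hα ha => have hM := (le_max_left M₀ (max Mz MDw)).trans hMz; he1G x hM α₀ hα (ha.trans haZ0)) (h43L := fun x hMz α₀ hα ha U hU hU' => have hM := (le_max_left M₀ (max Mz MDw)).trans hMz; (hG0C x hM α₀ hα (ha.trans haZ0) U hU hU').1.h43L) (h43d := fun x hMz α₀ hα ha U hU hU' => have hM := (le_max_left M₀ (max Mz MDw)).trans hMz; (hG0C x hM α₀ hα (ha.trans haZ0) U hU hU').1.h43d)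
      (hdgDH := fun x hMz α₀ hα ha U hU hU' => have hM := (le_max_left M₀ (max Mz MDw)).trans hMz; (hDg x (hMDgT.trans (hMM.trans hM)) α₀ hα (ha.trans haaG) U hU hU').2) (hdgDHd := fun x hMz α₀ hα ha U hU hU' => have hM := (le_max_left M₀ (max Mz MDw)).trans hMz; (hDg x (hMDgT.trans (hMM.trans hM)) α₀ hα (ha.trans haaG) U hU hU').1) (hYd := fun x hMz α₀ hα ha => have hM := (le_max_left M₀ (max Mz MDw)).trans hMz; hYd x (hMYT.trans (hMM.trans hM)) α₀ hα (ha.trans haaG)) (hXd := fun x hMz α₀ hα ha => have hM := (le_max_left M₀ (max Mz MDw)).trans hMz; hXd x (hMXT.trans (hMM.trans hM)) α₀ hα (ha.trans haaG))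
  obtain ⟨B12F, hBF1, hBF2, hBF3, hBF4, hBF5, hBF6, hBF7⟩ : ∃ B12F : ℝ, B12₃ ≤ B12F ∧ 2 * ADS ≤ B12F ∧ CA3 ≤ B12F ∧ (((θ.ℓ₆ + 1 : ℕ) : ℝ)) ^ 2 * Real.exp (2 * δ12₃ * ((θ.ℓ₆ : ℝ) + 4)) ≤ B12F ∧ Bd ≤ B12F ∧ Bz ≤ B12F ∧ BZv ≤ B12F :=
    ⟨max (max (max (max (max B12₃ (2 * ADS)) (max CA3 ((((θ.ℓ₆ + 1 : ℕ) : ℝ)) ^ 2 * Real.exp (2 * δ12₃ * ((θ.ℓ₆ : ℝ) + 4))))) Bd) Bz) BZv, ((((le_max_left _ _).trans (le_max_left _ _)).trans (le_max_left _ _)).trans (le_max_left _ _)).trans (le_max_left _ _), ((((le_max_right _ _).trans (le_max_left _ _)).trans (le_max_left _ _)).trans (le_max_left _ _)).trans (le_max_left _ _), ((((le_max_left _ _).trans (le_max_right _ _)).trans (le_max_left _ _)).trans (le_max_left _ _)).trans (le_max_left _ _), ((((le_max_right _ _).trans (le_max_right _ _)).trans (le_max_left _ _)).trans (le_max_left _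 _)).trans (le_max_left _ _), ((le_max_right _ _).trans (le_max_left _ _)).trans (le_max_left _ _), (le_max_right _ _).trans (le_max_left _ _), le_max_right _ _⟩
  have hq12c : 0 < δ12₃ * (2 * ((θ.ℓ₆ : ℝ) + 1) ^ 2 - 1) := mul_pos (by linarith only [hρ₃12, hρ12, hσ12]) (by nlinarith only [Nat.cast_nonneg (α := ℝ) θ.ℓ₆]); set M₀' : ℝ := max (max (max (max M₀ (max (max MD MQ) Mc)) MTS) (max (max (max Mr2 Md) Mz) (2 * Real.log (((θ.ℓ₆ + 1 : ℕ) : ℝ)) / (δ12₃ * (2 * ((θ.ℓ₆ : ℝ) + 1) ^ 2 - 1))))) (max (max (max MDv (max MDx MDL)) ML2) (max McI (max McD MR13))) with hM₀'def; have hM0le : M₀ ≤ M₀' := (((le_max_left _ _).trans (le_max_left _ _)).trans (le_max_left _ _)).trans (le_max_left _ _); have hMQD : max (max MD MQ) Mc ≤ M₀' := (((le_max_right _ _).trans (le_max_left _ _)).trans (le_max_left _ _)).trans (le_max_left _ _); have hMTS : MTS ≤ M₀' := ((le_max_right _ _).trans (le_max_left _ _)).trans (le_max_left _ _); have hMr2'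 : Mr2 ≤ M₀' := ((((le_max_left _ _).trans (le_max_left _ _)).trans (le_max_left _ _)).trans (le_max_right _ _)).trans (le_max_left _ _); have hMd' : Md ≤ M₀' := ((((le_max_right _ _).trans (le_max_left _ _)).trans (le_max_left _ _)).trans (le_max_right _ _)).trans (le_max_left _ _); have hMz' : Mz ≤ M₀' := (((le_max_right _ _).trans (le_max_left _ _)).trans (le_max_right _ _)).trans (le_max_left _ _); have hMq' : 2 * Real.log (((θ.ℓ₆ + 1 : ℕ) : ℝ)) / (δ12₃ * (2 * ((θ.ℓ₆ : ℝ) + 1) ^ 2 - 1)) ≤ M₀' := ((le_max_right _ _).trans (le_max_right _ _)).trans (le_max_left _ _); have hMDv' : MDv ≤ M₀' := (((le_max_left _ _).trans (le_max_left _ _)).trans (le_max_left _ _)).trans (le_max_right _ _); have hMDx' : MDx ≤ M₀' := ((((le_max_left MDx MDL).trans (le_max_right _ _)).trans (le_max_left _ _)).trans (le_max_left _ _)).trans (le_max_right _ _); have hMDL' : MDL ≤ M₀' := ((((le_max_right MDx MDL).trans (le_max_right _ _)).trans (le_max_left _ _)).trans (le_max_left _ _)).trans (le_max_right _ _); have hML2'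 : ML2 ≤ M₀' := ((le_max_right _ _).trans (le_max_left _ _)).trans (le_max_right _ _); have hMcI' : McI ≤ M₀' := ((le_max_left _ _).trans (le_max_right _ _)).trans (le_max_right _ _); have hMcD' : McD ≤ M₀' := (((le_max_left _ _).trans (le_max_right _ _)).trans (le_max_right _ _)).trans (le_max_right _ _); have hMR13' : MR13 ≤ M₀' := (((le_max_right _ _).trans (le_max_right _ _)).trans (le_max_right _ _)).trans (le_max_right _ _)
  have hLH3 : ∀ x : MemberY θ.d₆ θ.ℓ₆ θ.hd' θ.hL' θ.b₀ θ.b₁ Mstar, M₀' ≤ (geo9Y x).M → ∀ α₀ : ℝ, 0 < α₀ → (geo9Y x).M * α₀ ≤ aZ → ∀ U : (𝔅 x).Cfg, (𝔅 x).Reg335 c α₀ U → (𝔅 x).Reg336 c α₀ U → Letters313HZ (𝔬12 x) (𝔭A x) 1 (H x) ⟨geo9Y_dist_triangle x, geo9Y_dist_comm x, geo9K_dist_nonneg x.toKIdx, geo9Y_len_pos x⟩ (fun y => ((((θ.ℓ₆ + 1 : ℕ) : ℝ) ^ (θ.d₆ + 1)) ^ lvl x.hN x.D x.hk y)⁻¹)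 (fun y => plateau_pos x.toKIdx y) (bH13 x U) BhD13 (fun β => max (max (Bx13 β) Bxz) (KX * BhC β)) δ12₃ U := fun x hM α₀ hα ha U hU hU' =>
    ⟨fun β h0 h1 => hYd x (hMYT.trans ((hMM.trans hM0le).trans hM)) α₀ hα ((ha.trans haaZ).trans haGT2) U hU hU' β h0 h1, fun β h0 h1 => (hPX x (hMDx'.trans hM) α₀ hα ha U hU hU' β h0 h1).mono (kernel_mono (hgeoOK x) (hBxK β h0 h1) (le_max_right (max (Bx13 β) Bxz) (KX * BhC β)) le_rfl), fun β h0 h1 => ((hGT x (hMz'.trans hM) α₀ hα ha U hU hU').2 β h0 h1).mono (kernel_mono (hgeoOK x) hBxz ((le_max_right (Bx13 β) Bxz).trans (le_max_left (max (Bx13 β) Bxz) (KX * BhC β))) le_rfl)⟩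
  have hDMZ : ∀ x : MemberY θ.d₆ θ.ℓ₆ θ.hd' θ.hL' θ.b₀ θ.b₁ Mstar, M₀' ≤ (geo9Y x).M → ∀ α₀ : ℝ, 0 < α₀ → (geo9Y x).M * α₀ ≤ aZ → ∀ U : (𝔅 x).Cfg, (𝔅 x).Reg335 c α₀ U → (𝔅 x).Reg336 c α₀ U → Letters313DMZ (𝔬12 x) (𝔭A x) (𝔡A x).Dd 1 (H x) ⟨geo9Y_dist_triangle x, geo9Y_dist_comm x, geo9K_dist_nonneg x.toKIdx, geo9Y_len_pos x⟩ (fun y => ((((θ.ℓ₆ + 1 : ℕ) : ℝ) ^ (θ.d₆ + 1)) ^ lvl x.hN x.D x.hk y)⁻¹) (fun y => plateau_pos x.toKIdx y) (max B12₃ Bd) Bqd δ12₃ (bH13 x U) U := fun x hM α₀ hα ha U hU hU' =>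
    ⟨fun ν => ((hGQ x (hMd'.trans hM) α₀ hα ha U hU hU').1 ν).mono (kernel_mono (hgeoOK x) hBd (le_max_right B12₃ Bd) le_rfl), fun ν => ((hDg x ((hMDgT.trans (hMM.trans hM0le)).trans hM) α₀ hα ((ha.trans haaZ).trans haGT2) U hU hU').1 ν).mono (kernel_mono (hgeoOK x) hB12₃ (le_max_left B12₃ Bd) le_rfl), fun ν β h0 h1 => (hGQ x (hMd'.trans hM) α₀ hα ha U hU hU').2 ν β h0 h1⟩
  have hMcle : Mc ≤ M₀' := (le_max_right _ Mc).trans hMQD; have hMQle : MQ ≤ M₀' := (le_max_right MD MQ).trans ((le_max_left _ Mc).trans hMQD); have hMM' : M12 ≤ M₀' := hM12T.trans (hMM.trans hM0le); have hwGp13 := fun (x : MemberY θ.d₆ θ.ℓ₆ θ.hd' θ.hL' θ.b₀ θ.b₁ Mstar) (hM : M₀' ≤ (geo9Y x).M) (α₀ : ℝ) (hα : 0 < α₀) (ha : (geo9Y x).M * α₀ ≤ aZ) (U : (𝔅 x).Cfg) (hU : (𝔅 x).Reg335 c α₀ U) (hU' : (𝔅 x).Reg336 c α₀ U) =>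
    (h13 x ((hM13T.trans (hMM.trans hM0le)).trans hM) α₀ hα (ha.trans (le_min (le_min (le_min (haaZ.trans ha12T) (haaZ.trans ha44T)) (haaZ.trans ha43T)) (le_min (haaZ.trans ha31T) (haaZ.trans ha49T)))) U hU hU').mono (kernel_mono (hgeoOK x) hB12₃ hBF1 le_rfl); have hrgdH := fun (x : MemberY θ.d₆ θ.ℓ₆ θ.hd' θ.hL' θ.b₀ θ.b₁ Mstar) (hM : M₀' ≤ (geo9Y x).M) (α₀ : ℝ) (hα : 0 < α₀) (ha : (geo9Y x).M * α₀ ≤ aZ) (U : (𝔅 x).Cfg) (hU : (𝔅 x).Reg335 c α₀ U) (hU' : (𝔅 x).Reg336 c α₀ U) =>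
    hrg x ((hMrgT.trans (hMM.trans hM0le)).trans hM) α₀ hα (ha.trans (le_min (le_min (haaZ.trans ha12T) (haaZ.trans ha43T)) (le_min (haaZ.trans ha31T) (haaZ.trans ha49T)))) U hU hU' (hids x (hM0le.trans hM) α₀ hα ha U hU hU').2
  have s3132 := s3132Nu_opsYSectE_of_stepS_R_of_refinesY (θ := θ.toStage3Params) (Mstar := Mstar) (R₁ := R₁) (R₂ := R₂) (hG := hGR) (c' := c) (hY := fun x α₀ U h h' => ⟨regY335_of_regYP335 x c35Y_le_ten (hRP1 x α₀ U h).1 (hRP1 x α₀ U h).2 hL3c, regY336_of_regYP336 x c35Y_le_ten (hRP2 x α₀ U h').1 (hRP2 x α₀ U h').2 hL4c⟩) (bK := trBasis N) (𝔬 := 𝔬12) (H₀ := H) (T := fun x => (lettersYOfRecordV4P N θ.toStage3Params Mstar 𝔯 x).GD) (T₁ := fun x => (lettersYOfRecordV4P N θ.toStage3Params Mstar 𝔯 x).G₁)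
    (T₀ := fun x => (lettersYOfRecordV4P N θ.toStage3Params Mstar 𝔯 x).GA) (hT₀ := fun _ _ => rfl) (hblk := hblk12) (hGco := hGco12) (hG1co := hG1co12) (hG0co := hG0co12) (hlev := hlev) (hβ1 := hβ1) (hnbr := B9GeoNbrCountKLevelV1.hnbr_of_le hM₀') 
    (hgeo := hgeoOK) (𝔖 := (fun x U => weightNorm (bXH x U) (rwt (geo9Y x) (-1)) (rwt_nonneg (fun y => (geo9Y_len_pos x y).le) (-1)))) (θS := θS) (A₀ := A₀S) (CR := CRS) (κS := κ13) (δK := δK12) (δP := δP) (σ := σ12) (δ := ρ12) (a₁ := aZ) (M₁ := M₀') (hθS := hθS) (hA₀ := hA₀S) (hCR := hCRS)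
    (hκS := by show (0 : ℝ) ≤ 1 + CLip θ.d₆ θ.ℓ₆; linarith [CLip_nonneg θ.d₆ θ.ℓ₆]) (hσ := hσ12) (hδ := hρ12) (hδK := hρδ12) (hδP := by linarith) (ha₁ := haZg) (hM₁ := lt_of_lt_of_le hM₀g hM0le)
    (hstate := fun x hM α₀ hα ha U hU hU' => ⟨((hST x (hMTS.trans hM) α₀ hα ha U hU hU').1).1, ((hST x (hMTS.trans hM) α₀ hα ha U hU hU').1).2.2.2.1, ((hST x (hMTS.trans hM) α₀ hα ha U hU hU').1).2.2.2.2.2.1,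
      ((hST x (hMTS.trans hM) α₀ hα ha U hU hU').1).2.2.2.2.2.2.1, ((hST x (hMTS.trans hM) α₀ hα ha U hU hU').1).2.2.2.2.2.2.2, (hmodel12 x (hM0le.trans hM) α₀ hα (ha.trans haZ0) U hU hU').2.2⟩) (a311 := q.a₁ / c) (M311 := MR) (ha311 := hac) (hM311 := hMR)
    (hΔA := hΔA) (𝔏 := lettersYOfRecordV4P N θ.toStage3Params Mstar 𝔯) (𝔈 := 𝔈) (𝔢 := sectEYOfRecordV6 N θ.toStage3Params Mstar 𝔢₀) (𝔴 := 𝔴) (hQ := fun _ => rfl) (hQ₁ := fun _ => rfl)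
  obtain ⟨t312, t313⟩ := t312_t313_of_pins_stateSUCLE (N := N)
    (θ := θ.toStage3Params) (Mstar := Mstar) (hGR := hGR) (c := c) (𝔯 := 𝔯) (𝔢 := (sectEYOfRecordV6 N θ.toStage3Params Mstar 𝔢₀)) (𝔴 := 𝔴) (𝔈 := 𝔈) (bI := bI) (hβI := hβI) (hlev := hlev) (hβ1 := hβ1) (hM₀ := hM₀) (𝔭A := 𝔭A) (Dd := (fun x => (𝔡A x).Dd)) (Dds := (fun x => (𝔡A x).Dsd)) (hDd := h𝔡Ad) (hDds := h𝔡As) (𝔬12 := 𝔬12) (H12 := H) (bH13 := bH13) (θD12 := θD12) (r12 := r12) (B12₀ := B12₀) (δ12₀ := δ12₀) (δK12 := δK12) (σ12 := σ12) (ρ12 := ρ12) (a12 := aZ) (M12 := M₀') (B12₃ := B12F) (δ12₃ := δ12₃) (ρ13 := ρ13) (α12 := α12) (κ13 := (max κ13 1)) (hθD12 := hθD12) (hr12 := hr12) (θ2₁₂ := θ2S) (B12₂ := B12₂) (ρf12 := ρf12) (θH12 := θH12) (Bh12 := BhC) (Bi12 := Bi12) (Bq12 := BQ)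
      (Bi2₁₂ := Bi2₁₂) (hθH12 := hθH12) (hθ2₁₂ := hθ2S) (hB12₂ := hB12₂) (hρf12 := hρf12) (hρf1 := hρf1) (hρf2 := hρf2) (hBh12 := hBh12) (hBi12 := hBi12) (hBi2₁₂ := hBi2₁₂) (hBq12 := hBQ) (bHX12 := bHXA) (hB12₀ := hB12₀) (hB12₃ := hB12₃.trans hBF1) (hσ12 := hσ12) (hρ12 := hρ12) (hρS12 := hρS12) (hρδ12 := hρδ12) (hρ₃12 := hρ₃12) (ha12 := haZg) (hM12 := (lt_of_lt_of_le hM₀g hM0le)) (hα12 := hα12) (hα12' := hα12') (hκ13 := (fun x U => (hκ13 x U).trans (le_max_left κ13 1))) (hρ13 := hρ13) (hρ13ρ := hρ13ρ) (hσρ13 := hσρ13) (B13₄ := B4c) (Br13 := BrR) (BhD13 := BhD13) (Bx13 := fun β => max (max (Bx13 β) Bxz) (KX * BhC β)) (Bd13 := BdT) (Bd2₁₃ := Bd2T) (hB13₄ := (hB13₄.trans hB4c13)) (hBr13 := hBrR)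
      (hBhD13 := hBhD13) (hBx13 := hBxM) (hBd13 := fun ε hε _ => hBdT ε hε) (hBd2₁₃ := fun ε β hε _ h0 h1 => hBd2T ε β hε h0 h1) (bHW13 := (fun x U => bHXT x U)) (hκW13 := (fun x U ε => by letI : Fintype (B9GeoNormsKLevelV1.geo9K x.toKIdx).Site := (inferInstance : Fintype (geo9Y x).Site); rw [hbHXT x U]; exact (bHZPIfam_κ x.toKIdx (trBasis N) (taxiS x.toKIdx (𝔅 x) (fun U => U) U) ε).le.trans (le_max_left κ13 1))) (Gp := (fun (x : MemberY θ.d₆ θ.ℓ₆ θ.hd' θ.hL' θ.b₀ θ.b₁ Mstar) (U : (𝔅 x).Cfg) => GcoS x.toKIdx (trBasis N) (𝔅 x) (fun U => U) (GpY x.toKIdx (parSymY x.toKIdx)) U)) (bXH := bXH) (hκX := (fun x U => (hκX x U).trans (le_max_left κ13 1))) (hmodel12 := (fun x hM α₀ hα ha U hU hU' => (hmodel12 x (hM0le.trans hM) α₀ hα (ha.trans haZ0) U hU hU').2))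
      (hpinE := hpinE) (hpinH := hpinH) (hpinK := hpinK) (hblk12 := hblk12) (hblkY12 := hblkY12) (hGco12 := hGco12) (hG1co12 := hG1co12) (hGGco12 := hGGco12) (hDco12 := hDco12) (hDsco12 := hDsco12) (hblkZ12 := hblkZ12) (hHm12 := hHm12) (hH1m12 := hH1m12) (hH1N := hH1N) (hIF := hIF) (hHCN := hHCN) (hsymD := hsymD) (hG0C := (fun x hM α₀ hα ha => hG0C x (hM0le.trans hM) α₀ hα (ha.trans haZ0))) (hStL := (fun x hM α₀ hα ha => hstepL2 x ((hMM.trans hM0le).trans hM) α₀ hα (ha.trans haaZ))) (hLHH := (fun x hM α₀ hα ha => hLHHQ x (hMQle.trans hM) α₀ hα (ha.trans haZ0)))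
      (hLH3 := (fun x hM α₀ hα ha U hU hU' => Letters313HZc.of_HZ (hLH3 x hM α₀ hα ha U hU hU') (fun β h0 h1 => (hWE x ((hMM.trans hM0le).trans hM) α₀ hα (ha.trans (le_min (le_min (le_min haa12 (haaZ.trans haWT)) (haaZ.trans ha44T)) (haaZ.trans ha49T))) U hU hU' β h0 h1).mono (kernel_mono (hgeoOK x) (hBx13 β h0 h1) ((le_max_left (Bx13 β) Bxz).trans (le_max_left (max (Bx13 β) Bxz) (KX * BhC β))) le_rfl)))) (hΔ2 := hΔ2)
      (hLL2 := (fun x hM α₀ hα ha U hU hU' => by obtain ⟨hgQs, hdGQs, hddGQs, hdGQsd, hq⟩ := hLQ x (hML2'.trans hM) α₀ hα ha U hU hU'; have hdv := hDV x (hMDv'.trans hM) α₀ hα ha U hU hU'; have hri := hRGI x (hMcI'.trans hM) α₀ hα ha U hU hU'; have hrd := hRGD x (hMcD'.trans hM) α₀ hα ha (hcaP (ha.trans (haaZ.trans haPT))) U hU hU'; have hl : ∀ y : (geo9Y x).Site, 0 ≤ (geo9Y x).len y := (hgeoOK x).lenle; have hv : ∀ y : (geo9Y x).Site, 0 ≤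 Real.sqrt ((((θ.ℓ₆ + 1 : ℕ) : ℝ) ^ (θ.d₆ + 1)) ^ lvl x.hN x.D x.hk y)⁻¹ := fun y => Real.sqrt_nonneg _; exact ⟨letters313L2Pc_of_fields (hgeoOK x) (hB13₄.trans hB4c13) (hdv.2.2.1.mono (fun y y' => km hBLvc (hl y) (Real.exp_nonneg _))) (hdv.2.2.2.1.mono (fun y y' => km0 hBLvc (Real.exp_nonneg _))) (hgQs.mono (fun y y' => km2 hBL2c (hl y) (mul_nonneg (hv y') (hl y')) (Real.exp_nonneg _))) (fun q' => (hddGQs q').mono (fun y y' => km hBL2c (mul_nonneg (inv_nonneg.2 (hl y)) (mul_nonneg (hv y') (hl y'))) (Real.exp_nonneg _))) (hdGQs.mono (fun y y' => km hBL2c (mul_nonneg (hv y') (hl y')) (Real.exp_nonneg _))) (hri.mono (fun y y' => km hB4Ic (hl y') (Real.exp_nonneg _))) (hrd.1.mono (fun y y' => km0 hB4c (Real.exp_nonneg _))) (hq.mono (fun y y' => km hBL2c (mul_nonneg (mul_nonneg (hv y) (hl y)) (inv_nonneg.2 (hl y'))) (Real.exp_nonneg _))) ((hcut x (hMcle.trans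 hM) α₀ hα ha U hU hU').1) ((hcut x (hMcle.trans hM) α₀ hα ha U hU hU').2), ⟨fun ν => (hdv.2.2.2.2 ν).mono (fun y y' => km0 hBLvc (Real.exp_nonneg _)), fun ν => (hdGQsd ν).mono (fun y y' => km hBL2c (mul_nonneg (hv y') (hl y')) (Real.exp_nonneg _)), fun μ => (hrd.2 μ).mono (fun y y' => km0 hB4c (Real.exp_nonneg _))⟩⟩)) (hrgdd13 := (fun x hM α₀ hα ha => hRG13 x (hMR13'.trans hM) α₀ hα (ha.trans haZR))) (hdgDvd13 := (fun x hM α₀ hα ha U hU hU' ν ε hε _ => (hLEG x (hMDL'.trans hM) α₀ hα (ha.trans haZT) U hU hU').1 ν ε hε)) (hpdgDvd13 := (fun x hM α₀ hα ha U hU hU' ν ε β' hε _ h0 h1 => (hLEG x (hMDL'.trans hM) α₀ hα (ha.trans haZT) U hU hU').2 ν ε β' hε h0 h1)) (hZ2 := (fun x hM α₀ hα ha U hU hU' => ⟨((hDV x (hMDv'.trans hM) α₀ hα ha U hU hU').1).mono (kernel_mono (hgeoOK x) hBZv hBF7 le_rfl), ((hGT x (hMz'.trans hM) α₀ hα ha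 U hU hU').1).mono (kernel_mono (hgeoOK x) hBz hBF6 le_rfl)⟩)) (hQsco12 := hQsco12) (hCco12 := hCco12) (hC1co12 := hC1co12) (hδ₃₀ := hδ₃₀.le) (h26 := s3132) (hG0e := (fun x hM α₀ hα ha U hU hU' => (hmodel12 x (hM0le.trans hM) α₀ hα (ha.trans haZ0) U hU hU').1)) (hQco12 := hQco12) (hM12q := by rw [show δ12₃ * (2 * ((θ.ℓ₆ : ℝ) + 1) ^ 2 - 1) * M₀' = M₀' * (δ12₃ * (2 * ((θ.ℓ₆ : ℝ) + 1) ^ 2 - 1)) from by ring]; exact (div_le_iff₀ hq12c).1 hMq') (hB12₃q := hBF4) (hrgd2_13 := (fun x hM α₀ hα ha U hU hU' => (hr2 x (hMr2'.trans hM) α₀ hα (ha.trans (le_min (le_min (haaZ.trans ha12T) (haaZ.trans ha43T)) (le_min (haaZ.trans ha31T) (haaZ.trans ha49T)))) U hU hU' (hids x (hM0le.trans hM) α₀ hα ha U hU hU').2).mono (kernel_mono (hgeoOK x) hCA30 hBF3 le_rfl))) (hwGp13 := (fun x hM α₀ hα ha => hwGp13 x hM α₀ hα ha)) (hADB12 :=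 hBF2) (h152 := (fun x hM α₀ hα ha U hU hU' => (hids x (hM0le.trans hM) α₀ hα ha U hU hU').2))
      (hrgdH13 := (fun x hM α₀ hα ha U hU hU' => (hrgdH x hM α₀ hα ha U hU hU').mono (kernel_mono (hgeoOK x) hB12₃ hBF1 le_rfl))) (hdgDH13 := (fun x hM α₀ hα ha U hU hU' => ((hDg x ((hMDgT.trans (hMM.trans hM0le)).trans hM) α₀ hα (ha.trans haaG) U hU hU').2).mono (kernel_mono (hgeoOK x) hB12₃ hBF1 le_rfl))) (hlettersDM13 := (fun x hM α₀ hα ha U hU hU' => letters313DMZ_mono (hgeoOK x) (hB12₃.trans (le_max_left B12₃ Bd)) (max_le hBF1 hBF5) (fun β _ _ => hBQ β) (fun _ _ _ => le_rfl) le_rfl (hDMQ x U (hDMZ x hM α₀ hα ha U hU hU')))) (θS := θS) (κS := κ13) (A₀S := A₀S) (AW := AWS) (AQ := AQS) (AD := ADS) (AQ1 := AQ1S) (CR := CRS) (δP := δP) (AI := AIS) (AV := AVS) (hθS := hθS) (hκS := (by show (1 : ℝ) ≤ 1 + CLip θ.d₆ θ.ℓ₆; linarith [CLip_nonneg θ.d₆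 θ.ℓ₆])) (hκ13S := (max_le le_rfl (by show (1 : ℝ) ≤ 1 + CLip θ.d₆ θ.ℓ₆; linarith [CLip_nonneg θ.d₆ θ.ℓ₆]))) (hA₀S := hA₀S) (hAW := hAWS) (hAQ := hAQS) (hAD := hADS)
      (hAQ1 := hAQ1S) (hCR := hCRS) (hAI := hAIS) (hAV := hAVS) (hρP12 := hρP12) (hδP₀ := (by linarith)) (hδP₃ := (by linarith)) (he1 := (fun x hM α₀ hα ha => he1G x (hM0le.trans hM) α₀ hα (ha.trans haZ0))) (hdomX := (fun x ε hε => by simp only [hbHXA x]; exact exists_l1_control_bHK x.toKIdx (bI x) ε)) (hdomW := (fun x U ε hε => by letI : Fintype (B9GeoNormsKLevelV1.geo9K x.toKIdx).Site := (inferInstance : Fintype (geo9Y x).Site); simp only [hbHXT x U]; exact exists_l1_control_bHZPIfam x.toKIdx (trBasis N) (B9SmoothHolderClassTClosure.abs_cf_eq_nKT x.toKIdx x.hcfk) (taxiS x.toKIdx (𝔅 x) (fun U => U) U) ε)) (hst20 := (fun x hM α₀ hα ha U hU hU' => (hST x (hMTS.trans hM) α₀ hα ha U hU hU').1)) (hst10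 := (fun x hM α₀ hα ha U hU hU' => (hST x (hMTS.trans hM) α₀ hα ha U hU hU').2.1)) (hst21 := (fun x hM α₀ hα ha U hU hU' => (hST x (hMTS.trans hM) α₀ hα ha U hU hU').2.2.1))
      (hst11 := (fun x hM α₀ hα ha U hU hU' => (hST x (hMTS.trans hM) α₀ hα ha U hU hU').2.2.2))
  have s349 : B9.Stmt349Printed (θ.d₆ + 1) c geo9Y (bg9YR (Matrix (Fin N) (Fin N) ℂ) (specialUnitaryUnits (Fin N)) R₁ R₂) (fun x => fineKernelR R₁ R₂ ((opsYNuStOfRecordV4PE N θ.toStage3Params Mstar 𝔯 (sectEStYOfRecordV7 N θ.toStage3Params Mstar 𝔢₀) 𝔴 𝔈) x).P349) :=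
    s349_site_of_t37_display348_of_R θ.toStage3Params Mstar R₁ R₂ hGR (lettersYOfRecordV4P N θ.toStage3Params Mstar 𝔯) (fun _ => rfl) (fun _ => rfl) (trBasis N) hlev hβ1 (hnbr_two_of_le hM₀) 𝔬 rd H hp t37' hblkS hblkYS hGpS hDS hc hB39.le (hr39.trans_le hrδ39) ha39 hM39 h348
  have h37f : (fun x => rwExpansionR R₁ R₂ ((opsYNuStOfRecordV4PE N θ.toStage3Params Mstar 𝔯 (sectEStYOfRecordV7 N θ.toStage3Params Mstar 𝔢₀) 𝔴 𝔈) x).E37) = fun x => E37YPairMDir (bg := bg9YR (Matrix (Fin N) (Fin N) ℂ) (specialUnitaryUnits (Fin N)) R₁ R₂) (2 * (θ.d₆ + 1)) (nbrCountY θ.d₆ θ.ℓ₆ θ.hd' θ.hL' θ.b₀ θ.b₁ 2) (Real.sqrt ((θ.d₆ + 1) * Fintype.card (TrIdx N))) ((θ.d₆ + 1 : ℕ) : ℝ) p q (⟨p3.N3, 2 * p3.B3, 0⟩ : PairPrims) (⟨q3.N3, 2 * q3.B3, 0⟩ : PairPrims) pM qM (𝔬 x) (𝔡 x) (𝔩 x)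 (rd x) (H x)
      (kernelFamilyR R₁ R₂ ((opsYNuStOfRecordV4PE N θ.toStage3Params Mstar 𝔯 (sectEStYOfRecordV7 N θ.toStage3Params Mstar 𝔢₀) 𝔴 𝔈) x).Gp) := funext hE37
  have h310f : (fun x => rwExpansionR R₁ R₂ ((opsYNuStOfRecordV4PE N θ.toStage3Params Mstar 𝔯 (sectEStYOfRecordV7 N θ.toStage3Params Mstar 𝔢₀) 𝔴 𝔈) x).E310) = fun x => E310YPairM (bg := bg9YR (Matrix (Fin N) (Fin N) ℂ) (specialUnitaryUnits (Fin N)) R₁ R₂) (2 * (θ.d₆ + 1)) (nbrCountY θ.d₆ θ.ℓ₆ θ.hd' θ.hL' θ.b₀ θ.b₁ 2) (Real.sqrt ((θ.d₆ + 1) * Fintype.card (TrIdx N))) ((θ.d₆ + 1 : ℕ) : ℝ) p q (⟨p3.N3, 2 * p3.B3, 0⟩ : PairPrims) (⟨q3.N3, 2 * q3.B3, 0⟩ : PairPrims) pM qM (𝔬A x) (rdA x) (H x)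
      (kernelFamilyR R₁ R₂ ((opsYNuStOfRecordV4PE N θ.toStage3Params Mstar 𝔯 (sectEStYOfRecordV7 N θ.toStage3Params Mstar 𝔢₀) 𝔴 𝔈) x).GA) := funext hE310
  have t37 : B9.Thm37Printed c geo9Y (bg9YR (Matrix (Fin N) (Fin N) ℂ) (specialUnitaryUnits (Fin N)) R₁ R₂) (fun x => rwExpansionR R₁ R₂ ((opsYNuStOfRecordV4PE N θ.toStage3Params Mstar 𝔯 (sectEStYOfRecordV7 N θ.toStage3Params Mstar 𝔢₀) 𝔴 𝔈) x).E37) := h37f ▸ t37'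
  have c38 : B9.Cor38Printed c geo9Y (bg9YR (Matrix (Fin N) (Fin N) ℂ) (specialUnitaryUnits (Fin N)) R₁ R₂) (fun x => rwExpansionR R₁ R₂ ((opsYNuStOfRecordV4PE N θ.toStage3Params Mstar 𝔯 (sectEStYOfRecordV7 N θ.toStage3Params Mstar 𝔢₀) 𝔴 𝔈) x).E37) := h37f ▸ c38'
  have t310 : B9.Thm310Printed c geo9Y (bg9YR (Matrix (Fin N) (Fin N) ℂ) (specialUnitaryUnits (Fin N)) R₁ R₂) (fun x => rwExpansionR R₁ R₂ ((opsYNuStOfRecordV4PE N θ.toStage3Params Mstar 𝔯 (sectEStYOfRecordV7 N θ.toStage3Params Mstar 𝔢₀) 𝔴 𝔈) x).E310) := h310f ▸ t310'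
  have hsum : B9.RWSumsYieldIneqs geo9Y (bg9YR (Matrix (Fin N) (Fin N) ℂ) (specialUnitaryUnits (Fin N)) R₁ R₂) (fun x => rwExpansionR R₁ R₂ ((opsYNuStOfRecordV4PE N θ.toStage3Params Mstar 𝔯 (sectEStYOfRecordV7 N θ.toStage3Params Mstar 𝔢₀) 𝔴 𝔈) x).E37) (fun x => rwExpansionR R₁ R₂ ((opsYNuStOfRecordV4PE N θ.toStage3Params Mstar 𝔯 (sectEStYOfRecordV7 N θ.toStage3Params Mstar 𝔢₀) 𝔴 𝔈) x).E310)
      (fun x => kernelFamilyR R₁ R₂ ((opsYNuStOfRecordV4PE N θ.toStage3Params Mstar 𝔯 (sectEStYOfRecordV7 N θ.toStage3Params Mstar 𝔢₀) 𝔴 𝔈) x).Gp) (fun x => kernelFamilyR R₁ R₂ ((opsYNuStOfRecordV4PE N θ.toStage3Params Mstar 𝔯 (sectEStYOfRecordV7 N θ.toStage3Params Mstar 𝔢₀) 𝔴 𝔈) x).GA) := by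
    rw [h37f, h310f]; exact hsum'
  have hE4 := hE4_of_hGA_e4 (opsYNuStOfRecordV4PE N θ.toStage3Params Mstar 𝔯 (sectEStYOfRecordV7 N θ.toStage3Params Mstar 𝔢₀) 𝔴 𝔈) (hGA_e4_opsYOfLetters N θ.toStage3Params Mstar (lettersYOfRecordV4P N θ.toStage3Params Mstar 𝔯) 𝔈)
  have hH2 := hH2_of_hGA_h2 (opsYNuStOfRecordV4PE N θ.toStage3Params Mstar 𝔯 (sectEStYOfRecordV7 N θ.toStage3Params Mstar 𝔢₀) 𝔴 𝔈) (hGA_h2_opsYOfLetters N θ.toStage3Params Mstar (lettersYOfRecordV4P N θ.toStage3Params Mstar 𝔯) 𝔈)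
  have h1U : ClassIncl (regC335 (Matrix (Fin N) (Fin N) ℂ) (specialUnitaryUnits (Fin N)) (extraYPb (Matrix (Fin N) (Fin N) ℂ) (specialUnitaryUnits (Fin N)))) c35Y R₁ c := fun x α₀ U hα h => hP1 x α₀ U hα (classIncl_regC335Pb_regYPb335 c35Y c35Y x α₀ U hα h).2
  have h2U : ClassIncl (regC336 (Matrix (Fin N) (Fin N) ℂ) (specialUnitaryUnits (Fin N)) (extraYPb (Matrix (Fin N) (Fin N) ℂ) (specialUnitaryUnits (Fin N)))) c35Y R₂ c := fun x α₀ U hα h => hP2 x α₀ U hα (classIncl_regC336Pb_regYPb336 c35Y c35Y x α₀ U hα h).2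
  have honeU : ∀ (j : J) (α₀ : ℝ), 0 < α₀ → regC335 (Matrix (Fin N) (Fin N) ℂ) (specialUnitaryUnits (Fin N)) (extraYPb (Matrix (Fin N) (Fin N) ℂ) (specialUnitaryUnits (Fin N))) (f j) c35Y α₀ (bg9YC (Matrix (Fin N) (Fin N) ℂ) (specialUnitaryUnits (Fin N)) (extraYPb (Matrix (Fin N) (Fin N) ℂ) (specialUnitaryUnits (Fin N))) (f j)).one :=
    fun j α₀ hα => classIncl_regYPb335_regC335Pb c35Y c35Y (f j) α₀ _ hα ⟨hα.le, regYP335_one (x := f j) c35Y hα⟩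
  have hBU := fun h32 h33 => sectBStepU_C37GY_su_extraYPb_closed θ.toStage3Params Mstar f bR ιB C38 hN hι hM₀B h32 h33
  show B9LeafX (carriersYU (extraYPb (Matrix (Fin N) (Fin N) ℂ) (specialUnitaryUnits (Fin N))) (specialUnitaryUnits (Fin N)) f bR ιB C38 (opsYNuStOfRecordV4PE N θ.toStage3Params Mstar 𝔯 (sectEStYOfRecordV7 N θ.toStage3Params Mstar 𝔢₀) 𝔴 𝔈))
  exact b9LeafX_carriersYU (extraYPb (Matrix (Fin N) (Fin N) ℂ) (specialUnitaryUnits (Fin N))) (specialUnitaryUnits (Fin N)) f C38 bR ιB (opsYNuStOfRecordV4PE N θ.toStage3Params Mstar 𝔯 (sectEStYOfRecordV7 N θ.toStage3Params Mstar 𝔢₀) 𝔴 𝔈) θ.δ₀ _ _ honeU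
    (hGp_e_opsYOfLetters N θ.toStage3Params Mstar (lettersYOfRecordV4P N θ.toStage3Params Mstar 𝔯) 𝔈) (hGp_h1_opsYOfLetters N θ.toStage3Params Mstar (lettersYOfRecordV4P N θ.toStage3Params Mstar 𝔯) 𝔈)
    (hC_opsYOfLetters N θ.toStage3Params Mstar (lettersYOfRecordV4P N θ.toStage3Params Mstar 𝔯) 𝔈) (hGA_e_opsYOfLetters N θ.toStage3Params Mstar (lettersYOfRecordV4P N θ.toStage3Params Mstar 𝔯) 𝔈)
    (hGA_h1_opsYOfLetters N θ.toStage3Params Mstar (lettersYOfRecordV4P N θ.toStage3Params Mstar 𝔯) 𝔈) (hGA_e4_opsYOfLetters N θ.toStage3Params Mstar (lettersYOfRecordV4P N θ.toStage3Params Mstar 𝔯) 𝔈)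
    (hGA_h2_opsYOfLetters N θ.toStage3Params Mstar (lettersYOfRecordV4P N θ.toStage3Params Mstar 𝔯) 𝔈) (hGA_l2_opsYOfLetters N θ.toStage3Params Mstar (lettersYOfRecordV4P N θ.toStage3Params Mstar 𝔯) 𝔈)
    hE4 hH2 (residualGpAtOne_R (fun x => ((opsYNuStOfRecordV4PE N θ.toStage3Params Mstar 𝔯 (sectEStYOfRecordV7 N θ.toStage3Params Mstar 𝔢₀) 𝔴 𝔈) x).Gp) hGp) (residualGAGlobAtOne_R (fun x => ((opsYNuStOfRecordV4PE N θ.toStage3Params Mstar 𝔯 (sectEStYOfRecordV7 N θ.toStage3Params Mstar 𝔢₀) 𝔴 𝔈) x).GA) hGA) (fun _ => rfl) (fun _ => rfl) (fun _ => rfl) hBU (thm37Printed_antitone (R₂ := (regC336 (Matrix (Fin N) (Fin N) ℂ) (specialUnitaryUnits (Fin N)) (extraYPb (Matrix (Fin N) (Fin N) ℂ) (specialUnitaryUnits (Fin N))))) (R₂' := R₂) h1U (fun x => ((opsYNuStOfRecordV4PE N θ.toStage3Params Mstar 𝔯 (sectEStYOfRecordV7 N θ.toStage3Params Mstar 𝔢₀)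 𝔴 𝔈) x).E37) t37) (cor38Printed_antitone (R₂ := (regC336 (Matrix (Fin N) (Fin N) ℂ) (specialUnitaryUnits (Fin N)) (extraYPb (Matrix (Fin N) (Fin N) ℂ) (specialUnitaryUnits (Fin N))))) (R₂' := R₂) h1U (fun x => ((opsYNuStOfRecordV4PE N θ.toStage3Params Mstar 𝔯 (sectEStYOfRecordV7 N θ.toStage3Params Mstar 𝔢₀) 𝔴 𝔈) x).E37) c38)
    (thm39Printed_antitone (R₂ := (regC336 (Matrix (Fin N) (Fin N) ℂ) (specialUnitaryUnits (Fin N)) (extraYPb (Matrix (Fin N) (Fin N) ℂ) (specialUnitaryUnits (Fin N))))) (R₂' := R₂) h1U (fun x => ((opsYNuStOfRecordV4PE N θ.toStage3Params Mstar 𝔯 (sectEStYOfRecordV7 N θ.toStage3Params Mstar 𝔢₀) 𝔴 𝔈) x).EK39) t39) (thm310Printed_antitone (R₂ := (regC336 (Matrix (Fin N) (Fin N) ℂ) (specialUnitaryUnits (Fin N)) (extraYPb (Matrix (Fin N) (Fin N) ℂ) (specialUnitaryUnits (Fin N))))) (R₂' := R₂) h1U (fun x => ((opsYNuStOfRecordV4PE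 N θ.toStage3Params Mstar 𝔯 (sectEStYOfRecordV7 N θ.toStage3Params Mstar 𝔢₀) 𝔴 𝔈) x).E310) t310) (rwSumsYieldIneqs_R (fun x => ((opsYNuStOfRecordV4PE N θ.toStage3Params Mstar 𝔯 (sectEStYOfRecordV7 N θ.toStage3Params Mstar 𝔢₀) 𝔴 𝔈) x).E37) (fun x => ((opsYNuStOfRecordV4PE N θ.toStage3Params Mstar 𝔯 (sectEStYOfRecordV7 N θ.toStage3Params Mstar 𝔢₀) 𝔴 𝔈) x).E310) (fun x => ((opsYNuStOfRecordV4PE N θ.toStage3Params Mstar 𝔯 (sectEStYOfRecordV7 N θ.toStage3Params Mstar 𝔢₀) 𝔴 𝔈) x).Gp) (fun x => ((opsYNuStOfRecordV4PE N θ.toStage3Params Mstar 𝔯 (sectEStYOfRecordV7 N θ.toStage3Params Mstar 𝔢₀) 𝔴 𝔈) x).GA) hsum)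
    (rwKernelSumYields_R (fun x => ((opsYNuStOfRecordV4PE N θ.toStage3Params Mstar 𝔯 (sectEStYOfRecordV7 N θ.toStage3Params Mstar 𝔢₀) 𝔴 𝔈) x).EK39) (fun x => ((opsYNuStOfRecordV4PE N θ.toStage3Params Mstar 𝔯 (sectEStYOfRecordV7 N θ.toStage3Params Mstar 𝔢₀) 𝔴 𝔈) x).Cinv) hksum) (thm311Printed_antitone (R₂ := (regC336 (Matrix (Fin N) (Fin N) ℂ) (specialUnitaryUnits (Fin N)) (extraYPb (Matrix (Fin N) (Fin N) ℂ) (specialUnitaryUnits (Fin N))))) (R₂' := R₂) h1U (fun x => ((opsYNuStOfRecordV4PE N θ.toStage3Params Mstar 𝔯 (sectEStYOfRecordV7 N θ.toStage3Params Mstar 𝔢₀) 𝔴 𝔈) x).PosDef) t311) (thm312Printed_antitone h1U h2U (fun x => ((opsYNuStOfRecordV4PE N θ.toStage3Params Mstar 𝔯 (sectEStYOfRecordV7 N θ.toStage3Params Mstar 𝔢₀) 𝔴 𝔈) x).GD) (fun x => ((opsYNuStOfRecordV4PE N θ.toStage3Params Mstar 𝔯 (sectEStYOfRecordV7 N θ.toStage3Params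 Mstar 𝔢₀) 𝔴 𝔈) x).G₁) (fun x => ((opsYNuStOfRecordV4PE N θ.toStage3Params Mstar 𝔯 (sectEStYOfRecordV7 N θ.toStage3Params Mstar 𝔢₀) 𝔴 𝔈) x).H) (fun x => ((opsYNuStOfRecordV4PE N θ.toStage3Params Mstar 𝔯 (sectEStYOfRecordV7 N θ.toStage3Params Mstar 𝔢₀) 𝔴 𝔈) x).H₁) (fun x => ((opsYNuStOfRecordV4PE N θ.toStage3Params Mstar 𝔯 (sectEStYOfRecordV7 N θ.toStage3Params Mstar 𝔢₀) 𝔴 𝔈) x).HasRWExp) (fun x => ((opsYNuStOfRecordV4PE N θ.toStage3Params Mstar 𝔯 (sectEStYOfRecordV7 N θ.toStage3Params Mstar 𝔢₀) 𝔴 𝔈) x).HasRWExpH) (fun x => ((opsYNuStOfRecordV4PE N θ.toStage3Params Mstar 𝔯 (sectEStYOfRecordV7 N θ.toStage3Params Mstar 𝔢₀) 𝔴 𝔈) x).PosDefK) t312)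
    (thm313Printed_antitone h1U h2U (fun x => ((opsYNuStOfRecordV4PE N θ.toStage3Params Mstar 𝔯 (sectEStYOfRecordV7 N θ.toStage3Params Mstar 𝔢₀) 𝔴 𝔈) x).GG) (fun x => ((opsYNuStOfRecordV4PE N θ.toStage3Params Mstar 𝔯 (sectEStYOfRecordV7 N θ.toStage3Params Mstar 𝔢₀) 𝔴 𝔈) x).HasRWExp) (fun x => ((opsYNuStOfRecordV4PE N θ.toStage3Params Mstar 𝔯 (sectEStYOfRecordV7 N θ.toStage3Params Mstar 𝔢₀) 𝔴 𝔈) x).PosDefK) t313) (thm314Printed_antitone (R₂ := (regC336 (Matrix (Fin N) (Fin N) ℂ) (specialUnitaryUnits (Fin N)) (extraYPb (Matrix (Fin N) (Fin N) ℂ) (specialUnitaryUnits (Fin N))))) (R₂' := R₂) h1U (fun x => ((opsYNuStOfRecordV4PE N θ.toStage3Params Mstar 𝔯 (sectEStYOfRecordV7 N θ.toStage3Params Mstar 𝔢₀) 𝔴 𝔈) x).Kdiff) dOmegaY t314) (thm315FullPrinted_antitone h1U h2U (fun x => ((opsYNuStOfRecordV4PE N θ.toStage3Params Mstar 𝔯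 (sectEStYOfRecordV7 N θ.toStage3Params Mstar 𝔢₀) 𝔴 𝔈) x).Ck) inΛY unitDistY (fun x => ((opsYNuStOfRecordV4PE N θ.toStage3Params Mstar 𝔯 (sectEStYOfRecordV7 N θ.toStage3Params Mstar 𝔢₀) 𝔴 𝔈) x).GivenBy3185) (fun x => ((opsYNuStOfRecordV4PE N θ.toStage3Params Mstar 𝔯 (sectEStYOfRecordV7 N θ.toStage3Params Mstar 𝔢₀) 𝔴 𝔈) x).HasRWExpC) t315)
    (stmt349Printed_antitone (R₂ := (regC336 (Matrix (Fin N) (Fin N) ℂ) (specialUnitaryUnits (Fin N)) (extraYPb (Matrix (Fin N) (Fin N) ℂ) (specialUnitaryUnits (Fin N))))) (R₂' := R₂) h1U (fun x => ((opsYNuStOfRecordV4PE N θ.toStage3Params Mstar 𝔯 (sectEStYOfRecordV7 N θ.toStage3Params Mstar 𝔢₀) 𝔴 𝔈) x).P349) s349) (stmt3132Printed_antitone h1U h2U (fun x => ((opsYNuStOfRecordV4PE N θ.toStage3Params Mstar 𝔯 (sectEStYOfRecordV7 N θ.toStage3Params Mstar 𝔢₀) 𝔴 𝔈) x).QGQinv)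 (fun x => ((opsYNuStOfRecordV4PE N θ.toStage3Params Mstar 𝔯 (sectEStYOfRecordV7 N θ.toStage3Params Mstar 𝔢₀) 𝔴 𝔈) x).QG1Qinv) s3132) (thm314LocalPrinted_antitone (R₂ := (regC336 (Matrix (Fin N) (Fin N) ℂ) (specialUnitaryUnits (Fin N)) (extraYPb (Matrix (Fin N) (Fin N) ℂ) (specialUnitaryUnits (Fin N))))) (R₂' := R₂) h1U (fun x => ((opsYNuStOfRecordV4PE N θ.toStage3Params Mstar 𝔯 (sectEStYOfRecordV7 N θ.toStage3Params Mstar 𝔢₀) 𝔴 𝔈) x).Kdiff) OmKY dOmegaY t314loc) (b6BlockParam_D6OfRecord θ.toStage3Params hθ.1.1.1.1.1)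

end Pointed
end Summit.QuantumFields.YangMills.BalabanUVNodes.N06AtOpsYNuOfRecordV6EPairVL
end
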